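import Mathlib
import HarnessLib
import Literature.MathematicalPhysics.QuantumFieldTheory.Balaban1983to89.B12JacobianReal267
import Literature.MathematicalPhysics.QuantumFieldTheory.Balaban1983to89.B13HaarSigmaJacobian
import Literature.MathematicalPhysics.QuantumFieldTheory.Balaban1983to89.B12Def267Covariance
import Literature.Analysis.Calculus.ContDiffCodRestrict
import Literature.MathematicalPhysics.QuantumFieldTheory.Balaban1983to89.B12Average012Periodicity

/-!
# B12 [Balaban1987RG1] (2.16) p. 269 for the two MEASURE-BORN terms of (2.12) p. 268 — «Tr log(I − h((δ/δB)D̃)(g_kCB))»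
# and «log σ(g_kCB − hD̃(g_kCB))»: the linearizing change of variables `Φ(B) = B − hD̃(B)` of p. 267 is GAUGE-EQUIVARIANT
# (by the UNIQUENESS of `D̃`), its Jacobian operator `DΦ = I − h∘DD̃` CONJUGATES by the (2.16) isometry, the operator
# logarithm conjugates with it, and `Tr log DΦ`, `det DΦ` and `σ ∘ Φ` are INVARIANT

statement-level skeleton of published theorems with citation tags; proofs where landed; nothing here is a claim about
the Yang–Mills mass gap

CITATION HEADER (lean-in-tree rule 2026-08-18).  T. Bałaban, *Renormalization group approach to lattice gauge field
theories. I. Generation of effective actions in a small field approximation and a coupling constant renormalization in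
four dimensions*, Commun. Math. Phys. **109** (1987) 249–301 [Balaban1987RG1] («B12» of the cell; PDF page = journal
page − 248; PDF held: `paper:balaban1987-cmp109-rg-i-small-field`, text layer pp. 267–269 = `p0019.txt`–`p0021.txt` read
first-hand by the writing seat 2026-08-24).  Unit `lit-balaban-r20` gen 49 (literature-prover-lit-balaban-r20-g49-0; B12
fold owner; free-target protocol G.5-34(d), TAKING line HOME/STATUS 2026-08-24T02:38Z); v1.1 (§6) gen 51
(literature-prover-lit-balaban-r20-g51-0, TAKING line HOME/STATUS 2026-08-24, APPEND-ONLY: §§1–5 unchanged); v1.2 (§7) gen 52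
(literature-prover-lit-balaban-r20-g52-0, TAKING line HOME/STATUS 2026-08-24, APPEND-ONLY: §§1–6 unchanged, +1 import
`B12Def267Covariance` (r09)); v1.3 (§8) gen 52 (same seat, TAKING #2 line HOME/STATUS 2026-08-24, APPEND-ONLY: §§1–7 unchanged,
no new import); v1.4 (§9) gen 52 (same seat, TAKING #3 line HOME/STATUS 2026-08-24, APPEND-ONLY: §§1–8 unchanged, +1 import
`Literature.Analysis.Calculus.ContDiffCodRestrict`); v1.5 (§10) gen 53 (literature-prover-lit-balaban-r20-g53-0, TAKING #1 line
HOME/STATUS 2026-08-24, APPEND-ONLY: §§1–9 unchanged, +1 import `B12Average012Periodicity` (r09: `shiftE`, `blockBase_add`));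
display rows B12.Eq0.1 ∕ B12.Eq2.17-2.18 (r09) in addition; display rows B12.Eq2.12 ∕ B12.Eq2.16
of `HOME/lit-balaban-r09/ROWS-B12.md` (owner r09), coarse row B12.Eq2.13 «§2 (2.12)–(2.15)» of
`HOME/lit-balaban-r20/ROWS-B12.md`; HOME `run/shared/lean/pub/lit-balaban/`.

THE PRINT (verbatim).  p. 267 [PDF 19]: *«We are looking for an analytic, 𝐠-valued function D̃(B′), defined at bonds
of T⁽ᵏ⁺¹⁾, and such that the transformation B′ = B − hD̃(B) linearizes the function Q̃(B′). The function D̃(B) is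
determined by the equation LQ̃B′ + C̃(B′) = LQ̃B − D̃(B) + C̃(B − hD̃(B)) = LQ̃B. It is easy to prove, following the
proofs in the above mentioned papers, that there exists exactly one solution of this equation, and that it is an
analytic function of B.»*  p. 268 [PDF 20], (2.12): the fluctuation integral
`log N_k″⁻¹ ∫ dμ_{C⁽ᵏ⁾}(B) χ_k exp[Tr log(I − h((δ/δB)D̃)(g_kCB)) + log σ(g_kCB − hD̃(g_kCB)) + … ]` and *«The expression
under the exponential is clearly a sum of two terms, one is connected with the expansion of the action … and the measure
in (2.1), and we denote it by 𝐏⁽ᵏ⁾(g_k, U_{k+1}, B)»*.  p. 269 [PDF 21]: *«The gauge invariance was discussed already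
several times in the previous papers, so let us recall only that all the expressions in (2.12), together with the
measure, are invariant with respect to the gauge transformations*  `U_{k+1} → U^u_{k+1},  B′ → R(u)B′,
(R(u)B′)(b) = R(u(b₋))B′(b).  (2.16)`  *The characteristic function is invariant with respect to the transformations of
the fluctuation field B′, because they are local, orthogonal transformations; therefore the expression (2.13) is gauge
invariant.»*

WHY THIS FILE (cell `B12-CLOSURE.md` Amendment gen 48 (c), the NAMED residual of the (2.16) ledger): the cell's (2.16)
theorems (`B12Eq213Body268` §§3–8, `B12Eq216GaussianCarrier`) take the invariance of `𝐏⁽ᵏ⁾` as ONE binder `hP`; of its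
letters, `G`, `h∕C̃∕D̃` (algebra), `V₀` are covariant on their carriers by landed theorems, but the two MEASURE-BORN terms
— the Jacobian `Tr log(I − h(δD̃/δB))` of the substitution `B′ = B − hD̃(B)` and the Haar density `log σ` evaluated AFTER
the substitution — were «not assembled»: their invariance needs the EQUIVARIANCE OF THE SOLUTION `D̃` of the p. 267
fixed-point equation, which is exactly what «exactly one solution» delivers.  The sibling `B12JacobianReal267` proves the
same mechanism for the ANTILINEAR involution (complex conjugation: `D̃` is 𝐠-valued); this file is its LINEAR-ISOMETRY
twin, written for TWO systems (the letters at `U_{k+1}` and at `U^u_{k+1}` differ).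

THE TYPING (hypothesis style, carriers OF RECORD of `B12Lineariz267` ∕ `B12LinearizAnalytic267` ∕ `B12JacobianTrLog268`,
nothing re-declared; cell DIVERGENCE row for this file = that of `B12JacobianReal267`).  `𝒴`, `𝒳` complex Banach spaces
(the 𝐠ᶜ-valued functions on the bonds of `T⁽ᵏ⁾`, `T⁽ᵏ⁺¹⁾`); a SYSTEM is `(hop, Ct, Dt)` = print's `(h, C̃, D̃)` at one
background with the standing hypotheses `‖hX‖ ≤ b‖X‖`, `QuadAnalytic C̃ C₂ R`, `AnalyticOnNhd ℂ C̃ {‖Y‖ < R}`,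
`9C₂bε < 1` (`≤ 1/2` where the logarithm is taken), `3ε ≤ R`, and `D̃` ANY solution valued in the closed ball `4C₂ε²` on
`‖B‖ < ε`; the primed system `(hop′, Ct′, Dt′)` is the same at the transformed background, with the SAME constants (print's
constants do not depend on the background).  The (2.16) maps are continuous linear equivalences `U : 𝒴 ≃L[ℂ] 𝒴`,
`V : 𝒳 ≃L[ℂ] 𝒳` with `‖UY‖ = ‖Y‖`, `‖VX‖ = ‖X‖` («orthogonal transformations»; the complexified `R(u)` acting bondwise
by `Ad`), and the COVARIANCE OF THE LETTERS enters as the two binders `hop′(VX) = U(hop X)` and `Ct′(UY) = V(Ct Y)` on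
`‖Y‖ < R` (for print's objects: the covariance of `h` = of `LQ̃`, and of `C̃` = of `Q̃`, [13] (3.32)-shape statements —
rows B12.Def@267 ∕ B9; on r09's ℤᵈ corner-cube carrier BOTH binders are landed theorems,
`B12Def267Covariance.hOp_hAverage_gaugeTransformZd` (h) and `Ctilde_gaugeTransformZd` (C̃ = Q̃ − LQ̃), and the ℤᵈ
INSTANCE of §2's equivariance `D̃[V^u](R(u)B) = R(u)D̃_V(B)` is his `B12Def267Covariance.Dtilde_gaugeTransformZd` (r09 g45,
(2.16) as the ℓ^∞ isometry `rotBF`) — not imported: this file keeps the abstract carrier of the Jacobian lineage and adds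
what that file does not have, the consequences for `DΦ`, `Tr log DΦ`, `det DΦ` and `σ∘Φ`; the binders are NOT discharged
here).

CONTENTS.  §1 [folklore] GENERIC: in a complete normed ℂ-algebra, conjugation by a unit commutes with the operator
logarithm of the tree (`MatrixLog.mlog`, [Balaban1985Averaging] (21)) on `‖X − 1‖ < 1` (`mlog_units_conj`: the series
`MatrixLog.hasSum_mlog` mapped through the continuous linear map `T ↦ uTu⁻¹`, termwise `Units.conj_pow`); in `𝒴 →L[ℂ] 𝒴`,
`Tr(UTU⁻¹) = Tr T` (finite dimension, `LinearMap.trace_comp_comm'`) and `det(UTU⁻¹) = det T` (`LinearMap.det_comp`) for a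
continuous linear equivalence `U` (`trace_conj_eq`, `det_conj_eq`), and `log(U(1 − J)U⁻¹) = U log(1 − J) U⁻¹`
(`mlog_one_sub_conj`).  §2 [folklore] EQUIVARIANCE: **`Dt_gauge`** `D̃′(UB) = VD̃(B)` on `‖B‖ < ε` — `VD̃(B)` solves the
primed equation in the same ball, hence equals `D̃′(UB)` by `B12Lineariz267.eq_Dt_of_fixedPt` («exactly one solution»);
`phi_gauge` `Φ′(UB) = UΦ(B)`; **`fderiv_Dt_gauge`** `DD̃′(UB₀) = V∘DD̃(B₀)∘U⁻¹` (near `UB₀` the primed solution IS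
`V∘D̃∘U⁻¹`, chain rule); `jacobianOp_gauge` `J′(UB₀) = U∘J(B₀)∘U⁻¹` for `J = h∘DD̃`; **`fderiv_phi_gauge`**
`DΦ′(UB₀) = U∘DΦ(B₀)∘U⁻¹`.  §3 [folklore] **`logJacobian_gauge`** `log DΦ′(UB₀) = U∘log DΦ(B₀)∘U⁻¹`,
**`trace_logJacobian_gauge`** `Tr log DΦ′(UB₀) = Tr log DΦ(B₀)` (finite dimension), **`det_fderiv_phi_gauge`**
`det DΦ′(UB₀) = det DΦ(B₀)`.  §4 [folklore] `sigma_phi_gauge`: `σ(Φ′(UB)) = σ(Φ(B))` for every `U`-invariant `σ` — the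
term «log σ(g_kCB − hD̃(g_kCB))»; for the Haar density in exponential coordinates the invariance of `σ` under the bondwise
`Ad`-action is r10's `B13HaarSigmaJacobian.det_jac_Adg` (cited in v1.0; IMPORTED in v1.1, whose §6 assembles the
product density from it).  §5 THREE TRANSCRIPTION THEOREMS [cite]:
`p269_gauge_invariance_measure_terms` (Banach part), `p269_gauge_invariance_TrLog_findim` (finite dimension), and
`p269_gauge_invariance_at_CB` — the statement AT THE ARGUMENT `g_kCB` of (2.12): under (2.16) the remaining variables
transform by the restriction `R_rem` of `R(u)` and the elimination map intertwines, `C(U^u)·R_rem = R(u)·C(U)` (own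
`B12Eq216GaussianCarrier.intertwine_of_elimination` ∕ `elimLin_intertwine`, in the chart; entered here as the binder
`g_kC′(R_rem B) = U(g_kC B)` for arbitrary argument maps) — plus a degenerate model (`U = V = −1` on `ℂ`) inhabiting every
hypothesis at once.  §6 (v1.1) [folklore] THE HAAR LETTER ASSEMBLED: for bond-coordinate maps `π_b : 𝒴 → 𝔤` (`𝔤` an
`ad`-stable finite-dimensional subspace of a normed ℂ-algebra `𝔸`) and print's (2.16) as the ONE hypothesis on `U`,
`π_b(UY) = u_b π_b(Y) u_b⁻¹` (bondwise `Ad`, r10's `B13HaarSigmaJacobian.Adg`), the Haar density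
`σ(Y) = ∏_b det jac(π_b Y)` (r10's `jac x = (1 − e^{−ad x})/ad x`, [Balaban1985UV3] p. 260) satisfies `σ(UY) = σ(Y)`
(`prod_det_jac_conj`, `det_jac_Adg` bond by bond) — the binder `hσ` of §4 DISCHARGED: **`sigma_phi_gauge_haar`**;
for the product carrier `(bonds → 𝔤)` the (2.16) map is `ContinuousLinearEquiv.piCongrRight` of the `Adg`
(`piAdg_apply`: the hypothesis by `rfl`) and an isometry of the sup norm for norm-one units (`norm_Adg_apply`,
`norm_piAdg`: the binder `hU`).  §7 (v1.2) (a) [folklore] §2's derivative identities WITHOUT the analyticity binder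
(`fderiv_Dt_gauge'`, `jacobianOp_gauge'`, `fderiv_phi_gauge'`, `det_fderiv_phi_gauge'`: near `UB₀` the primed maps ARE the
conjugated ones, and `fderiv` of a conjugate by continuous linear equivalences is the conjugate with no differentiability
hypothesis); (b) THE `ℤᵈ` JUNCTION: r09's (2.16) self-map `B12Def267Covariance.rotBF` of `ℓ^∞(bonds of ℤᵈ; 𝔸)` upgraded
to a continuous linear ISOMETRIC EQUIVALENCE **`rotBFL`** (with body), and §§2, 4 with EVERY binder discharged for the
letters `hfield` ∕ `Cfield` of `B12LinearizationGenuineZd` at `V` and `V^u` by r09's `quadAnalytic_Cfield` ∕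
`norm_hfield_le` ∕ `norm_rotBF` ∕ `hfield_gaugeTransformZd` ∕ `Cfield_gaugeTransformZd` ∕ `p267_genuine`:
**`Dt_gauge_genuineZd`**, **`phi_gauge_genuineZd`**, **`fderiv_phi_gauge_genuineZd`**, **`sigma_phi_gauge_genuineZd`**,
**`p269_measure_terms_genuineZd`** (the two `D̃`'s produced from `p267_genuine`; hypotheses = background regularity and
the radius conditions only), `exists_radius` and a full flat-background inhabitant.  §8 (v1.3) [folklore] TWO-CARRIER FORM: the primed
system on DIFFERENT Banach spaces `𝒳′`, `𝒴′` with `U : 𝒴 ≃L[ℂ] 𝒴′`, `V : 𝒳 ≃L[ℂ] 𝒳′` — print's carriers are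
background-indexed ([15] (115): the norm carries `∇^{U}`; the tree's `B11Eq115GaugeIsometry.gauge115Isometry` maps the space
at `U` onto the space at `U^u`), so the one-carrier typing of §§2–7 cannot host them: `Dt_gauge₂`, `phi_gauge₂`,
`fderiv_Dt_gauge₂` ∕ `jacobianOp_gauge₂` ∕ `fderiv_phi_gauge₂` ∕ **`det_fderiv_phi_gauge₂`** (no analyticity binder),
`mlog_one_sub_conj₂` (the operator logarithm crosses the carriers through the continuous algebra isomorphism `T ↦ UTU⁻¹`),
**`logJacobian_gauge₂`**, **`trace_logJacobian_gauge₂`** (`LinearMap.trace_conj'`), `det_conj_eq₂` (`LinearMap.det_conj`),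
`sigma_phi_gauge₂`; and `Dt_embed` ∕ `phi_embed`: ISOMETRIC EMBEDDINGS (not onto) suffice for the equivariance of `D̃`, `Φ` —
the restriction of the scheme to a closed invariant sub-carrier (e.g. periodic fields = print's torus) included.  §9 (v1.4)
[folklore] RESTRICTION TO A CLOSED INVARIANT SUB-CARRIER `W𝒳 ≤ 𝒳`, `W𝒴 ≤ 𝒴` (`h(W𝒳) ⊆ W𝒴`, `C̃(W𝒴) ⊆ W𝒳`, `W𝒳` closed —
binders): `quadAnalytic_subcarrier` (`C̃|` is `QuadAnalytic` with the same constants), `Dt_mem_subcarrier` ∕ `phi_mem_subcarrier`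
(the ambient `D̃`, `Φ` map the sub-carrier ball into the sub-carrier), `fderiv_Dt_mem_subcarrier` ∕ `jacobianOp_mem_subcarrier`
(`DD̃(B)` and `1 − h∘DD̃(B)` preserve it — no differentiability binder), `Dt_subcarrier_eq` ∕ `exists_Dt_subcarrier` (the sub-carrier
system's `D̃` exists and is the ambient one): the abstract road from r09's `ℓ^∞(ℤᵈ)` carrier to print's finite tori, on which §3 ∕ §6 apply.
§10 (v1.5) THE PERIODIC SUB-CARRIER = PRINT'S TORUS (0.1), CONCRETELY: `shiftBFL` ((2.17) translations as isometric equivalences of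
`ℓ^∞`), **`perBF d 𝔸 N`** (the `N`-periodic bond fields: closed `isClosed_perBF`, complete, translation- and (2.16)-stable
`shiftBFL_mem_perBF` ∕ `rotBFL_mem_perBF`, **finite-dimensional for finite-dimensional `𝔸`** `finiteDimensional_perBF`), the restricted
(2.16) ∕ (2.17) isometries `rotBFLPer` ∕ `shiftBFLPer`, and §§8–9 INSTANTIATED: `Dt_gauge_sub` ∕ `phi_gauge_sub` ∕ **`det_fderiv_phi_gauge_sub`**
∕ `trace_logJacobian_gauge_sub` (any closed invariant sub-carrier pair), **`det_fderiv_phi_gauge_per`** ∕ `Dt_gauge_per` (the torus), and for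
[I]'s genuine letters **`p269_det_genuineZd_per`** — THE JACOBIAN DETERMINANT OF (2.12) ON THE TORUS IS (2.16)-INVARIANT, with r09's
letters and covariances by name and only the two periodic-stability binders of `h_V`, `C̃_V` left (= their translation covariance).

HONEST SCOPE.  (i) Which operators realise print's `h`, `C̃` (hence `D̃`) and their (2.16) covariance are rows
B12.Def@267 ∕ B12.Eq2.11 ∕ B9 and r09's ℤᵈ lineage (`B12Def267Covariance`, where they are theorems) — BINDERS here, as
is the invariance of `σ` in §§4–5 (discharged in §6 for the Haar density `∏_b det jac(π_b ·)` under every `U` acting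
bondwise by `Ad`); the file proves the MECHANISM print invokes («invariant … because … orthogonal transformations»
+ «exactly one solution») and its Jacobian consequences, not the covariance of the letters; the junction of the abstract
carrier with the ℤᵈ one (an `ℓ^∞`/operator-norm Banach structure on the bond functions, r09's `BField`) is not written
in v1.0–v1.1 and IS WRITTEN in §7 (v1.2) for §§2, 4 (equivariance of `D̃`, `Φ`, `DΦ`, `σ∘Φ`); on that carrier «Tr log»,
`det` and the operator logarithm are NOT available (no finite dimension, no Fréchet analyticity of `C̃` on `ℓ^∞`).  §10 (v1.5)
passes to its PERIODIC SUB-CARRIER `perBF` (print's torus): closed, finite-dimensional for finite-dimensional `𝔸`, where `det DΦ` IS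
available and (2.16)-invariant (`p269_det_genuineZd_per`; binders: periodic stability of `h_V`, `C̃_V`); «Tr log» there still needs the
Fréchet analyticity of `C̃|` (Hartogs-type step from `QuadAnalytic`, not done), and print's Haar `σ` the `𝐠`-valuedness of the bond variables.  (ii) The other terms of `𝐏⁽ᵏ⁾` (`G₃`, the `H₁`∕`Δ₁`∕`J` pairings, `V`) and `{…}` are not touched
(their covariance: `B12ActionExpansion26Lattice` §5, `B12Eq25GaugeInvariance216`, `B12Eq213Body268`).  (iii) The
identification of `Tr mlog DΦ` with a scalar `log det` and the reality questions are `B12TrLogReal268` ∕ `B12JacobianReal267`,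
unchanged.  (iv) No measure theory here: the substitution's effect on the INTEGRAL (2.10) → (2.12) is row B12.Eq2.12.
No `def` in §§1–6, ONE `def` with body in §7 (`rotBFL`), FIVE in §10 (`restrictEquiv`, `shiftBFL`, `perBF`, `shiftBFLPer`, `rotBFLPer`; + 3 private
auxiliaries), no `Prop` fact, no `sorry`; axioms standard.  Located bookkeeping for one skeleton row; NOT summit progress.
-/

open Metric Set Filter Topology NormedSpace

namespace Literature.MathematicalPhysics.QuantumFieldTheory.Balaban1983to89.B12JacobianGauge269

open Literature.MathematicalPhysics.QuantumFieldTheory.Balaban1983to89.B13Contraction113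
open Literature.MathematicalPhysics.QuantumFieldTheory.Balaban1983to89.B12Lineariz267
open Literature.MathematicalPhysics.QuantumFieldTheory.Balaban1983to89.B12LinearizAnalytic267
open Literature.MathematicalPhysics.QuantumFieldTheory.Balaban1983to89.B12JacobianTrLog268
open Literature.MathematicalPhysics.QuantumFieldTheory.Balaban1983to89.B12SecondOrder267
open Literature.MathematicalPhysics.QuantumFieldTheory.Balaban1983to89.MatrixLog
open Literature.Analysis.Complex (logSeriesCoeff)
open Literature.Analysis.Calculus (differentiableWithinAt_of_linearIsometry_comp range_subtypeₗᵢ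
  mem_of_hasFDerivAt_of_isClosed)

/-! ## §1  Conjugation by a unit commutes with the operator logarithm; trace and determinant are conjugation
invariant -/
section generic

variable {𝔄 : Type*} [NormedRing 𝔄] [NormedAlgebra ℂ 𝔄]

omit [NormedAlgebra ℂ 𝔄] in
/-- `u (X − 1) u⁻¹ = u X u⁻¹ − 1`. [folklore] -/
private theorem units_conj_sub_one (u : 𝔄ˣ) (X : 𝔄) :
    (u : 𝔄) * (X - 1) * (↑u⁻¹ : 𝔄) = (u : 𝔄) * X * (↑u⁻¹ : 𝔄) - 1 := by
  rw [mul_sub, sub_mul, mul_one, Units.mul_inv]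

variable [CompleteSpace 𝔄]

/-- **The operator logarithm commutes with conjugation by a unit**: for `‖X − 1‖ < 1` and `‖uXu⁻¹ − 1‖ < 1`,
`mlog (uXu⁻¹) = u (mlog X) u⁻¹` — the logarithmic series ([Balaban1985Averaging] (21), the tree's `MatrixLog.mlog`)
mapped through the continuous linear map `T ↦ uTu⁻¹`, termwise `u (X − 1)ⁿ u⁻¹ = (uXu⁻¹ − 1)ⁿ` (`Units.conj_pow`).
[cite: Balaban1987RG1, (2.12) p.268, (2.16) p.269] -/
theorem mlog_units_conj (u : 𝔄ˣ) {X : 𝔄} (hX : ‖X - 1‖ < 1)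
    (huX : ‖(u : 𝔄) * X * (↑u⁻¹ : 𝔄) - 1‖ < 1) :
    mlog ((u : 𝔄) * X * (↑u⁻¹ : 𝔄)) = (u : 𝔄) * mlog X * (↑u⁻¹ : 𝔄) := by
  have hs := hasSum_mlog hX
  let φ : 𝔄 →L[ℂ] 𝔄 := ContinuousLinearMap.mulLeftRight ℂ 𝔄 (u : 𝔄) (↑u⁻¹ : 𝔄)
  have hφ : ∀ T : 𝔄, φ T = (u : 𝔄) * T * (↑u⁻¹ : 𝔄) := fun T => by
    simp [φ, ContinuousLinearMap.mulLeftRight_apply]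
  have h1 : HasSum (fun n : ℕ => φ (logSeriesCoeff n • (X - 1) ^ n)) (φ (mlog X)) :=
    hs.map φ φ.continuous
  have h2 := hasSum_mlog huX
  have heq : (fun n : ℕ => φ (logSeriesCoeff n • (X - 1) ^ n)) =
      fun n : ℕ => logSeriesCoeff n • ((u : 𝔄) * X * (↑u⁻¹ : 𝔄) - 1) ^ n := by
    funext n
    rw [map_smul, hφ, ← units_conj_sub_one, Units.conj_pow]
  rw [heq, hφ] at h1
  exact h2.unique h1

end generic

section lintrace

variable {𝒴 : Type*} [NormedAddCommGroup 𝒴] [NormedSpace ℂ 𝒴]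

/-- `U⁻¹ ∘ U = id` at the level of linear maps, for a continuous linear equivalence. [folklore] -/
private theorem symm_comp_coe (U : 𝒴 ≃L[ℂ] 𝒴) :
    ((U.symm : 𝒴 →L[ℂ] 𝒴) : 𝒴 →ₗ[ℂ] 𝒴) ∘ₗ ((U : 𝒴 →L[ℂ] 𝒴) : 𝒴 →ₗ[ℂ] 𝒴) = LinearMap.id := by
  ext v; simp

/-- `U ∘ U⁻¹ = id` at the level of linear maps. [folklore] -/
private theorem coe_comp_symm (U : 𝒴 ≃L[ℂ] 𝒴) :
    ((U : 𝒴 →L[ℂ] 𝒴) : 𝒴 →ₗ[ℂ] 𝒴) ∘ₗ ((U.symm : 𝒴 →L[ℂ] 𝒴) : 𝒴 →ₗ[ℂ] 𝒴) = LinearMap.id := by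
  ext v; simp

/-- **The trace is conjugation invariant**: `Tr (U T U⁻¹) = Tr T` (finite dimension; `LinearMap.trace_comp_comm'`).
[cite: Balaban1987RG1, (2.12) p.268, (2.16) p.269] -/
theorem trace_conj_eq [FiniteDimensional ℂ 𝒴] (U : 𝒴 ≃L[ℂ] 𝒴) (T : 𝒴 →L[ℂ] 𝒴) :
    LinearMap.trace ℂ 𝒴 (((U : 𝒴 →L[ℂ] 𝒴) ∘L T ∘L (U.symm : 𝒴 →L[ℂ] 𝒴) : 𝒴 →L[ℂ] 𝒴) : 𝒴 →ₗ[ℂ] 𝒴) =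
      LinearMap.trace ℂ 𝒴 (T : 𝒴 →ₗ[ℂ] 𝒴) := by
  rw [ContinuousLinearMap.toLinearMap_comp, ContinuousLinearMap.toLinearMap_comp, LinearMap.trace_comp_comm',
    LinearMap.comp_assoc, symm_comp_coe, LinearMap.comp_id]

/-- **The determinant is conjugation invariant**: `det (U T U⁻¹) = det T` (`LinearMap.det_comp`). [cite: Balaban1987RG1, (2.12) p.268, (2.16) p.269] -/
theorem det_conj_eq (U : 𝒴 ≃L[ℂ] 𝒴) (T : 𝒴 →L[ℂ] 𝒴) :
    LinearMap.det (((U : 𝒴 →L[ℂ] 𝒴) ∘L T ∘L (U.symm : 𝒴 →L[ℂ] 𝒴) : 𝒴 →L[ℂ] 𝒴) : 𝒴 →ₗ[ℂ] 𝒴) =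
      LinearMap.det (T : 𝒴 →ₗ[ℂ] 𝒴) := by
  rw [ContinuousLinearMap.toLinearMap_comp, ContinuousLinearMap.toLinearMap_comp, LinearMap.det_comp,
    LinearMap.det_comp, mul_left_comm, ← LinearMap.det_comp, coe_comp_symm, LinearMap.det_id, mul_one]

/-- The unit of `𝒴 →L[ℂ] 𝒴` given by a continuous linear equivalence: `↑U.toUnit = U`. [folklore] -/
private theorem coe_toUnit (U : 𝒴 ≃L[ℂ] 𝒴) : ((U.toUnit : (𝒴 →L[ℂ] 𝒴)ˣ) : 𝒴 →L[ℂ] 𝒴) = (U : 𝒴 →L[ℂ] 𝒴) := rfl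

/-- … and `↑U.toUnit⁻¹ = U.symm`. [folklore] -/
private theorem coe_toUnit_inv (U : 𝒴 ≃L[ℂ] 𝒴) :
    ((U.toUnit⁻¹ : (𝒴 →L[ℂ] 𝒴)ˣ) : 𝒴 →L[ℂ] 𝒴) = (U.symm : 𝒴 →L[ℂ] 𝒴) := rfl

/-- `U (1 − J) U⁻¹ = 1 − U J U⁻¹` in the algebra `𝒴 →L[ℂ] 𝒴` (composition spelling). [folklore] -/
private theorem conj_one_sub (U : 𝒴 ≃L[ℂ] 𝒴) (J : 𝒴 →L[ℂ] 𝒴) :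
    (U : 𝒴 →L[ℂ] 𝒴) ∘L (1 - J) ∘L (U.symm : 𝒴 →L[ℂ] 𝒴) = 1 - (U : 𝒴 →L[ℂ] 𝒴) ∘L J ∘L (U.symm : 𝒴 →L[ℂ] 𝒴) := by
  ext v; simp

variable [CompleteSpace 𝒴]

/-- **`log (U(1 − J)U⁻¹) = U log(1 − J) U⁻¹`** in `𝒴 →L[ℂ] 𝒴`, for `‖J‖ < 1` and `‖UJU⁻¹‖ < 1`. [cite: Balaban1987RG1, (2.12) p.268, (2.16) p.269] -/
theorem mlog_one_sub_conj (U : 𝒴 ≃L[ℂ] 𝒴) {J : 𝒴 →L[ℂ] 𝒴} (hJ : ‖J‖ < 1)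
    (hUJ : ‖(U : 𝒴 →L[ℂ] 𝒴) ∘L J ∘L (U.symm : 𝒴 →L[ℂ] 𝒴)‖ < 1) :
    mlog (1 - (U : 𝒴 →L[ℂ] 𝒴) ∘L J ∘L (U.symm : 𝒴 →L[ℂ] 𝒴)) =
      (U : 𝒴 →L[ℂ] 𝒴) ∘L mlog (1 - J) ∘L (U.symm : 𝒴 →L[ℂ] 𝒴) := by
  have hX : ‖(1 - J : 𝒴 →L[ℂ] 𝒴) - 1‖ < 1 := by rwa [sub_sub_cancel_left, norm_neg]
  have hconj : (U.toUnit : 𝒴 →L[ℂ] 𝒴) * (1 - J) * (↑U.toUnit⁻¹ : 𝒴 →L[ℂ] 𝒴) =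
      1 - (U : 𝒴 →L[ℂ] 𝒴) ∘L J ∘L (U.symm : 𝒴 →L[ℂ] 𝒴) := by
    rw [coe_toUnit, coe_toUnit_inv, ← conj_one_sub]; rfl
  have huX : ‖(U.toUnit : 𝒴 →L[ℂ] 𝒴) * (1 - J) * (↑U.toUnit⁻¹ : 𝒴 →L[ℂ] 𝒴) - 1‖ < 1 := by
    rw [hconj, sub_sub_cancel_left, norm_neg]; exact hUJ
  have h := mlog_units_conj U.toUnit hX huX
  rw [hconj, coe_toUnit, coe_toUnit_inv] at h
  rw [h]; rfl

end lintrace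

/-! ## §2  Two linearization systems linked by linear isometries: `D̃′(U B) = V D̃(B)` by uniqueness,
`Φ′(U B) = U Φ(B)`, `DD̃′(U B₀) = V ∘ DD̃(B₀) ∘ U⁻¹`, `J′(U B₀) = U ∘ J(B₀) ∘ U⁻¹`, `DΦ′(U B₀) = U ∘ DΦ(B₀) ∘ U⁻¹` -/
section equivariance

variable {𝒳 𝒴 : Type*} [NormedAddCommGroup 𝒳] [NormedSpace ℂ 𝒳] [CompleteSpace 𝒳]
  [NormedAddCommGroup 𝒴] [NormedSpace ℂ 𝒴] [CompleteSpace 𝒴]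
  {hop hop' : 𝒳 →ₗ[ℂ] 𝒴} {Ct Ct' : 𝒴 → 𝒳} {C₂ R b ε : ℝ} {Dt Dt' : 𝒴 → 𝒳}
  {V : 𝒳 ≃L[ℂ] 𝒳} {U : 𝒴 ≃L[ℂ] 𝒴}

omit [CompleteSpace 𝒴] in
/-- **`D̃′(U B) = V D̃(B)` on `‖B‖ < ε`** — the solution of the PRIMED equation `C̃′(B′ − h′X) = X` at the transformed
field `U B` is the transported solution of the unprimed one: `V D̃(B)` lies in the same closed ball (`V` isometric) and
solves the primed equation (covariance of `h` and `C̃`), so it equals `D̃′(U B)` by UNIQUENESS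
(`B12Lineariz267.eq_Dt_of_fixedPt`, «exactly one solution»). [cite: Balaban1987RG1, p.267, (2.16) p.269] -/
theorem Dt_gauge (hC : QuadAnalytic Ct C₂ R) (hC' : QuadAnalytic Ct' C₂ R) (hC₂ : 0 ≤ C₂) (hb : 0 ≤ b)
    (hHop : ∀ X, ‖hop X‖ ≤ b * ‖X‖) (hHop' : ∀ X, ‖hop' X‖ ≤ b * ‖X‖) (hq : 9 * C₂ * b * ε < 1)
    (hRC : 3 * ε ≤ R)
    (hDball : ∀ B : 𝒴, ‖B‖ < ε → Dt B ∈ closedBall (0:𝒳) (4 * C₂ * ε ^ 2))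
    (hDfix : ∀ B : 𝒴, ‖B‖ < ε → Ct (B - hop (Dt B)) = Dt B)
    (hDball' : ∀ B : 𝒴, ‖B‖ < ε → Dt' B ∈ closedBall (0:𝒳) (4 * C₂ * ε ^ 2))
    (hDfix' : ∀ B : 𝒴, ‖B‖ < ε → Ct' (B - hop' (Dt' B)) = Dt' B)
    (hU : ∀ Y, ‖U Y‖ = ‖Y‖) (hV : ∀ X, ‖V X‖ = ‖X‖)
    (hhop : ∀ X, hop' (V X) = U (hop X)) (hCt : ∀ Y : 𝒴, ‖Y‖ < R → Ct' (U Y) = V (Ct Y))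
    {B : 𝒴} (hB : ‖B‖ < ε) : Dt' (U B) = V (Dt B) := by
  have hUB : ‖U B‖ < ε := by rwa [hU]
  have hXball : V (Dt B) ∈ closedBall (0:𝒳) (4 * C₂ * ε ^ 2) := by
    have h := hDball _ hB
    rw [mem_closedBall_zero_iff] at h ⊢
    rwa [hV]
  have hXfix : Ct' (U B - hop' (V (Dt B))) = V (Dt B) := by
    have h1 : U B - hop' (V (Dt B)) = U (B - hop (Dt B)) := by
      rw [map_sub, hhop]
    rw [h1, hCt _ (norm_phi_lt hC hC₂ hb hHop hq hRC hDball hDfix hB), hDfix _ hB]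
  exact (eq_Dt_of_fixedPt hC' hC₂ hb hHop' hq hRC hDball' hDfix' hUB hXball hXfix).symm

omit [CompleteSpace 𝒴] in
/-- **`Φ′(U B) = U Φ(B)`** for `Φ(B) = B − hD̃(B)`, `Φ′(B) = B − h′D̃′(B)` on the ball. [cite: Balaban1987RG1, p.267, (2.16) p.269] -/
theorem phi_gauge (hC : QuadAnalytic Ct C₂ R) (hC' : QuadAnalytic Ct' C₂ R) (hC₂ : 0 ≤ C₂) (hb : 0 ≤ b)
    (hHop : ∀ X, ‖hop X‖ ≤ b * ‖X‖) (hHop' : ∀ X, ‖hop' X‖ ≤ b * ‖X‖) (hq : 9 * C₂ * b * ε < 1)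
    (hRC : 3 * ε ≤ R)
    (hDball : ∀ B : 𝒴, ‖B‖ < ε → Dt B ∈ closedBall (0:𝒳) (4 * C₂ * ε ^ 2))
    (hDfix : ∀ B : 𝒴, ‖B‖ < ε → Ct (B - hop (Dt B)) = Dt B)
    (hDball' : ∀ B : 𝒴, ‖B‖ < ε → Dt' B ∈ closedBall (0:𝒳) (4 * C₂ * ε ^ 2))
    (hDfix' : ∀ B : 𝒴, ‖B‖ < ε → Ct' (B - hop' (Dt' B)) = Dt' B)
    (hU : ∀ Y, ‖U Y‖ = ‖Y‖) (hV : ∀ X, ‖V X‖ = ‖X‖)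
    (hhop : ∀ X, hop' (V X) = U (hop X)) (hCt : ∀ Y : 𝒴, ‖Y‖ < R → Ct' (U Y) = V (Ct Y))
    {B : 𝒴} (hB : ‖B‖ < ε) : U B - hop' (Dt' (U B)) = U (B - hop (Dt B)) := by
  rw [Dt_gauge hC hC' hC₂ hb hHop hHop' hq hRC hDball hDfix hDball' hDfix' hU hV hhop hCt hB, hhop, map_sub]

/-- **`DD̃′(U B₀) = V ∘ DD̃(B₀) ∘ U⁻¹`** — near `U B₀` the primed solution IS `V ∘ D̃ ∘ U⁻¹` (the ball is open), so
its Fréchet derivative is the conjugated one (chain rule). [cite: Balaban1987RG1, p.267, (2.16) p.269] -/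
theorem fderiv_Dt_gauge (hC : QuadAnalytic Ct C₂ R) (hCa : AnalyticOnNhd ℂ Ct {Y : 𝒴 | ‖Y‖ < R})
    (hC' : QuadAnalytic Ct' C₂ R) (hC₂ : 0 ≤ C₂) (hb : 0 ≤ b)
    (hHop : ∀ X, ‖hop X‖ ≤ b * ‖X‖) (hHop' : ∀ X, ‖hop' X‖ ≤ b * ‖X‖) (hq : 9 * C₂ * b * ε < 1)
    (hRC : 3 * ε ≤ R)
    (hDball : ∀ B : 𝒴, ‖B‖ < ε → Dt B ∈ closedBall (0:𝒳) (4 * C₂ * ε ^ 2))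
    (hDfix : ∀ B : 𝒴, ‖B‖ < ε → Ct (B - hop (Dt B)) = Dt B)
    (hDball' : ∀ B : 𝒴, ‖B‖ < ε → Dt' B ∈ closedBall (0:𝒳) (4 * C₂ * ε ^ 2))
    (hDfix' : ∀ B : 𝒴, ‖B‖ < ε → Ct' (B - hop' (Dt' B)) = Dt' B)
    (hU : ∀ Y, ‖U Y‖ = ‖Y‖) (hV : ∀ X, ‖V X‖ = ‖X‖)
    (hhop : ∀ X, hop' (V X) = U (hop X)) (hCt : ∀ Y : 𝒴, ‖Y‖ < R → Ct' (U Y) = V (Ct Y))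
    {B₀ : 𝒴} (hB₀ : ‖B₀‖ < ε) :
    fderiv ℂ Dt' (U B₀) = (V : 𝒳 →L[ℂ] 𝒳) ∘L fderiv ℂ Dt B₀ ∘L (U.symm : 𝒴 →L[ℂ] 𝒴) := by
  have hD : HasFDerivAt Dt (fderiv ℂ Dt B₀) B₀ :=
    (analyticAt_Dt hC hCa hC₂ hb hHop hq hRC hDball hDfix hB₀).differentiableAt.hasFDerivAt
  have hD' : HasFDerivAt Dt (fderiv ℂ Dt B₀) ((U.symm : 𝒴 →L[ℂ] 𝒴) (U B₀)) := by
    rwa [ContinuousLinearEquiv.coe_coe, U.symm_apply_apply]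
  have hcomp : HasFDerivAt (fun B' => (V : 𝒳 →L[ℂ] 𝒳) (Dt ((U.symm : 𝒴 →L[ℂ] 𝒴) B')))
      ((V : 𝒳 →L[ℂ] 𝒳) ∘L fderiv ℂ Dt B₀ ∘L (U.symm : 𝒴 →L[ℂ] 𝒴)) (U B₀) :=
    (V : 𝒳 →L[ℂ] 𝒳).hasFDerivAt.comp (U B₀) (hD'.comp (U B₀) (U.symm : 𝒴 →L[ℂ] 𝒴).hasFDerivAt)
  have heq : Dt' =ᶠ[𝓝 (U B₀)] fun B' => (V : 𝒳 →L[ℂ] 𝒳) (Dt ((U.symm : 𝒴 →L[ℂ] 𝒴) B')) := by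
    have hopen : ∀ᶠ B' in 𝓝 (U B₀), ‖B'‖ < ε := by
      have hUB₀ : ‖U B₀‖ < ε := by rwa [hU]
      exact (isOpen_lt continuous_norm continuous_const).mem_nhds hUB₀
    filter_upwards [hopen] with B' hB'
    have hA : ‖U.symm B'‖ < ε := by
      have h := hU (U.symm B'); rw [U.apply_symm_apply] at h; rwa [← h]
    have h := Dt_gauge hC hC' hC₂ hb hHop hHop' hq hRC hDball hDfix hDball' hDfix' hU hV hhop hCt hA
    rw [U.apply_symm_apply] at h
    simpa using h
  exact (hcomp.congr_of_eventuallyEq heq).fderiv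

/-- **`J′(U B₀) = U ∘ J(B₀) ∘ U⁻¹`** for the operator `J(B) = h∘DD̃(B)` of (2.12) (`B12JacobianTrLog268`) and its primed
twin `J′(B) = h′∘DD̃′(B)`. [cite: Balaban1987RG1, (2.12) p.268, (2.16) p.269] -/
theorem jacobianOp_gauge (hC : QuadAnalytic Ct C₂ R) (hCa : AnalyticOnNhd ℂ Ct {Y : 𝒴 | ‖Y‖ < R})
    (hC' : QuadAnalytic Ct' C₂ R) (hC₂ : 0 ≤ C₂) (hb : 0 ≤ b)
    (hHop : ∀ X, ‖hop X‖ ≤ b * ‖X‖) (hHop' : ∀ X, ‖hop' X‖ ≤ b * ‖X‖) (hq : 9 * C₂ * b * ε < 1)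
    (hRC : 3 * ε ≤ R)
    (hDball : ∀ B : 𝒴, ‖B‖ < ε → Dt B ∈ closedBall (0:𝒳) (4 * C₂ * ε ^ 2))
    (hDfix : ∀ B : 𝒴, ‖B‖ < ε → Ct (B - hop (Dt B)) = Dt B)
    (hDball' : ∀ B : 𝒴, ‖B‖ < ε → Dt' B ∈ closedBall (0:𝒳) (4 * C₂ * ε ^ 2))
    (hDfix' : ∀ B : 𝒴, ‖B‖ < ε → Ct' (B - hop' (Dt' B)) = Dt' B)
    (hU : ∀ Y, ‖U Y‖ = ‖Y‖) (hV : ∀ X, ‖V X‖ = ‖X‖)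
    (hhop : ∀ X, hop' (V X) = U (hop X)) (hCt : ∀ Y : 𝒴, ‖Y‖ < R → Ct' (U Y) = V (Ct Y))
    {B₀ : 𝒴} (hB₀ : ‖B₀‖ < ε) :
    hop'.mkContinuous b hHop' ∘L fderiv ℂ Dt' (U B₀) =
      (U : 𝒴 →L[ℂ] 𝒴) ∘L (hop.mkContinuous b hHop ∘L fderiv ℂ Dt B₀) ∘L (U.symm : 𝒴 →L[ℂ] 𝒴) := by
  rw [fderiv_Dt_gauge hC hCa hC' hC₂ hb hHop hHop' hq hRC hDball hDfix hDball' hDfix' hU hV hhop hCt hB₀]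
  ext v
  simp [hhop]

/-- **`DΦ′(U B₀) = U ∘ DΦ(B₀) ∘ U⁻¹`** for the Jacobian operators `DΦ = fderiv Φ = 1 − J` of the two substitutions.
[cite: Balaban1987RG1, (2.12) p.268, (2.16) p.269] -/
theorem fderiv_phi_gauge (hC : QuadAnalytic Ct C₂ R) (hCa : AnalyticOnNhd ℂ Ct {Y : 𝒴 | ‖Y‖ < R})
    (hC' : QuadAnalytic Ct' C₂ R) (hCa' : AnalyticOnNhd ℂ Ct' {Y : 𝒴 | ‖Y‖ < R}) (hC₂ : 0 ≤ C₂) (hb : 0 ≤ b)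
    (hHop : ∀ X, ‖hop X‖ ≤ b * ‖X‖) (hHop' : ∀ X, ‖hop' X‖ ≤ b * ‖X‖) (hq : 9 * C₂ * b * ε < 1)
    (hRC : 3 * ε ≤ R)
    (hDball : ∀ B : 𝒴, ‖B‖ < ε → Dt B ∈ closedBall (0:𝒳) (4 * C₂ * ε ^ 2))
    (hDfix : ∀ B : 𝒴, ‖B‖ < ε → Ct (B - hop (Dt B)) = Dt B)
    (hDball' : ∀ B : 𝒴, ‖B‖ < ε → Dt' B ∈ closedBall (0:𝒳) (4 * C₂ * ε ^ 2))
    (hDfix' : ∀ B : 𝒴, ‖B‖ < ε → Ct' (B - hop' (Dt' B)) = Dt' B)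
    (hU : ∀ Y, ‖U Y‖ = ‖Y‖) (hV : ∀ X, ‖V X‖ = ‖X‖)
    (hhop : ∀ X, hop' (V X) = U (hop X)) (hCt : ∀ Y : 𝒴, ‖Y‖ < R → Ct' (U Y) = V (Ct Y))
    {B₀ : 𝒴} (hB₀ : ‖B₀‖ < ε) :
    fderiv ℂ (fun B => B - hop' (Dt' B)) (U B₀) =
      (U : 𝒴 →L[ℂ] 𝒴) ∘L fderiv ℂ (fun B => B - hop (Dt B)) B₀ ∘L (U.symm : 𝒴 →L[ℂ] 𝒴) := by
  have hUB₀ : ‖U B₀‖ < ε := by rwa [hU]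
  rw [fderiv_phi hC' hCa' hC₂ hb hHop' hq hRC hDball' hDfix' hUB₀, fderiv_phi hC hCa hC₂ hb hHop hq hRC hDball hDfix hB₀,
    jacobianOp_gauge hC hCa hC' hC₂ hb hHop hHop' hq hRC hDball hDfix hDball' hDfix' hU hV hhop hCt hB₀, conj_one_sub]

/-! ## §3  The logarithm of the Jacobian conjugates; its TRACE and the Jacobian DETERMINANT are gauge invariant -/

/-- **`log DΦ′(U B₀) = U ∘ log DΦ(B₀) ∘ U⁻¹`** (`9C₂bε ≤ 1/2`, so that `‖J‖ < 1` on the ball for both systems and the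
operator logarithm `mlog (1 − J)` is its power series). [cite: Balaban1987RG1, (2.12) p.268, (2.16) p.269] -/
theorem logJacobian_gauge (hC : QuadAnalytic Ct C₂ R) (hCa : AnalyticOnNhd ℂ Ct {Y : 𝒴 | ‖Y‖ < R})
    (hC' : QuadAnalytic Ct' C₂ R) (hCa' : AnalyticOnNhd ℂ Ct' {Y : 𝒴 | ‖Y‖ < R}) (hC₂ : 0 ≤ C₂) (hb : 0 ≤ b)
    (hHop : ∀ X, ‖hop X‖ ≤ b * ‖X‖) (hHop' : ∀ X, ‖hop' X‖ ≤ b * ‖X‖) (hq2 : 9 * C₂ * b * ε ≤ 1 / 2)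
    (hRC : 3 * ε ≤ R)
    (hDball : ∀ B : 𝒴, ‖B‖ < ε → Dt B ∈ closedBall (0:𝒳) (4 * C₂ * ε ^ 2))
    (hDfix : ∀ B : 𝒴, ‖B‖ < ε → Ct (B - hop (Dt B)) = Dt B)
    (hDball' : ∀ B : 𝒴, ‖B‖ < ε → Dt' B ∈ closedBall (0:𝒳) (4 * C₂ * ε ^ 2))
    (hDfix' : ∀ B : 𝒴, ‖B‖ < ε → Ct' (B - hop' (Dt' B)) = Dt' B)
    (hU : ∀ Y, ‖U Y‖ = ‖Y‖) (hV : ∀ X, ‖V X‖ = ‖X‖)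
    (hhop : ∀ X, hop' (V X) = U (hop X)) (hCt : ∀ Y : 𝒴, ‖Y‖ < R → Ct' (U Y) = V (Ct Y))
    {B₀ : 𝒴} (hB₀ : ‖B₀‖ < ε) :
    mlog (1 - hop'.mkContinuous b hHop' ∘L fderiv ℂ Dt' (U B₀)) =
      (U : 𝒴 →L[ℂ] 𝒴) ∘L mlog (1 - hop.mkContinuous b hHop ∘L fderiv ℂ Dt B₀) ∘L (U.symm : 𝒴 →L[ℂ] 𝒴) := by
  have hUB₀ : ‖U B₀‖ < ε := by rwa [hU]
  have hJ := norm_jacobianOp_lt_one hC hCa hC₂ hb hHop hq2 hRC hDball hDfix hB₀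
  have hJ' := norm_jacobianOp_lt_one hC' hCa' hC₂ hb hHop' hq2 hRC hDball' hDfix' hUB₀
  rw [jacobianOp_gauge hC hCa hC' hC₂ hb hHop hHop' (lt_one_of_le_half hq2) hRC hDball hDfix hDball' hDfix' hU hV
    hhop hCt hB₀] at hJ' ⊢
  exact mlog_one_sub_conj U hJ hJ'

/-- **«Tr log(I − h((δ/δB)D̃)(·))» IS GAUGE INVARIANT**: `Tr log DΦ′(U B₀) = Tr log DΦ(B₀)` (finite dimension). [cite: Balaban1987RG1, (2.12) p.268, (2.16) p.269] -/
theorem trace_logJacobian_gauge [FiniteDimensional ℂ 𝒴] (hC : QuadAnalytic Ct C₂ R)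
    (hCa : AnalyticOnNhd ℂ Ct {Y : 𝒴 | ‖Y‖ < R})
    (hC' : QuadAnalytic Ct' C₂ R) (hCa' : AnalyticOnNhd ℂ Ct' {Y : 𝒴 | ‖Y‖ < R}) (hC₂ : 0 ≤ C₂) (hb : 0 ≤ b)
    (hHop : ∀ X, ‖hop X‖ ≤ b * ‖X‖) (hHop' : ∀ X, ‖hop' X‖ ≤ b * ‖X‖) (hq2 : 9 * C₂ * b * ε ≤ 1 / 2)
    (hRC : 3 * ε ≤ R)
    (hDball : ∀ B : 𝒴, ‖B‖ < ε → Dt B ∈ closedBall (0:𝒳) (4 * C₂ * ε ^ 2))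
    (hDfix : ∀ B : 𝒴, ‖B‖ < ε → Ct (B - hop (Dt B)) = Dt B)
    (hDball' : ∀ B : 𝒴, ‖B‖ < ε → Dt' B ∈ closedBall (0:𝒳) (4 * C₂ * ε ^ 2))
    (hDfix' : ∀ B : 𝒴, ‖B‖ < ε → Ct' (B - hop' (Dt' B)) = Dt' B)
    (hU : ∀ Y, ‖U Y‖ = ‖Y‖) (hV : ∀ X, ‖V X‖ = ‖X‖)
    (hhop : ∀ X, hop' (V X) = U (hop X)) (hCt : ∀ Y : 𝒴, ‖Y‖ < R → Ct' (U Y) = V (Ct Y))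
    {B₀ : 𝒴} (hB₀ : ‖B₀‖ < ε) :
    LinearMap.trace ℂ 𝒴 ((mlog (1 - hop'.mkContinuous b hHop' ∘L fderiv ℂ Dt' (U B₀)) : 𝒴 →L[ℂ] 𝒴) : 𝒴 →ₗ[ℂ] 𝒴) =
      LinearMap.trace ℂ 𝒴 ((mlog (1 - hop.mkContinuous b hHop ∘L fderiv ℂ Dt B₀) : 𝒴 →L[ℂ] 𝒴) : 𝒴 →ₗ[ℂ] 𝒴) := by
  rw [logJacobian_gauge hC hCa hC' hCa' hC₂ hb hHop hHop' hq2 hRC hDball hDfix hDball' hDfix' hU hV hhop hCt hB₀,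
    trace_conj_eq]

/-- **THE JACOBIAN DETERMINANT IS GAUGE INVARIANT**: `det DΦ′(U B₀) = det DΦ(B₀)`. [cite: Balaban1987RG1, (2.12) p.268, (2.16) p.269] -/
theorem det_fderiv_phi_gauge (hC : QuadAnalytic Ct C₂ R) (hCa : AnalyticOnNhd ℂ Ct {Y : 𝒴 | ‖Y‖ < R})
    (hC' : QuadAnalytic Ct' C₂ R) (hCa' : AnalyticOnNhd ℂ Ct' {Y : 𝒴 | ‖Y‖ < R}) (hC₂ : 0 ≤ C₂) (hb : 0 ≤ b)
    (hHop : ∀ X, ‖hop X‖ ≤ b * ‖X‖) (hHop' : ∀ X, ‖hop' X‖ ≤ b * ‖X‖) (hq : 9 * C₂ * b * ε < 1)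
    (hRC : 3 * ε ≤ R)
    (hDball : ∀ B : 𝒴, ‖B‖ < ε → Dt B ∈ closedBall (0:𝒳) (4 * C₂ * ε ^ 2))
    (hDfix : ∀ B : 𝒴, ‖B‖ < ε → Ct (B - hop (Dt B)) = Dt B)
    (hDball' : ∀ B : 𝒴, ‖B‖ < ε → Dt' B ∈ closedBall (0:𝒳) (4 * C₂ * ε ^ 2))
    (hDfix' : ∀ B : 𝒴, ‖B‖ < ε → Ct' (B - hop' (Dt' B)) = Dt' B)
    (hU : ∀ Y, ‖U Y‖ = ‖Y‖) (hV : ∀ X, ‖V X‖ = ‖X‖)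
    (hhop : ∀ X, hop' (V X) = U (hop X)) (hCt : ∀ Y : 𝒴, ‖Y‖ < R → Ct' (U Y) = V (Ct Y))
    {B₀ : 𝒴} (hB₀ : ‖B₀‖ < ε) :
    LinearMap.det ((fderiv ℂ (fun B => B - hop' (Dt' B)) (U B₀) : 𝒴 →L[ℂ] 𝒴) : 𝒴 →ₗ[ℂ] 𝒴) =
      LinearMap.det ((fderiv ℂ (fun B => B - hop (Dt B)) B₀ : 𝒴 →L[ℂ] 𝒴) : 𝒴 →ₗ[ℂ] 𝒴) := by
  rw [fderiv_phi_gauge hC hCa hC' hCa' hC₂ hb hHop hHop' hq hRC hDball hDfix hDball' hDfix' hU hV hhop hCt hB₀,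
    det_conj_eq]

/-! ## §4  The second measure-born term: `σ(Φ′(U B)) = σ(Φ(B))` for every `U`-invariant function `σ`
(the Haar density in exponential coordinates, «log σ(g_kCB − hD̃(g_kCB))») -/

omit [CompleteSpace 𝒴] in
/-- **«log σ(g_kCB − hD̃(g_kCB))» IS GAUGE INVARIANT** given the invariance of `σ` under the (2.16) map on the
fields (`σ(U Y) = σ(Y)`: for the Haar density in exponential coordinates this is the `Ad`-invariance of `det jac`,
the tree's `B13HaarSigmaJacobian.det_jac_Adg`, bond by bond): `σ(Φ′(U B)) = σ(Φ(B))` on the ball. [cite: Balaban1987RG1, (2.12) p.268, (2.16) p.269] -/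
theorem sigma_phi_gauge {F : Type*} (σ : 𝒴 → F) (hσ : ∀ Y, σ (U Y) = σ Y)
    (hC : QuadAnalytic Ct C₂ R) (hC' : QuadAnalytic Ct' C₂ R) (hC₂ : 0 ≤ C₂) (hb : 0 ≤ b)
    (hHop : ∀ X, ‖hop X‖ ≤ b * ‖X‖) (hHop' : ∀ X, ‖hop' X‖ ≤ b * ‖X‖) (hq : 9 * C₂ * b * ε < 1)
    (hRC : 3 * ε ≤ R)
    (hDball : ∀ B : 𝒴, ‖B‖ < ε → Dt B ∈ closedBall (0:𝒳) (4 * C₂ * ε ^ 2))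
    (hDfix : ∀ B : 𝒴, ‖B‖ < ε → Ct (B - hop (Dt B)) = Dt B)
    (hDball' : ∀ B : 𝒴, ‖B‖ < ε → Dt' B ∈ closedBall (0:𝒳) (4 * C₂ * ε ^ 2))
    (hDfix' : ∀ B : 𝒴, ‖B‖ < ε → Ct' (B - hop' (Dt' B)) = Dt' B)
    (hU : ∀ Y, ‖U Y‖ = ‖Y‖) (hV : ∀ X, ‖V X‖ = ‖X‖)
    (hhop : ∀ X, hop' (V X) = U (hop X)) (hCt : ∀ Y : 𝒴, ‖Y‖ < R → Ct' (U Y) = V (Ct Y))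
    {B : 𝒴} (hB : ‖B‖ < ε) : σ (U B - hop' (Dt' (U B))) = σ (B - hop (Dt B)) := by
  rw [phi_gauge hC hC' hC₂ hb hHop hHop' hq hRC hDball hDfix hDball' hDfix' hU hV hhop hCt hB, hσ]

end equivariance

/-! ## §5  Transcription: p. 269 «all the expressions in (2.12), together with the measure, are invariant with respect
to the gauge transformations (2.16)» for the two measure-born terms of `𝐏^{(k)}` -/
section transcription

variable {𝒳 𝒴 : Type*} [NormedAddCommGroup 𝒳] [NormedSpace ℂ 𝒳] [CompleteSpace 𝒳]
  [NormedAddCommGroup 𝒴] [NormedSpace ℂ 𝒴] [CompleteSpace 𝒴]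

/-- **[B12] p. 269 «let us recall only that all the expressions in (2.12), together with the measure, are invariant
with respect to the gauge transformations U_{k+1} → U^u_{k+1}, B′ → R(u)B′ … (2.16)» FOR THE TWO MEASURE-BORN
TERMS OF `𝐏^{(k)}` — «Tr log(I − h((δ/δB)D̃)(g_kCB))» and «log σ(g_kCB − hD̃(g_kCB))» of (2.12) p. 268 —, BANACH
PART.**  Two linearization systems in the hypothesis-style typing of `B12Lineariz267` ∕ `B12LinearizAnalytic267`
(the letters `h`, `C̃`, `D̃` at the background `U_{k+1}` and their primed twins at `U^u_{k+1}`, same constants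
`C₂, R, b, ε`), linked by continuous linear ISOMETRIC equivalences `U` of the `T⁽ᵏ⁾`-bond fields and `V` of the
`T⁽ᵏ⁺¹⁾`-bond fields (print's `R(u)`: «local, orthogonal transformations») under which `h` and `C̃` are COVARIANT
(`h′(VX) = U(hX)`, `C̃′(UY) = V(C̃Y)` on `‖Y‖ < R`).  THEN on the ball `‖B‖ < ε`: (i) `D̃′(UB) = VD̃(B)` («exactly one
solution» ⇒ equivariance) and `Φ′(UB) = UΦ(B)` for the substitutions `Φ(B) = B − hD̃(B)`; (ii) the Jacobian operators
conjugate, `DΦ′(UB) = U∘DΦ(B)∘U⁻¹`, and the Jacobian DETERMINANT is invariant, `det DΦ′(UB) = det DΦ(B)`; (iii) every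
`U`-invariant function `σ` of the fields takes the same value at `Φ′(UB)` and `Φ(B)` — the term «log σ(·)» (for the
Haar density in exponential coordinates the invariance `σ(UY) = σ(Y)` is the bondwise `Ad`-invariance of `det jac`,
`B13HaarSigmaJacobian.det_jac_Adg`, not imported here).  Everything about `h`, `C̃`, `D̃`, `U`, `V`, `σ` is a
HYPOTHESIS; which operators realise print's letters is rows B12.Def@267 ∕ B12.Eq2.11, not this file; nothing printed is
asserted. [cite: Balaban1987RG1, (2.16) p.269] -/
theorem p269_gauge_invariance_measure_terms {hop hop' : 𝒳 →ₗ[ℂ] 𝒴} {Ct Ct' : 𝒴 → 𝒳} {C₂ R b ε : ℝ}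
    {Dt Dt' : 𝒴 → 𝒳} {V : 𝒳 ≃L[ℂ] 𝒳} {U : 𝒴 ≃L[ℂ] 𝒴}
    (hC : QuadAnalytic Ct C₂ R) (hCa : AnalyticOnNhd ℂ Ct {Y : 𝒴 | ‖Y‖ < R})
    (hC' : QuadAnalytic Ct' C₂ R) (hCa' : AnalyticOnNhd ℂ Ct' {Y : 𝒴 | ‖Y‖ < R}) (hC₂ : 0 ≤ C₂) (hb : 0 ≤ b)
    (hHop : ∀ X, ‖hop X‖ ≤ b * ‖X‖) (hHop' : ∀ X, ‖hop' X‖ ≤ b * ‖X‖) (hq : 9 * C₂ * b * ε < 1)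
    (hRC : 3 * ε ≤ R)
    (hDball : ∀ B : 𝒴, ‖B‖ < ε → Dt B ∈ closedBall (0:𝒳) (4 * C₂ * ε ^ 2))
    (hDfix : ∀ B : 𝒴, ‖B‖ < ε → Ct (B - hop (Dt B)) = Dt B)
    (hDball' : ∀ B : 𝒴, ‖B‖ < ε → Dt' B ∈ closedBall (0:𝒳) (4 * C₂ * ε ^ 2))
    (hDfix' : ∀ B : 𝒴, ‖B‖ < ε → Ct' (B - hop' (Dt' B)) = Dt' B)
    (hU : ∀ Y, ‖U Y‖ = ‖Y‖) (hV : ∀ X, ‖V X‖ = ‖X‖)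
    (hhop : ∀ X, hop' (V X) = U (hop X)) (hCt : ∀ Y : 𝒴, ‖Y‖ < R → Ct' (U Y) = V (Ct Y)) :
    (∀ B : 𝒴, ‖B‖ < ε → Dt' (U B) = V (Dt B) ∧ U B - hop' (Dt' (U B)) = U (B - hop (Dt B))) ∧
    (∀ B₀ : 𝒴, ‖B₀‖ < ε →
      fderiv ℂ (fun B => B - hop' (Dt' B)) (U B₀) =
          (U : 𝒴 →L[ℂ] 𝒴) ∘L fderiv ℂ (fun B => B - hop (Dt B)) B₀ ∘L (U.symm : 𝒴 →L[ℂ] 𝒴) ∧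
        LinearMap.det ((fderiv ℂ (fun B => B - hop' (Dt' B)) (U B₀) : 𝒴 →L[ℂ] 𝒴) : 𝒴 →ₗ[ℂ] 𝒴) =
          LinearMap.det ((fderiv ℂ (fun B => B - hop (Dt B)) B₀ : 𝒴 →L[ℂ] 𝒴) : 𝒴 →ₗ[ℂ] 𝒴)) ∧
    (∀ {F : Type*} (σ : 𝒴 → F), (∀ Y, σ (U Y) = σ Y) →
      ∀ B : 𝒴, ‖B‖ < ε → σ (U B - hop' (Dt' (U B))) = σ (B - hop (Dt B))) :=
  ⟨fun _ hB => ⟨Dt_gauge hC hC' hC₂ hb hHop hHop' hq hRC hDball hDfix hDball' hDfix' hU hV hhop hCt hB,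
      phi_gauge hC hC' hC₂ hb hHop hHop' hq hRC hDball hDfix hDball' hDfix' hU hV hhop hCt hB⟩,
    fun _ hB₀ => ⟨fderiv_phi_gauge hC hCa hC' hCa' hC₂ hb hHop hHop' hq hRC hDball hDfix hDball' hDfix' hU hV
        hhop hCt hB₀,
      det_fderiv_phi_gauge hC hCa hC' hCa' hC₂ hb hHop hHop' hq hRC hDball hDfix hDball' hDfix' hU hV hhop hCt hB₀⟩,
    fun σ hσ _ hB => sigma_phi_gauge σ hσ hC hC' hC₂ hb hHop hHop' hq hRC hDball hDfix hDball' hDfix' hU hV hhop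
      hCt hB⟩

/-- **[B12] p. 269, the same sentence — FINITE-DIMENSIONAL PART** (`𝒴` finite-dimensional, as for the lattice
`𝐠`-valued bond functions of [B12]; `9C₂bε ≤ 1/2` as in `B12JacobianTrLog268`): the operator logarithm of the Jacobian
conjugates, `log DΦ′(UB₀) = U∘log DΦ(B₀)∘U⁻¹`, and the term «Tr log(I − h((δ/δB)D̃)(·))» of (2.12) is GAUGE INVARIANT,
`Tr log DΦ′(UB₀) = Tr log DΦ(B₀)`, at every `‖B₀‖ < ε`.  Same hypothesis discipline; nothing printed is asserted.
[cite: Balaban1987RG1, (2.16) p.269] -/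
theorem p269_gauge_invariance_TrLog_findim [FiniteDimensional ℂ 𝒴] {hop hop' : 𝒳 →ₗ[ℂ] 𝒴} {Ct Ct' : 𝒴 → 𝒳}
    {C₂ R b ε : ℝ} {Dt Dt' : 𝒴 → 𝒳} {V : 𝒳 ≃L[ℂ] 𝒳} {U : 𝒴 ≃L[ℂ] 𝒴}
    (hC : QuadAnalytic Ct C₂ R) (hCa : AnalyticOnNhd ℂ Ct {Y : 𝒴 | ‖Y‖ < R})
    (hC' : QuadAnalytic Ct' C₂ R) (hCa' : AnalyticOnNhd ℂ Ct' {Y : 𝒴 | ‖Y‖ < R}) (hC₂ : 0 ≤ C₂) (hb : 0 ≤ b)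
    (hHop : ∀ X, ‖hop X‖ ≤ b * ‖X‖) (hHop' : ∀ X, ‖hop' X‖ ≤ b * ‖X‖) (hq2 : 9 * C₂ * b * ε ≤ 1 / 2)
    (hRC : 3 * ε ≤ R)
    (hDball : ∀ B : 𝒴, ‖B‖ < ε → Dt B ∈ closedBall (0:𝒳) (4 * C₂ * ε ^ 2))
    (hDfix : ∀ B : 𝒴, ‖B‖ < ε → Ct (B - hop (Dt B)) = Dt B)
    (hDball' : ∀ B : 𝒴, ‖B‖ < ε → Dt' B ∈ closedBall (0:𝒳) (4 * C₂ * ε ^ 2))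
    (hDfix' : ∀ B : 𝒴, ‖B‖ < ε → Ct' (B - hop' (Dt' B)) = Dt' B)
    (hU : ∀ Y, ‖U Y‖ = ‖Y‖) (hV : ∀ X, ‖V X‖ = ‖X‖)
    (hhop : ∀ X, hop' (V X) = U (hop X)) (hCt : ∀ Y : 𝒴, ‖Y‖ < R → Ct' (U Y) = V (Ct Y))
    {B₀ : 𝒴} (hB₀ : ‖B₀‖ < ε) :
    mlog (1 - hop'.mkContinuous b hHop' ∘L fderiv ℂ Dt' (U B₀)) =
        (U : 𝒴 →L[ℂ] 𝒴) ∘L mlog (1 - hop.mkContinuous b hHop ∘L fderiv ℂ Dt B₀) ∘L (U.symm : 𝒴 →L[ℂ] 𝒴) ∧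
    LinearMap.trace ℂ 𝒴 ((mlog (1 - hop'.mkContinuous b hHop' ∘L fderiv ℂ Dt' (U B₀)) : 𝒴 →L[ℂ] 𝒴) : 𝒴 →ₗ[ℂ] 𝒴) =
      LinearMap.trace ℂ 𝒴 ((mlog (1 - hop.mkContinuous b hHop ∘L fderiv ℂ Dt B₀) : 𝒴 →L[ℂ] 𝒴) : 𝒴 →ₗ[ℂ] 𝒴) :=
  ⟨logJacobian_gauge hC hCa hC' hCa' hC₂ hb hHop hHop' hq2 hRC hDball hDfix hDball' hDfix' hU hV hhop hCt hB₀,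
    trace_logJacobian_gauge hC hCa hC' hCa' hC₂ hb hHop hHop' hq2 hRC hDball hDfix hDball' hDfix' hU hV hhop hCt hB₀⟩

/-- **AT THE ARGUMENT `g_kCB` of (2.12).**  Under (2.16) the remaining variables `B` transform by the restriction
`R_rem` of `R(u)` to the retained bonds and the elimination map intertwines, `C(U^u_{k+1})·R_rem = R(u)·C(U_{k+1})`
(`B12Eq216GaussianCarrier.intertwine_of_elimination` ∕ `elimLin_intertwine`, in the chart; not imported): for ANY two
argument maps `B ↦ g_kC B`, `B ↦ g_kC′B` and any `R_rem` with `g_kC′(R_rem B) = U(g_kC B)`, the two measure-born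
terms of `𝐏^{(k)}` agree at `(U^u_{k+1}, R_rem B)` and `(U_{k+1}, B)`: «Tr log», the Jacobian determinant and
«log σ».  [cite: Balaban1987RG1, (2.12) p.268, (2.16) p.269] -/
theorem p269_gauge_invariance_at_CB [FiniteDimensional ℂ 𝒴] {hop hop' : 𝒳 →ₗ[ℂ] 𝒴} {Ct Ct' : 𝒴 → 𝒳}
    {C₂ R b ε : ℝ} {Dt Dt' : 𝒴 → 𝒳} {V : 𝒳 ≃L[ℂ] 𝒳} {U : 𝒴 ≃L[ℂ] 𝒴}
    (hC : QuadAnalytic Ct C₂ R) (hCa : AnalyticOnNhd ℂ Ct {Y : 𝒴 | ‖Y‖ < R})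
    (hC' : QuadAnalytic Ct' C₂ R) (hCa' : AnalyticOnNhd ℂ Ct' {Y : 𝒴 | ‖Y‖ < R}) (hC₂ : 0 ≤ C₂) (hb : 0 ≤ b)
    (hHop : ∀ X, ‖hop X‖ ≤ b * ‖X‖) (hHop' : ∀ X, ‖hop' X‖ ≤ b * ‖X‖) (hq2 : 9 * C₂ * b * ε ≤ 1 / 2)
    (hRC : 3 * ε ≤ R)
    (hDball : ∀ B : 𝒴, ‖B‖ < ε → Dt B ∈ closedBall (0:𝒳) (4 * C₂ * ε ^ 2))
    (hDfix : ∀ B : 𝒴, ‖B‖ < ε → Ct (B - hop (Dt B)) = Dt B)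
    (hDball' : ∀ B : 𝒴, ‖B‖ < ε → Dt' B ∈ closedBall (0:𝒳) (4 * C₂ * ε ^ 2))
    (hDfix' : ∀ B : 𝒴, ‖B‖ < ε → Ct' (B - hop' (Dt' B)) = Dt' B)
    (hU : ∀ Y, ‖U Y‖ = ‖Y‖) (hV : ∀ X, ‖V X‖ = ‖X‖)
    (hhop : ∀ X, hop' (V X) = U (hop X)) (hCt : ∀ Y : 𝒴, ‖Y‖ < R → Ct' (U Y) = V (Ct Y))
    {𝒵 : Type*} (Carg Carg' : 𝒵 → 𝒴) (Rrem : 𝒵 → 𝒵) (hCarg : ∀ B, Carg' (Rrem B) = U (Carg B))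
    {F : Type*} (σ : 𝒴 → F) (hσ : ∀ Y, σ (U Y) = σ Y) {B : 𝒵} (hB : ‖Carg B‖ < ε) :
    LinearMap.trace ℂ 𝒴
        ((mlog (1 - hop'.mkContinuous b hHop' ∘L fderiv ℂ Dt' (Carg' (Rrem B))) : 𝒴 →L[ℂ] 𝒴) : 𝒴 →ₗ[ℂ] 𝒴) =
      LinearMap.trace ℂ 𝒴 ((mlog (1 - hop.mkContinuous b hHop ∘L fderiv ℂ Dt (Carg B)) : 𝒴 →L[ℂ] 𝒴) : 𝒴 →ₗ[ℂ] 𝒴) ∧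
    LinearMap.det ((fderiv ℂ (fun Y => Y - hop' (Dt' Y)) (Carg' (Rrem B)) : 𝒴 →L[ℂ] 𝒴) : 𝒴 →ₗ[ℂ] 𝒴) =
      LinearMap.det ((fderiv ℂ (fun Y => Y - hop (Dt Y)) (Carg B) : 𝒴 →L[ℂ] 𝒴) : 𝒴 →ₗ[ℂ] 𝒴) ∧
    σ (Carg' (Rrem B) - hop' (Dt' (Carg' (Rrem B)))) = σ (Carg B - hop (Dt (Carg B))) := by
  rw [hCarg]
  exact ⟨trace_logJacobian_gauge hC hCa hC' hCa' hC₂ hb hHop hHop' hq2 hRC hDball hDfix hDball' hDfix' hU hV hhop hCt hB,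
    det_fderiv_phi_gauge hC hCa hC' hCa' hC₂ hb hHop hHop' (lt_one_of_le_half hq2) hRC hDball hDfix hDball' hDfix' hU hV
      hhop hCt hB,
    sigma_phi_gauge σ hσ hC hC' hC₂ hb hHop hHop' (lt_one_of_le_half hq2) hRC hDball hDfix hDball' hDfix' hU hV hhop
      hCt hB⟩

/-- Non-vacuity of the hypothesis set: the degenerate model `𝒳 = 𝒴 = ℂ`, `h = h′ = id`, `C̃ = C̃′ = 0`, `D̃ = D̃′ = 0`,
`C₂ = 0`, `R = 3`, `b = 1`, `ε = 1`, `U = V = −1` (a non-trivial isometry), `σ = ‖·‖` satisfies every hypothesis of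
`p269_gauge_invariance_measure_terms` ∕ `p269_gauge_invariance_TrLog_findim` ∕ `p269_gauge_invariance_at_CB`, with
`B₀ = 1/2` in the ball. -/
example : ∃ (hop hop' : ℂ →ₗ[ℂ] ℂ) (Ct Ct' : ℂ → ℂ) (C₂ R b ε : ℝ) (Dt Dt' : ℂ → ℂ) (V U : ℂ ≃L[ℂ] ℂ)
    (σ : ℂ → ℝ) (B₀ : ℂ),
    QuadAnalytic Ct C₂ R ∧ AnalyticOnNhd ℂ Ct {Y : ℂ | ‖Y‖ < R} ∧
    QuadAnalytic Ct' C₂ R ∧ AnalyticOnNhd ℂ Ct' {Y : ℂ | ‖Y‖ < R} ∧ 0 ≤ C₂ ∧ 0 ≤ b ∧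
    (∀ X, ‖hop X‖ ≤ b * ‖X‖) ∧ (∀ X, ‖hop' X‖ ≤ b * ‖X‖) ∧ 9 * C₂ * b * ε ≤ 1 / 2 ∧ 3 * ε ≤ R ∧
    (∀ B : ℂ, ‖B‖ < ε → Dt B ∈ closedBall (0:ℂ) (4 * C₂ * ε ^ 2)) ∧
    (∀ B : ℂ, ‖B‖ < ε → Ct (B - hop (Dt B)) = Dt B) ∧
    (∀ B : ℂ, ‖B‖ < ε → Dt' B ∈ closedBall (0:ℂ) (4 * C₂ * ε ^ 2)) ∧
    (∀ B : ℂ, ‖B‖ < ε → Ct' (B - hop' (Dt' B)) = Dt' B) ∧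
    (∀ Y, ‖U Y‖ = ‖Y‖) ∧ (∀ X, ‖V X‖ = ‖X‖) ∧ (∀ X, hop' (V X) = U (hop X)) ∧
    (∀ Y : ℂ, ‖Y‖ < R → Ct' (U Y) = V (Ct Y)) ∧ (∀ Y, σ (U Y) = σ Y) ∧ U ≠ ContinuousLinearEquiv.refl ℂ ℂ ∧
    ‖B₀‖ < ε := by
  refine ⟨LinearMap.id, LinearMap.id, fun _ => 0, fun _ => 0, 0, 3, 1, 1, fun _ => 0, fun _ => 0,
    ContinuousLinearEquiv.neg ℂ, ContinuousLinearEquiv.neg ℂ, fun Y => ‖Y‖, (1/2 : ℝ),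
    ⟨fun Y _ => by simp, fun P Q => ?_⟩, fun Y _ => analyticAt_const, ⟨fun Y _ => by simp, fun P Q => ?_⟩,
    fun Y _ => analyticAt_const, le_rfl, zero_le_one, fun X => by simp, fun X => by simp, by norm_num, by norm_num,
    fun B _ => by simp, fun B _ => rfl, fun B _ => by simp, fun B _ => rfl, fun Y => by simp, fun X => by simp,
    fun X => by simp, fun Y _ => by simp, fun Y => by simp, ?_, ?_⟩
  · exact differentiableOn_const 0
  · exact differentiableOn_const 0
  · intro h
    have h1 := congrArg (fun e : ℂ ≃L[ℂ] ℂ => e 1) h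
    simp only [ContinuousLinearEquiv.neg_apply, ContinuousLinearEquiv.refl_apply] at h1
    norm_num at h1
  · rw [Complex.norm_real]; norm_num

end transcription


/-! ## §6  The Haar letter `σ` ASSEMBLED: print's density `∏_b det[(1 − e^{−ad B′(b)})/ad B′(b)]` is invariant under
every transformation acting bondwise by `Ad` — the binder `hσ` of §4 DISCHARGED from r10's `det_jac_Adg` (v1.1, gen 51)

Print's `σ` in (2.12) is the density of the Haar measure in the exponential chart, a product over the bonds of
`det jac(B′(b))`, `jac x = (1 − e^{−ad x})/ad x` (`B13HaarSigmaJacobian.jac`, [Balaban1985UV3] p. 260,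
[Helgason2000] Ch. I Thm. 1.14), and (2.16) acts on the fields bond by bond, `(R(u)B′)(b) = R(u(b₋))B′(b)`, by the
adjoint action (`B13HaarSigmaJacobian.Adg`).  On the abstract carrier `𝒴` of §§2–5 this is typed by bond-coordinate
maps `π_b : 𝒴 → 𝔤` (`𝔤` an `ad`-stable finite-dimensional subspace of a normed ℂ-algebra `𝔸` — the 𝐠ᶜ-valued
functions of the Jacobian lineage) and ONE hypothesis on `U`, print's (2.16) itself: `π_b(UY) = u_b π_b(Y) u_b⁻¹`.
Then `σ(UY) = σ(Y)` for `σ(Y) = ∏_b det jac(π_b Y)` (`prod_det_jac_conj`, from `det_jac_Adg` bond by bond), and §4's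
`sigma_phi_gauge` yields **`sigma_phi_gauge_haar`**: `σ(Φ′(UB)) = σ(Φ(B))` with the letters `h`, `C̃`, `D̃`, `V` and
the isometry of `U` left as binders.  For the product carrier `𝒴 = (bonds → 𝔤)` with the sup norm the two remaining
facts are recorded as they stand: the bondwise `Ad` map IS `ContinuousLinearEquiv.piCongrRight` of the `Adg`
(`piAdg_apply`, the hypothesis `π_b(UY) = Ad_{u_b} π_b(Y)` by `rfl`) and it IS an isometry for norm-one units,
`‖u_b‖ ≤ 1`, `‖u_b⁻¹‖ ≤ 1` — the unitaries of a C⋆-norm («local, orthogonal transformations»; `norm_Adg_apply`,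
`norm_piAdg`). [cite: Balaban1987RG1, (2.12) p.268, (2.16) p.269] [cite: Balaban1985UV3, p. 260] -/

section haar

open B13HaarSigmaJacobian

variable {𝔸 : Type*} [NormedRing 𝔸] [NormedAlgebra ℂ 𝔸] {𝔤 : Submodule ℂ 𝔸} [FiniteDimensional ℂ 𝔤]
  (hlie : ∀ x ∈ 𝔤, ∀ y ∈ 𝔤, x * y - y * x ∈ 𝔤)
  {ι : Type*} [Fintype ι] {u : ι → 𝔸ˣ}
  (hAd : ∀ b, ∀ y ∈ 𝔤, (u b : 𝔸) * y * ↑(u b)⁻¹ ∈ 𝔤) (hAd' : ∀ b, ∀ y ∈ 𝔤, (↑(u b)⁻¹ : 𝔸) * y * u b ∈ 𝔤)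

/-- **`σ(UY) = σ(Y)`** for the Haar density `σ(Y) = ∏_b det jac(π_b Y)` and every `U` acting bondwise by `Ad` in the
bond coordinates `π_b` (print's (2.16): `π_b(UY) = u_b π_b(Y) u_b⁻¹`) — `det jac(u x u⁻¹) = det jac(x)` bond by bond
(`B13HaarSigmaJacobian.det_jac_Adg`). [cite: Balaban1987RG1, (2.12) p.268, (2.16) p.269] [cite: Balaban1985UV3, p. 260] -/
theorem prod_det_jac_conj {𝒴 : Type*} (π : ι → 𝒴 → 𝔤) (U : 𝒴 → 𝒴)
    (hUπ : ∀ Y b, π b (U Y) = Adg (hAd b) (hAd' b) (π b Y)) (Y : 𝒴) :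
    ∏ b, LinearMap.det (jac hlie (π b (U Y)) : 𝔤 →ₗ[ℂ] 𝔤) = ∏ b, LinearMap.det (jac hlie (π b Y) : 𝔤 →ₗ[ℂ] 𝔤) :=
  Finset.prod_congr rfl fun b _ => by rw [hUπ, det_jac_Adg]

/-- **«log σ(g_kCB − hD̃(g_kCB))» IS (2.16)-INVARIANT FOR PRINT'S HAAR DENSITY** — §4's `sigma_phi_gauge` with
`σ(Y) = ∏_b det jac(π_b Y)` and its binder `hσ` DISCHARGED for every `U` acting bondwise by `Ad` in the bond
coordinates: `σ(Φ′(UB)) = σ(Φ(B))` on `‖B‖ < ε`; the letters `h`, `C̃`, `D̃` (both systems), `V` and the isometry of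
`U`, `V` remain the binders of §2 (for the product carrier the isometry is `norm_piAdg` below).
[cite: Balaban1987RG1, (2.12) p.268, (2.16) p.269] [cite: Balaban1985UV3, p. 260] -/
theorem sigma_phi_gauge_haar {𝒳 𝒴 : Type*} [NormedAddCommGroup 𝒳] [NormedSpace ℂ 𝒳] [CompleteSpace 𝒳]
    [NormedAddCommGroup 𝒴] [NormedSpace ℂ 𝒴]
    {hop hop' : 𝒳 →ₗ[ℂ] 𝒴} {Ct Ct' : 𝒴 → 𝒳} {C₂ R b ε : ℝ} {Dt Dt' : 𝒴 → 𝒳} {V : 𝒳 ≃L[ℂ] 𝒳} {U : 𝒴 ≃L[ℂ] 𝒴}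
    (π : ι → 𝒴 → 𝔤) (hUπ : ∀ Y b, π b (U Y) = Adg (hAd b) (hAd' b) (π b Y))
    (hC : QuadAnalytic Ct C₂ R) (hC' : QuadAnalytic Ct' C₂ R) (hC₂ : 0 ≤ C₂) (hb : 0 ≤ b)
    (hHop : ∀ X, ‖hop X‖ ≤ b * ‖X‖) (hHop' : ∀ X, ‖hop' X‖ ≤ b * ‖X‖) (hq : 9 * C₂ * b * ε < 1)
    (hRC : 3 * ε ≤ R)
    (hDball : ∀ B : 𝒴, ‖B‖ < ε → Dt B ∈ closedBall (0:𝒳) (4 * C₂ * ε ^ 2))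
    (hDfix : ∀ B : 𝒴, ‖B‖ < ε → Ct (B - hop (Dt B)) = Dt B)
    (hDball' : ∀ B : 𝒴, ‖B‖ < ε → Dt' B ∈ closedBall (0:𝒳) (4 * C₂ * ε ^ 2))
    (hDfix' : ∀ B : 𝒴, ‖B‖ < ε → Ct' (B - hop' (Dt' B)) = Dt' B)
    (hU : ∀ Y, ‖U Y‖ = ‖Y‖) (hV : ∀ X, ‖V X‖ = ‖X‖)
    (hhop : ∀ X, hop' (V X) = U (hop X)) (hCt : ∀ Y : 𝒴, ‖Y‖ < R → Ct' (U Y) = V (Ct Y))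
    {B : 𝒴} (hB : ‖B‖ < ε) :
    ∏ b, LinearMap.det (jac hlie (π b (U B - hop' (Dt' (U B)))) : 𝔤 →ₗ[ℂ] 𝔤) =
      ∏ b, LinearMap.det (jac hlie (π b (B - hop (Dt B))) : 𝔤 →ₗ[ℂ] 𝔤) :=
  sigma_phi_gauge (fun Y : 𝒴 => ∏ b, LinearMap.det (jac hlie (π b Y) : 𝔤 →ₗ[ℂ] 𝔤))
    (prod_det_jac_conj hlie hAd hAd' π U hUπ) hC hC' hC₂ hb hHop hHop' hq hRC hDball hDfix hDball' hDfix'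
    hU hV hhop hCt hB

omit [Fintype ι] in
/-- THE PRODUCT CARRIER: on `𝒴 = (ι → 𝔤)` with bond coordinates `π_b = eval_b`, the (2.16) map
`(R(u)Y)(b) = u_b Y(b) u_b⁻¹` is `ContinuousLinearEquiv.piCongrRight` of the bondwise `Adg`, and the hypothesis
`hUπ` of `prod_det_jac_conj` ∕ `sigma_phi_gauge_haar` holds by `rfl`. [cite: Balaban1987RG1, (2.16) p.269] -/
theorem piAdg_apply (Y : ι → 𝔤) (b : ι) :
    ContinuousLinearEquiv.piCongrRight (fun b => Adg (hAd b) (hAd' b)) Y b = Adg (hAd b) (hAd' b) (Y b) := rfl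

omit [Fintype ι] in
/-- `‖u y u⁻¹‖ = ‖y‖` for a unit with `‖u‖ ≤ 1` and `‖u⁻¹‖ ≤ 1` («orthogonal transformations»).
[cite: Balaban1987RG1, (2.16) p.269] -/
theorem norm_Adg_apply (b : ι) (hu : ‖(u b : 𝔸)‖ ≤ 1) (hu' : ‖(↑(u b)⁻¹ : 𝔸)‖ ≤ 1) (y : 𝔤) :
    ‖Adg (hAd b) (hAd' b) y‖ = ‖y‖ := by
  apply le_antisymm
  · rw [← Submodule.norm_coe, Adg_apply_coe, ← Submodule.norm_coe]
    calc ‖(u b : 𝔸) * y * ↑(u b)⁻¹‖ ≤ ‖(u b : 𝔸)‖ * ‖(y : 𝔸)‖ * ‖(↑(u b)⁻¹ : 𝔸)‖ :=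
          (norm_mul_le _ _).trans (mul_le_mul_of_nonneg_right (norm_mul_le _ _) (norm_nonneg _))
      _ ≤ 1 * ‖(y : 𝔸)‖ * 1 := by gcongr
      _ = ‖(y : 𝔸)‖ := by ring
  · have h : y = (Adg (hAd b) (hAd' b)).symm (Adg (hAd b) (hAd' b) y) := by simp
    conv_lhs => rw [h]
    rw [← Submodule.norm_coe, Adg_symm_apply_coe, ← Submodule.norm_coe (Adg (hAd b) (hAd' b) y)]
    calc ‖(↑(u b)⁻¹ : 𝔸) * ↑(Adg (hAd b) (hAd' b) y) * ↑(u b)‖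
        ≤ ‖(↑(u b)⁻¹ : 𝔸)‖ * ‖(↑(Adg (hAd b) (hAd' b) y) : 𝔸)‖ * ‖(u b : 𝔸)‖ :=
          (norm_mul_le _ _).trans (mul_le_mul_of_nonneg_right (norm_mul_le _ _) (norm_nonneg _))
      _ ≤ 1 * ‖(↑(Adg (hAd b) (hAd' b) y) : 𝔸)‖ * 1 := by gcongr
      _ = _ := by ring

/-- **`‖R(u)Y‖ = ‖Y‖`** on the product carrier in the sup norm over the bonds, for norm-one units («they are local,
orthogonal transformations») — the binder `hU` of `sigma_phi_gauge_haar` for `𝒴 = (ι → 𝔤)`.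
[cite: Balaban1987RG1, (2.16) p.269] -/
theorem norm_piAdg (hu : ∀ b, ‖(u b : 𝔸)‖ ≤ 1) (hu' : ∀ b, ‖(↑(u b)⁻¹ : 𝔸)‖ ≤ 1) (Y : ι → 𝔤) :
    ‖ContinuousLinearEquiv.piCongrRight (fun b => Adg (hAd b) (hAd' b)) Y‖ = ‖Y‖ := by
  refine le_antisymm ((pi_norm_le_iff_of_nonneg (norm_nonneg Y)).2 fun b => ?_)
    ((pi_norm_le_iff_of_nonneg (norm_nonneg _)).2 fun b => ?_)
  · rw [ContinuousLinearEquiv.piCongrRight_apply, norm_Adg_apply hAd hAd' b (hu b) (hu' b)]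
    exact norm_le_pi_norm Y b
  · rw [← norm_Adg_apply hAd hAd' b (hu b) (hu' b) (Y b)]
    exact norm_le_pi_norm (ContinuousLinearEquiv.piCongrRight (fun b => Adg (hAd b) (hAd' b)) Y) b

/-- Inhabitant of §6's hypotheses on `U` beyond §5's model: the trivial gauge `u_b = 1` — `Ad 1` preserves every
`𝔤`, and `‖1‖ ≤ 1`, `‖1⁻¹‖ ≤ 1` in a norm-one algebra. [cite: Balaban1987RG1, (2.16) p.269] -/
example [NormOneClass 𝔸] :
    (∀ b : ι, ‖((fun _ : ι => (1 : 𝔸ˣ)) b : 𝔸)‖ ≤ 1 ∧ ‖(↑((fun _ : ι => (1 : 𝔸ˣ)) b)⁻¹ : 𝔸)‖ ≤ 1) ∧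
      ∀ b : ι, ∀ y ∈ 𝔤, (((fun _ : ι => (1 : 𝔸ˣ)) b : 𝔸ˣ) : 𝔸) * y * ↑((fun _ : ι => (1 : 𝔸ˣ)) b)⁻¹ ∈ 𝔤 :=
  ⟨fun b => by simp, fun b y hy => by simpa using hy⟩

end haar


/-! ## §7  (v1.2) The derivative identities of §2 WITHOUT the analyticity binder, and THE `ℤᵈ` JUNCTION: every binder of
§§2, 4 DISCHARGED for [I]'s genuine average on r09's `ℓ^∞` carrier `B12LinearizationGenuineZd.BField`

(a) In §2 the conjugation of the Fréchet derivatives, `DD̃′(UB₀) = V∘DD̃(B₀)∘U⁻¹` and `DΦ′(UB₀) = U∘DΦ(B₀)∘U⁻¹`, was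
derived from the chain rule under the analyticity binder `hCa` (needed there only to know that `D̃` is differentiable).
The identities hold UNCONDITIONALLY: near `UB₀` the primed maps ARE `V∘D̃∘U⁻¹`, `U∘Φ∘U⁻¹` (§2's `Dt_gauge` ∕ `phi_gauge`
on the open ball), and `fderiv (V ∘ f ∘ U⁻¹)(UB₀) = V ∘ fderiv f (B₀) ∘ U⁻¹` for continuous linear equivalences with NO
differentiability hypothesis (both sides vanish together; Mathlib `ContinuousLinearEquiv.comp_fderiv` ∕
`comp_right_fderiv`).  Hence `fderiv_Dt_gauge'`, `jacobianOp_gauge'`, `fderiv_phi_gauge'`, `det_fderiv_phi_gauge'` —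
§2–§3's statements minus `hCa`, `hCa'` (the operator LOGARITHM of §3 keeps them: `‖J‖ < 1` is a Cauchy estimate).
(b) THE JUNCTION (HONEST SCOPE (i) of v1.0–v1.1: «the junction of the abstract carrier with the ℤᵈ one … is not
written»).  On r09's carrier — `𝒳 = 𝒴 = ℓ^∞(bonds of ℤᵈ; 𝔸)` (`BField`), the letters OF RECORD `hfield` (h),
`Cfield` (C̃ = Q̃ − LQ̃) of `B12LinearizationGenuineZd` at a bondwise-`U1`, `ε₀`-regular background `V` and at `V^u`
(`QuantumLattice.gaugeTransformZd u V`), the lineage's explicit constants `C₂ = 192000(dL)²`, `R = 1/(4800dL)`,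
`b = H = (Lᵈ/L)/(1 − (Lᵈ/L)·24ω_A(ε₀))` (the SAME at `V` and `V^u`: they do not see the background) — the (2.16) map
`B′ → R(u)B′` is r09's `B12Def267Covariance.rotBF`, here UPGRADED to a continuous linear ISOMETRIC EQUIVALENCE of `ℓ^∞`
(`rotBFL`, with body: `ℂ`-linearity of the bondwise conjugation, inverse `R(u⁻¹)`, `‖R(u)Y‖ = ‖Y‖` = his `norm_rotBF`):
`U = R(u)` (fine bonds, `u(b₋)`), `V = R(u(L·))` (coarse bonds, `u(Lc₋)`, his `rotBF (u ∘ blockBase L)`).  THEN EVERY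
BINDER OF §2 IS A LANDED THEOREM: `hC`, `hC'` = `quadAnalytic_Cfield` (at `V`, at `V^u`); `hHop`, `hHop'` =
`norm_hfield_le`; `hU`, `hV` = `norm_rotBF`; `hhop` = `hfield_gaugeTransformZd`; `hCt` = `Cfield_gaugeTransformZd`
(r09 g45, [Balaban1987RG1] p. 267 «Of course h is uniquely defined by these conditions» + the covariance of `Q̃`);
`hDball`∕`hDfix` (both systems) = the solution clauses of `p267_genuine` — so for ANY two solutions `D̃_V`, `D̃_{V^u}`
of the p. 267 equation in the ball (`p267_genuine` supplies one at each background; r09's `Dtilde_gaugeTransformZd`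
states the same covariance with the UNIQUENESS clause of `p267_genuine` at `V^u` as the hypothesis on `D̃_{V^u}` — here
the SOLUTION clause suffices, uniqueness in the ball being a theorem of the scheme, `B12Lineariz267.eq_Dt_of_fixedPt`):
**`Dt_gauge_genuineZd`** `D̃_{V^u}(R(u)B) = R(u(L·))D̃_V(B)`,
**`phi_gauge_genuineZd`** `Φ_{V^u}(R(u)B) = R(u)Φ_V(B)`, **`fderiv_phi_gauge_genuineZd`**
`DΦ_{V^u}(R(u)B₀) = R(u)∘DΦ_V(B₀)∘R(u)⁻¹`, **`sigma_phi_gauge_genuineZd`** `σ(Φ_{V^u}(R(u)B)) = σ(Φ_V(B))` for every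
`R(u)`-invariant functional `σ` of the fine field, and the packaged **`p269_measure_terms_genuineZd`** (with the two
`D̃`'s PRODUCED from `p267_genuine`): hypotheses = `0 < L`, `1 ≤ d`, `V`, `u` bondwise in `U1`, `(dL)²ε₀ ≤ 1/200`,
`ε₀`-regularity (44), the Neumann budget `(Lᵈ/L)·24ω_A(ε₀) < 1`, and the radius conditions `9C₂Hε < 1`, `3ε ≤ R` —
nothing about `h`, `C̃`, `D̃`, `U`, `V` is assumed; **`exists_radius`** (a radius meeting both conditions exists under the
budget) and a FULL flat-background inhabitant (`V ≡ 1`, `u ≡ 1`, `ε₀ = 0`: radius, both `D̃` and (i)–(ii) produced)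
close the section.  NOT on this carrier: «Tr log» and `det DΦ` (no finite dimension on
`ℓ^∞(ℤᵈ)`; print's torus is finite — the torus-carrier `LQ̃`∕`Q̃` of (0.11)∕(0.12) is not constructed in the tree, cell
`B12-CLOSURE.md` gen 48 (c)), the operator logarithm (no Fréchet analyticity of `C̃` on `ℓ^∞`, `B12LinearizationGenuineZd`
scope (b)), and print's Haar `σ` (𝔸-valued fields carry no `𝐠`; §6 is the product-carrier statement).
[cite: Balaban1987RG1, p.267, (2.12) p.268, (2.16) p.269] -/

section equivariance_free

variable {𝒳 𝒴 : Type*} [NormedAddCommGroup 𝒳] [NormedSpace ℂ 𝒳] [CompleteSpace 𝒳]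
  [NormedAddCommGroup 𝒴] [NormedSpace ℂ 𝒴]
  {hop hop' : 𝒳 →ₗ[ℂ] 𝒴} {Ct Ct' : 𝒴 → 𝒳} {C₂ R b ε : ℝ} {Dt Dt' : 𝒴 → 𝒳}
  {V : 𝒳 ≃L[ℂ] 𝒳} {U : 𝒴 ≃L[ℂ] 𝒴}

/-- LOCAL FORM of §2's `Dt_gauge`: near `U B₀` (the ball `‖·‖ < ε` is open and `U` is isometric) the primed solution IS
the transported one, `D̃′ = V ∘ D̃ ∘ U⁻¹` eventually. [cite: Balaban1987RG1, p.267, (2.16) p.269] -/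
theorem Dt_gauge_eventuallyEq (hC : QuadAnalytic Ct C₂ R) (hC' : QuadAnalytic Ct' C₂ R) (hC₂ : 0 ≤ C₂) (hb : 0 ≤ b)
    (hHop : ∀ X, ‖hop X‖ ≤ b * ‖X‖) (hHop' : ∀ X, ‖hop' X‖ ≤ b * ‖X‖) (hq : 9 * C₂ * b * ε < 1)
    (hRC : 3 * ε ≤ R)
    (hDball : ∀ B : 𝒴, ‖B‖ < ε → Dt B ∈ closedBall (0:𝒳) (4 * C₂ * ε ^ 2))
    (hDfix : ∀ B : 𝒴, ‖B‖ < ε → Ct (B - hop (Dt B)) = Dt B)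
    (hDball' : ∀ B : 𝒴, ‖B‖ < ε → Dt' B ∈ closedBall (0:𝒳) (4 * C₂ * ε ^ 2))
    (hDfix' : ∀ B : 𝒴, ‖B‖ < ε → Ct' (B - hop' (Dt' B)) = Dt' B)
    (hU : ∀ Y, ‖U Y‖ = ‖Y‖) (hV : ∀ X, ‖V X‖ = ‖X‖)
    (hhop : ∀ X, hop' (V X) = U (hop X)) (hCt : ∀ Y : 𝒴, ‖Y‖ < R → Ct' (U Y) = V (Ct Y))
    {B₀ : 𝒴} (hB₀ : ‖B₀‖ < ε) :
    Dt' =ᶠ[𝓝 (U B₀)] (⇑V ∘ Dt ∘ ⇑U.symm) := by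
  have hUB₀ : ‖U B₀‖ < ε := by rwa [hU]
  filter_upwards [(isOpen_lt continuous_norm continuous_const).mem_nhds hUB₀] with B' hB'
  have hA : ‖U.symm B'‖ < ε := by
    have h := hU (U.symm B'); rw [U.apply_symm_apply] at h; rwa [← h]
  have h := Dt_gauge hC hC' hC₂ hb hHop hHop' hq hRC hDball hDfix hDball' hDfix' hU hV hhop hCt hA
  rw [U.apply_symm_apply] at h
  simpa using h

/-- **`DD̃′(U B₀) = V ∘ DD̃(B₀) ∘ U⁻¹` WITHOUT the analyticity binder** of §2's `fderiv_Dt_gauge`: the Fréchet derivative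
of `V ∘ D̃ ∘ U⁻¹` at `UB₀` is `V ∘ DD̃(B₀) ∘ U⁻¹` whether or not `D̃` is differentiable at `B₀` (both sides vanish
otherwise). [cite: Balaban1987RG1, p.267, (2.16) p.269] -/
theorem fderiv_Dt_gauge' (hC : QuadAnalytic Ct C₂ R) (hC' : QuadAnalytic Ct' C₂ R) (hC₂ : 0 ≤ C₂) (hb : 0 ≤ b)
    (hHop : ∀ X, ‖hop X‖ ≤ b * ‖X‖) (hHop' : ∀ X, ‖hop' X‖ ≤ b * ‖X‖) (hq : 9 * C₂ * b * ε < 1)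
    (hRC : 3 * ε ≤ R)
    (hDball : ∀ B : 𝒴, ‖B‖ < ε → Dt B ∈ closedBall (0:𝒳) (4 * C₂ * ε ^ 2))
    (hDfix : ∀ B : 𝒴, ‖B‖ < ε → Ct (B - hop (Dt B)) = Dt B)
    (hDball' : ∀ B : 𝒴, ‖B‖ < ε → Dt' B ∈ closedBall (0:𝒳) (4 * C₂ * ε ^ 2))
    (hDfix' : ∀ B : 𝒴, ‖B‖ < ε → Ct' (B - hop' (Dt' B)) = Dt' B)
    (hU : ∀ Y, ‖U Y‖ = ‖Y‖) (hV : ∀ X, ‖V X‖ = ‖X‖)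
    (hhop : ∀ X, hop' (V X) = U (hop X)) (hCt : ∀ Y : 𝒴, ‖Y‖ < R → Ct' (U Y) = V (Ct Y))
    {B₀ : 𝒴} (hB₀ : ‖B₀‖ < ε) :
    fderiv ℂ Dt' (U B₀) = (V : 𝒳 →L[ℂ] 𝒳) ∘L fderiv ℂ Dt B₀ ∘L (U.symm : 𝒴 →L[ℂ] 𝒴) := by
  rw [(Dt_gauge_eventuallyEq hC hC' hC₂ hb hHop hHop' hq hRC hDball hDfix hDball' hDfix' hU hV hhop hCt hB₀).fderiv_eq,
    V.comp_fderiv, U.symm.comp_right_fderiv, U.symm_apply_apply]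

/-- **`J′(U B₀) = U ∘ J(B₀) ∘ U⁻¹`** for `J = h∘DD̃`, without the analyticity binder. [cite: Balaban1987RG1, (2.12) p.268, (2.16) p.269] -/
theorem jacobianOp_gauge' (hC : QuadAnalytic Ct C₂ R) (hC' : QuadAnalytic Ct' C₂ R) (hC₂ : 0 ≤ C₂) (hb : 0 ≤ b)
    (hHop : ∀ X, ‖hop X‖ ≤ b * ‖X‖) (hHop' : ∀ X, ‖hop' X‖ ≤ b * ‖X‖) (hq : 9 * C₂ * b * ε < 1)
    (hRC : 3 * ε ≤ R)
    (hDball : ∀ B : 𝒴, ‖B‖ < ε → Dt B ∈ closedBall (0:𝒳) (4 * C₂ * ε ^ 2))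
    (hDfix : ∀ B : 𝒴, ‖B‖ < ε → Ct (B - hop (Dt B)) = Dt B)
    (hDball' : ∀ B : 𝒴, ‖B‖ < ε → Dt' B ∈ closedBall (0:𝒳) (4 * C₂ * ε ^ 2))
    (hDfix' : ∀ B : 𝒴, ‖B‖ < ε → Ct' (B - hop' (Dt' B)) = Dt' B)
    (hU : ∀ Y, ‖U Y‖ = ‖Y‖) (hV : ∀ X, ‖V X‖ = ‖X‖)
    (hhop : ∀ X, hop' (V X) = U (hop X)) (hCt : ∀ Y : 𝒴, ‖Y‖ < R → Ct' (U Y) = V (Ct Y))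
    {B₀ : 𝒴} (hB₀ : ‖B₀‖ < ε) :
    hop'.mkContinuous b hHop' ∘L fderiv ℂ Dt' (U B₀) =
      (U : 𝒴 →L[ℂ] 𝒴) ∘L (hop.mkContinuous b hHop ∘L fderiv ℂ Dt B₀) ∘L (U.symm : 𝒴 →L[ℂ] 𝒴) := by
  rw [fderiv_Dt_gauge' hC hC' hC₂ hb hHop hHop' hq hRC hDball hDfix hDball' hDfix' hU hV hhop hCt hB₀]
  ext v
  simp [hhop]

/-- LOCAL FORM of §2's `phi_gauge`: near `U B₀`, `Φ′ = U ∘ Φ ∘ U⁻¹` eventually. [cite: Balaban1987RG1, p.267, (2.16) p.269] -/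
theorem phi_gauge_eventuallyEq (hC : QuadAnalytic Ct C₂ R) (hC' : QuadAnalytic Ct' C₂ R) (hC₂ : 0 ≤ C₂) (hb : 0 ≤ b)
    (hHop : ∀ X, ‖hop X‖ ≤ b * ‖X‖) (hHop' : ∀ X, ‖hop' X‖ ≤ b * ‖X‖) (hq : 9 * C₂ * b * ε < 1)
    (hRC : 3 * ε ≤ R)
    (hDball : ∀ B : 𝒴, ‖B‖ < ε → Dt B ∈ closedBall (0:𝒳) (4 * C₂ * ε ^ 2))
    (hDfix : ∀ B : 𝒴, ‖B‖ < ε → Ct (B - hop (Dt B)) = Dt B)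
    (hDball' : ∀ B : 𝒴, ‖B‖ < ε → Dt' B ∈ closedBall (0:𝒳) (4 * C₂ * ε ^ 2))
    (hDfix' : ∀ B : 𝒴, ‖B‖ < ε → Ct' (B - hop' (Dt' B)) = Dt' B)
    (hU : ∀ Y, ‖U Y‖ = ‖Y‖) (hV : ∀ X, ‖V X‖ = ‖X‖)
    (hhop : ∀ X, hop' (V X) = U (hop X)) (hCt : ∀ Y : 𝒴, ‖Y‖ < R → Ct' (U Y) = V (Ct Y))
    {B₀ : 𝒴} (hB₀ : ‖B₀‖ < ε) :
    (fun B => B - hop' (Dt' B)) =ᶠ[𝓝 (U B₀)] (⇑U ∘ (fun B => B - hop (Dt B)) ∘ ⇑U.symm) := by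
  have hUB₀ : ‖U B₀‖ < ε := by rwa [hU]
  filter_upwards [(isOpen_lt continuous_norm continuous_const).mem_nhds hUB₀] with B' hB'
  have hA : ‖U.symm B'‖ < ε := by
    have h := hU (U.symm B'); rw [U.apply_symm_apply] at h; rwa [← h]
  have h := phi_gauge hC hC' hC₂ hb hHop hHop' hq hRC hDball hDfix hDball' hDfix' hU hV hhop hCt hA
  rw [U.apply_symm_apply] at h
  simpa using h

/-- **`DΦ′(U B₀) = U ∘ DΦ(B₀) ∘ U⁻¹` WITHOUT the analyticity binders** of §2's `fderiv_phi_gauge`. [cite: Balaban1987RG1, (2.12) p.268, (2.16) p.269] -/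
theorem fderiv_phi_gauge' (hC : QuadAnalytic Ct C₂ R) (hC' : QuadAnalytic Ct' C₂ R) (hC₂ : 0 ≤ C₂) (hb : 0 ≤ b)
    (hHop : ∀ X, ‖hop X‖ ≤ b * ‖X‖) (hHop' : ∀ X, ‖hop' X‖ ≤ b * ‖X‖) (hq : 9 * C₂ * b * ε < 1)
    (hRC : 3 * ε ≤ R)
    (hDball : ∀ B : 𝒴, ‖B‖ < ε → Dt B ∈ closedBall (0:𝒳) (4 * C₂ * ε ^ 2))
    (hDfix : ∀ B : 𝒴, ‖B‖ < ε → Ct (B - hop (Dt B)) = Dt B)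
    (hDball' : ∀ B : 𝒴, ‖B‖ < ε → Dt' B ∈ closedBall (0:𝒳) (4 * C₂ * ε ^ 2))
    (hDfix' : ∀ B : 𝒴, ‖B‖ < ε → Ct' (B - hop' (Dt' B)) = Dt' B)
    (hU : ∀ Y, ‖U Y‖ = ‖Y‖) (hV : ∀ X, ‖V X‖ = ‖X‖)
    (hhop : ∀ X, hop' (V X) = U (hop X)) (hCt : ∀ Y : 𝒴, ‖Y‖ < R → Ct' (U Y) = V (Ct Y))
    {B₀ : 𝒴} (hB₀ : ‖B₀‖ < ε) :
    fderiv ℂ (fun B => B - hop' (Dt' B)) (U B₀) =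
      (U : 𝒴 →L[ℂ] 𝒴) ∘L fderiv ℂ (fun B => B - hop (Dt B)) B₀ ∘L (U.symm : 𝒴 →L[ℂ] 𝒴) := by
  rw [(phi_gauge_eventuallyEq hC hC' hC₂ hb hHop hHop' hq hRC hDball hDfix hDball' hDfix' hU hV hhop hCt hB₀).fderiv_eq,
    U.comp_fderiv, U.symm.comp_right_fderiv, U.symm_apply_apply]

/-- **`det DΦ′(U B₀) = det DΦ(B₀)` WITHOUT the analyticity binders** of §3's `det_fderiv_phi_gauge`. [cite: Balaban1987RG1, (2.12) p.268, (2.16) p.269] -/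
theorem det_fderiv_phi_gauge' (hC : QuadAnalytic Ct C₂ R) (hC' : QuadAnalytic Ct' C₂ R) (hC₂ : 0 ≤ C₂) (hb : 0 ≤ b)
    (hHop : ∀ X, ‖hop X‖ ≤ b * ‖X‖) (hHop' : ∀ X, ‖hop' X‖ ≤ b * ‖X‖) (hq : 9 * C₂ * b * ε < 1)
    (hRC : 3 * ε ≤ R)
    (hDball : ∀ B : 𝒴, ‖B‖ < ε → Dt B ∈ closedBall (0:𝒳) (4 * C₂ * ε ^ 2))
    (hDfix : ∀ B : 𝒴, ‖B‖ < ε → Ct (B - hop (Dt B)) = Dt B)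
    (hDball' : ∀ B : 𝒴, ‖B‖ < ε → Dt' B ∈ closedBall (0:𝒳) (4 * C₂ * ε ^ 2))
    (hDfix' : ∀ B : 𝒴, ‖B‖ < ε → Ct' (B - hop' (Dt' B)) = Dt' B)
    (hU : ∀ Y, ‖U Y‖ = ‖Y‖) (hV : ∀ X, ‖V X‖ = ‖X‖)
    (hhop : ∀ X, hop' (V X) = U (hop X)) (hCt : ∀ Y : 𝒴, ‖Y‖ < R → Ct' (U Y) = V (Ct Y))
    {B₀ : 𝒴} (hB₀ : ‖B₀‖ < ε) :
    LinearMap.det ((fderiv ℂ (fun B => B - hop' (Dt' B)) (U B₀) : 𝒴 →L[ℂ] 𝒴) : 𝒴 →ₗ[ℂ] 𝒴) =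
      LinearMap.det ((fderiv ℂ (fun B => B - hop (Dt B)) B₀ : 𝒴 →L[ℂ] 𝒴) : 𝒴 →ₗ[ℂ] 𝒴) := by
  rw [fderiv_phi_gauge' hC hC' hC₂ hb hHop hHop' hq hRC hDball hDfix hDball' hDfix' hU hV hhop hCt hB₀, det_conj_eq]

end equivariance_free

/-! ### §7 (b)  The `ℤᵈ` junction: (2.16) as a continuous linear isometric equivalence of `ℓ^∞`, and §§2, 4 with every
binder discharged for the letters of `B12LinearizationGenuineZd` ∕ `B12Def267Covariance` -/

section rotZd

open B12LinearizationGenuineZd (BField)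
open B12Def267Covariance (rotBF coe_rotBF norm_rotBF norm_rotBF_le rotBF_inv_rotBF rotB_rotB_inv)
open B12Average012Covariance (rotB rotB_apply)
open B7Prop1Explicit (U1)

variable {d : ℕ} {𝔸 : Type*} [NormedRing 𝔸] [NormedAlgebra ℂ 𝔸] [NormOneClass 𝔸]

omit [NormedAlgebra ℂ 𝔸] in
/-- `R(w)` is additive on `ℓ^∞` (plumbing for `rotBFL`). [folklore] -/
private theorem rotBF_add (w : (Fin d → ℤ) → 𝔸ˣ) (hw : ∀ z, w z ∈ U1 𝔸) (Y Z : BField d 𝔸) :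
    rotBF w hw (Y + Z) = rotBF w hw Y + rotBF w hw Z :=
  lp.ext (funext fun b => by
    simp only [coe_rotBF, lp.coeFn_add, Pi.add_apply, rotB_apply, mul_add, add_mul])

/-- `R(w)` is `ℂ`-homogeneous on `ℓ^∞` (bondwise conjugation commutes with scalars; plumbing for `rotBFL`). [folklore] -/
private theorem rotBF_smul (w : (Fin d → ℤ) → 𝔸ˣ) (hw : ∀ z, w z ∈ U1 𝔸) (a : ℂ) (Y : BField d 𝔸) :
    rotBF w hw (a • Y) = a • rotBF w hw Y :=
  lp.ext (funext fun b => by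
    simp only [coe_rotBF, lp.coeFn_smul, Pi.smul_apply, rotB_apply, mul_smul_comm, smul_mul_assoc])

omit [NormedAlgebra ℂ 𝔸] in
/-- `R(w)R(w⁻¹) = 1` on `ℓ^∞` (the twin of r09's `rotBF_inv_rotBF`; plumbing for `rotBFL`). [folklore] -/
private theorem rotBF_rotBF_inv (w : (Fin d → ℤ) → 𝔸ˣ) (hw : ∀ z, w z ∈ U1 𝔸) (Y : BField d 𝔸) :
    rotBF w hw (rotBF w⁻¹ (fun z => (U1 𝔸).inv_mem (hw z)) Y) = Y :=
  lp.ext (by rw [coe_rotBF, coe_rotBF, rotB_rotB_inv])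

/-- **(2.16) `B′ → R(u)B′, (R(u)B′)(b) = R(u(b₋))B′(b)` AS A CONTINUOUS LINEAR ISOMETRIC EQUIVALENCE OF `ℓ^∞`** («they
are local, orthogonal transformations»): r09's self-map `B12Def267Covariance.rotBF w` (bondwise conjugation by
`w(b₋) ∈ U1`) with its `ℂ`-linearity, the bound `‖R(w)Y‖ ≤ ‖Y‖` and the two-sided inverse `R(w⁻¹)` packaged as
`ℓ^∞ ≃L[ℂ] ℓ^∞` — the shape of the binders `U`, `V` of §§2–5. [cite: Balaban1987RG1, (2.16) p.269] -/
noncomputable def rotBFL (w : (Fin d → ℤ) → 𝔸ˣ) (hw : ∀ z, w z ∈ U1 𝔸) : BField d 𝔸 ≃L[ℂ] BField d 𝔸 :=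
  ContinuousLinearEquiv.equivOfInverse
    (LinearMap.mkContinuous
      { toFun := rotBF w hw, map_add' := rotBF_add w hw, map_smul' := rotBF_smul w hw } 1
      fun Y => by rw [one_mul]; exact norm_rotBF_le w hw Y)
    (LinearMap.mkContinuous
      { toFun := rotBF w⁻¹ (fun z => (U1 𝔸).inv_mem (hw z)),
        map_add' := rotBF_add w⁻¹ (fun z => (U1 𝔸).inv_mem (hw z)),
        map_smul' := rotBF_smul w⁻¹ (fun z => (U1 𝔸).inv_mem (hw z)) } 1
      fun Y => by rw [one_mul]; exact norm_rotBF_le w⁻¹ (fun z => (U1 𝔸).inv_mem (hw z)) Y)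
    (rotBF_inv_rotBF w hw) (rotBF_rotBF_inv w hw)

/-- `rotBFL w hw Y = rotBF w hw Y` (the underlying map is r09's). [cite: Balaban1987RG1, (2.16) p.269] -/
theorem rotBFL_apply (w : (Fin d → ℤ) → 𝔸ˣ) (hw : ∀ z, w z ∈ U1 𝔸) (Y : BField d 𝔸) :
    rotBFL w hw Y = rotBF w hw Y := rfl

/-- Bondwise: `(R(w)Y)(b) = w(b₋) Y(b) w(b₋)⁻¹`. [cite: Balaban1987RG1, (2.16) p.269] -/
theorem rotBFL_apply_apply (w : (Fin d → ℤ) → 𝔸ˣ) (hw : ∀ z, w z ∈ U1 𝔸) (Y : BField d 𝔸) (b : ZdEdge d) :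
    (rotBFL w hw Y : ZdEdge d → 𝔸) b = (w b.1 : 𝔸) * Y b * (((w b.1)⁻¹ : 𝔸ˣ) : 𝔸) := rfl

/-- The inverse of `R(w)` is `R(w⁻¹)`. [cite: Balaban1987RG1, (2.16) p.269] -/
theorem rotBFL_symm_apply (w : (Fin d → ℤ) → 𝔸ˣ) (hw : ∀ z, w z ∈ U1 𝔸) (Y : BField d 𝔸) :
    (rotBFL w hw).symm Y = rotBF w⁻¹ (fun z => (U1 𝔸).inv_mem (hw z)) Y := rfl

/-- **`‖R(w)Y‖ = ‖Y‖`** — the isometry binder `hU` ∕ `hV` of §§2–5 on `ℓ^∞` (r09's `norm_rotBF`). [cite: Balaban1987RG1, (2.16) p.269] -/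
theorem norm_rotBFL (w : (Fin d → ℤ) → 𝔸ˣ) (hw : ∀ z, w z ∈ U1 𝔸) (Y : BField d 𝔸) : ‖rotBFL w hw Y‖ = ‖Y‖ :=
  norm_rotBF w hw Y

end rotZd

section genuineZd

open B12LinearizationGenuineZd (BField hfield Cfield norm_hfield_le quadAnalytic_Cfield p267_genuine)
open B12Def267Covariance (rotBF norm_rotBF mem_U1_gaugeTransformZd plaq_gaugeTransformZd_le hfield_gaugeTransformZd
  Cfield_gaugeTransformZd)
open B7Prop1Explicit (U1)
open B12ContourAverage253 (omegaA)
open Literature.MathematicalPhysics.QuantumLattice (blockBase plaquetteHolonomyZd gaugeTransformZd)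

variable {d : ℕ} {𝔸 : Type*} [NormedRing 𝔸] [NormedAlgebra ℂ 𝔸] [NormOneClass 𝔸] [CompleteSpace 𝔸] {L : ℕ}
  (hL : 0 < L) (hd : 1 ≤ d) (V : ZdEdge d → 𝔸ˣ) (hV : ∀ b, V b ∈ U1 𝔸) {u : (Fin d → ℤ) → 𝔸ˣ}
  (hu : ∀ z, u z ∈ U1 𝔸) {ε₀ : ℝ} (hε₀ : 0 ≤ ε₀) (hsm : ((d : ℝ) * L) ^ 2 * ε₀ ≤ 1 / 200)
  (h44 : ∀ (p : Fin d → ℤ) (i j : Fin d), i ≠ j → ‖((plaquetteHolonomyZd V p i j : 𝔸ˣ) : 𝔸) - 1‖ ≤ ε₀)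
  (hbud : (L : ℝ) ^ d / L * (24 * omegaA d L ε₀) < 1)

/-- **`D̃_{V^u}(R(u)B) = R(u(L·))D̃_V(B)` WITH EVERY BINDER OF §2 DISCHARGED** — §2's `Dt_gauge` on r09's `ℓ^∞` carrier
for the letters of [I]'s genuine average: `h = hfield`, `C̃ = Cfield` at `V` and at `V^u` (same constants
`C₂ = 192000(dL)²`, `R = 1/(4800dL)`, `H`), `U = R(u)` on the fine field, `V = R(u(L·))` on the coarse field; the
covariance binders are r09's `hfield_gaugeTransformZd` ∕ `Cfield_gaugeTransformZd`, the isometries his `norm_rotBF`,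
the `QuadAnalytic` ∕ `‖h‖ ≤ H` hypotheses `quadAnalytic_Cfield` ∕ `norm_hfield_le`.  For ANY solution `D̃_V` of the
p. 267 equation in the ball at `V` and ANY solution `D̃_{V^u}` at `V^u` (both exist: `p267_genuine`; uniqueness in
the ball is a THEOREM of the scheme, `B12Lineariz267.eq_Dt_of_fixedPt` — r09's `Dtilde_gaugeTransformZd` states the
same covariance with the uniqueness CLAUSE at `V^u` as its hypothesis on `D̃_{V^u}` instead of the solution clause).
[cite: Balaban1987RG1, p.267, (2.16) p.269] -/
theorem Dt_gauge_genuineZd {ε : ℝ} {DtV DtU : BField d 𝔸 → BField d 𝔸}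
    (hq : 9 * (192000 * ((d : ℝ) * L) ^ 2) * (((L : ℝ) ^ d / L) / (1 - (L : ℝ) ^ d / L * (24 * omegaA d L ε₀))) * ε < 1)
    (hRC : 3 * ε ≤ 1 / (4800 * ((d : ℝ) * L)))
    (hDtV : ∀ B : BField d 𝔸, ‖B‖ < ε →
      DtV B ∈ closedBall (0 : BField d 𝔸) (4 * (192000 * ((d : ℝ) * L) ^ 2) * ε ^ 2) ∧
      Cfield hL hd V hV hε₀ hsm h44 (B - hfield hL hd V hV hε₀ hsm h44 hbud (DtV B)) = DtV B)
    (hDtU : ∀ B : BField d 𝔸, ‖B‖ < ε →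
      DtU B ∈ closedBall (0 : BField d 𝔸) (4 * (192000 * ((d : ℝ) * L) ^ 2) * ε ^ 2) ∧
      Cfield hL hd (gaugeTransformZd u V) (mem_U1_gaugeTransformZd hV hu) hε₀ hsm (plaq_gaugeTransformZd_le V hu h44)
          (B - hfield hL hd (gaugeTransformZd u V) (mem_U1_gaugeTransformZd hV hu) hε₀ hsm
            (plaq_gaugeTransformZd_le V hu h44) hbud (DtU B)) = DtU B)
    {B : BField d 𝔸} (hB : ‖B‖ < ε) :
    DtU (rotBFL u hu B) = rotBFL (fun y => u (blockBase L y)) (fun _ => hu _) (DtV B) :=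
  Dt_gauge (U := rotBFL u hu) (V := rotBFL (fun y => u (blockBase L y)) (fun _ => hu _))
    (quadAnalytic_Cfield hL hd V hV hε₀ hsm h44)
    (quadAnalytic_Cfield hL hd (gaugeTransformZd u V) (mem_U1_gaugeTransformZd hV hu) hε₀ hsm
      (plaq_gaugeTransformZd_le V hu h44))
    (by positivity) (B12B0RestrictionAverage267.H_nonneg L d hbud) (norm_hfield_le hL hd V hV hε₀ hsm h44 hbud)
    (norm_hfield_le hL hd (gaugeTransformZd u V) (mem_U1_gaugeTransformZd hV hu) hε₀ hsm
      (plaq_gaugeTransformZd_le V hu h44) hbud)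
    hq hRC (fun B hB => (hDtV B hB).1) (fun B hB => (hDtV B hB).2) (fun B hB => (hDtU B hB).1)
    (fun B hB => (hDtU B hB).2) (norm_rotBF u hu) (norm_rotBF (fun y => u (blockBase L y)) (fun _ => hu _))
    (hfield_gaugeTransformZd hL hd V hV hu hε₀ hsm h44 hbud)
    (fun Y _ => Cfield_gaugeTransformZd hL hd V hV hu hε₀ hsm h44 Y) hB

/-- **`Φ_{V^u}(R(u)B) = R(u)Φ_V(B)`** for the linearizing substitutions `Φ_V(B) = B − h_V D̃_V(B)` of [I]'s genuine
average on `ℓ^∞`, every binder discharged (as in `Dt_gauge_genuineZd`). [cite: Balaban1987RG1, p.267, (2.16) p.269] -/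
theorem phi_gauge_genuineZd {ε : ℝ} {DtV DtU : BField d 𝔸 → BField d 𝔸}
    (hq : 9 * (192000 * ((d : ℝ) * L) ^ 2) * (((L : ℝ) ^ d / L) / (1 - (L : ℝ) ^ d / L * (24 * omegaA d L ε₀))) * ε < 1)
    (hRC : 3 * ε ≤ 1 / (4800 * ((d : ℝ) * L)))
    (hDtV : ∀ B : BField d 𝔸, ‖B‖ < ε →
      DtV B ∈ closedBall (0 : BField d 𝔸) (4 * (192000 * ((d : ℝ) * L) ^ 2) * ε ^ 2) ∧
      Cfield hL hd V hV hε₀ hsm h44 (B - hfield hL hd V hV hε₀ hsm h44 hbud (DtV B)) = DtV B)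
    (hDtU : ∀ B : BField d 𝔸, ‖B‖ < ε →
      DtU B ∈ closedBall (0 : BField d 𝔸) (4 * (192000 * ((d : ℝ) * L) ^ 2) * ε ^ 2) ∧
      Cfield hL hd (gaugeTransformZd u V) (mem_U1_gaugeTransformZd hV hu) hε₀ hsm (plaq_gaugeTransformZd_le V hu h44)
          (B - hfield hL hd (gaugeTransformZd u V) (mem_U1_gaugeTransformZd hV hu) hε₀ hsm
            (plaq_gaugeTransformZd_le V hu h44) hbud (DtU B)) = DtU B)
    {B : BField d 𝔸} (hB : ‖B‖ < ε) :
    rotBFL u hu B - hfield hL hd (gaugeTransformZd u V) (mem_U1_gaugeTransformZd hV hu) hε₀ hsm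
        (plaq_gaugeTransformZd_le V hu h44) hbud (DtU (rotBFL u hu B)) =
      rotBFL u hu (B - hfield hL hd V hV hε₀ hsm h44 hbud (DtV B)) :=
  phi_gauge (U := rotBFL u hu) (V := rotBFL (fun y => u (blockBase L y)) (fun _ => hu _))
    (quadAnalytic_Cfield hL hd V hV hε₀ hsm h44)
    (quadAnalytic_Cfield hL hd (gaugeTransformZd u V) (mem_U1_gaugeTransformZd hV hu) hε₀ hsm
      (plaq_gaugeTransformZd_le V hu h44))
    (by positivity) (B12B0RestrictionAverage267.H_nonneg L d hbud) (norm_hfield_le hL hd V hV hε₀ hsm h44 hbud)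
    (norm_hfield_le hL hd (gaugeTransformZd u V) (mem_U1_gaugeTransformZd hV hu) hε₀ hsm
      (plaq_gaugeTransformZd_le V hu h44) hbud)
    hq hRC (fun B hB => (hDtV B hB).1) (fun B hB => (hDtV B hB).2) (fun B hB => (hDtU B hB).1)
    (fun B hB => (hDtU B hB).2) (norm_rotBF u hu) (norm_rotBF (fun y => u (blockBase L y)) (fun _ => hu _))
    (hfield_gaugeTransformZd hL hd V hV hu hε₀ hsm h44 hbud)
    (fun Y _ => Cfield_gaugeTransformZd hL hd V hV hu hε₀ hsm h44 Y) hB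

/-- **`DΦ_{V^u}(R(u)B₀) = R(u) ∘ DΦ_V(B₀) ∘ R(u)⁻¹`** on `ℓ^∞` — the Jacobian operators of the two substitutions
conjugate by the (2.16) isometry (`fderiv_phi_gauge'`: no analyticity needed), every binder discharged.  (Their
determinant ∕ «Tr log» need finite dimension and are NOT stated on this carrier.) [cite: Balaban1987RG1, (2.12) p.268, (2.16) p.269] -/
theorem fderiv_phi_gauge_genuineZd {ε : ℝ} {DtV DtU : BField d 𝔸 → BField d 𝔸}
    (hq : 9 * (192000 * ((d : ℝ) * L) ^ 2) * (((L : ℝ) ^ d / L) / (1 - (L : ℝ) ^ d / L * (24 * omegaA d L ε₀))) * ε < 1)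
    (hRC : 3 * ε ≤ 1 / (4800 * ((d : ℝ) * L)))
    (hDtV : ∀ B : BField d 𝔸, ‖B‖ < ε →
      DtV B ∈ closedBall (0 : BField d 𝔸) (4 * (192000 * ((d : ℝ) * L) ^ 2) * ε ^ 2) ∧
      Cfield hL hd V hV hε₀ hsm h44 (B - hfield hL hd V hV hε₀ hsm h44 hbud (DtV B)) = DtV B)
    (hDtU : ∀ B : BField d 𝔸, ‖B‖ < ε →
      DtU B ∈ closedBall (0 : BField d 𝔸) (4 * (192000 * ((d : ℝ) * L) ^ 2) * ε ^ 2) ∧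
      Cfield hL hd (gaugeTransformZd u V) (mem_U1_gaugeTransformZd hV hu) hε₀ hsm (plaq_gaugeTransformZd_le V hu h44)
          (B - hfield hL hd (gaugeTransformZd u V) (mem_U1_gaugeTransformZd hV hu) hε₀ hsm
            (plaq_gaugeTransformZd_le V hu h44) hbud (DtU B)) = DtU B)
    {B₀ : BField d 𝔸} (hB₀ : ‖B₀‖ < ε) :
    fderiv ℂ (fun B => B - hfield hL hd (gaugeTransformZd u V) (mem_U1_gaugeTransformZd hV hu) hε₀ hsm
        (plaq_gaugeTransformZd_le V hu h44) hbud (DtU B)) (rotBFL u hu B₀) =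
      (rotBFL u hu : BField d 𝔸 →L[ℂ] BField d 𝔸) ∘L
        fderiv ℂ (fun B => B - hfield hL hd V hV hε₀ hsm h44 hbud (DtV B)) B₀ ∘L
          ((rotBFL u hu).symm : BField d 𝔸 →L[ℂ] BField d 𝔸) :=
  fderiv_phi_gauge' (U := rotBFL u hu) (V := rotBFL (fun y => u (blockBase L y)) (fun _ => hu _))
    (quadAnalytic_Cfield hL hd V hV hε₀ hsm h44)
    (quadAnalytic_Cfield hL hd (gaugeTransformZd u V) (mem_U1_gaugeTransformZd hV hu) hε₀ hsm
      (plaq_gaugeTransformZd_le V hu h44))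
    (by positivity) (B12B0RestrictionAverage267.H_nonneg L d hbud) (norm_hfield_le hL hd V hV hε₀ hsm h44 hbud)
    (norm_hfield_le hL hd (gaugeTransformZd u V) (mem_U1_gaugeTransformZd hV hu) hε₀ hsm
      (plaq_gaugeTransformZd_le V hu h44) hbud)
    hq hRC (fun B hB => (hDtV B hB).1) (fun B hB => (hDtV B hB).2) (fun B hB => (hDtU B hB).1)
    (fun B hB => (hDtU B hB).2) (norm_rotBF u hu) (norm_rotBF (fun y => u (blockBase L y)) (fun _ => hu _))
    (hfield_gaugeTransformZd hL hd V hV hu hε₀ hsm h44 hbud)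
    (fun Y _ => Cfield_gaugeTransformZd hL hd V hV hu hε₀ hsm h44 Y) hB₀

/-- **`σ(Φ_{V^u}(R(u)B)) = σ(Φ_V(B))`** for EVERY functional `σ` of the fine field invariant under `R(u)` — the shape of
the «log σ(·)» term of (2.12) — on `ℓ^∞` with every binder but `hσ` discharged (print's Haar density itself needs
`𝐠`-valued bond variables: §6, product carrier). [cite: Balaban1987RG1, (2.12) p.268, (2.16) p.269] -/
theorem sigma_phi_gauge_genuineZd {F : Type*} (σ : BField d 𝔸 → F) (hσ : ∀ Y, σ (rotBFL u hu Y) = σ Y)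
    {ε : ℝ} {DtV DtU : BField d 𝔸 → BField d 𝔸}
    (hq : 9 * (192000 * ((d : ℝ) * L) ^ 2) * (((L : ℝ) ^ d / L) / (1 - (L : ℝ) ^ d / L * (24 * omegaA d L ε₀))) * ε < 1)
    (hRC : 3 * ε ≤ 1 / (4800 * ((d : ℝ) * L)))
    (hDtV : ∀ B : BField d 𝔸, ‖B‖ < ε →
      DtV B ∈ closedBall (0 : BField d 𝔸) (4 * (192000 * ((d : ℝ) * L) ^ 2) * ε ^ 2) ∧
      Cfield hL hd V hV hε₀ hsm h44 (B - hfield hL hd V hV hε₀ hsm h44 hbud (DtV B)) = DtV B)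
    (hDtU : ∀ B : BField d 𝔸, ‖B‖ < ε →
      DtU B ∈ closedBall (0 : BField d 𝔸) (4 * (192000 * ((d : ℝ) * L) ^ 2) * ε ^ 2) ∧
      Cfield hL hd (gaugeTransformZd u V) (mem_U1_gaugeTransformZd hV hu) hε₀ hsm (plaq_gaugeTransformZd_le V hu h44)
          (B - hfield hL hd (gaugeTransformZd u V) (mem_U1_gaugeTransformZd hV hu) hε₀ hsm
            (plaq_gaugeTransformZd_le V hu h44) hbud (DtU B)) = DtU B)
    {B : BField d 𝔸} (hB : ‖B‖ < ε) :
    σ (rotBFL u hu B - hfield hL hd (gaugeTransformZd u V) (mem_U1_gaugeTransformZd hV hu) hε₀ hsm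
        (plaq_gaugeTransformZd_le V hu h44) hbud (DtU (rotBFL u hu B))) =
      σ (B - hfield hL hd V hV hε₀ hsm h44 hbud (DtV B)) := by
  rw [phi_gauge_genuineZd hL hd V hV hu hε₀ hsm h44 hbud hq hRC hDtV hDtU hB, hσ]

/-- **[B12] p. 269 (2.16) FOR THE MEASURE-BORN TERMS ON THE `ℤᵈ` CARRIER, HYPOTHESIS-FREE IN THE LETTERS.**  For [I]'s
genuine average on `ℓ^∞(bonds of ℤᵈ; 𝔸)` at a bondwise-`U1`, `ε₀`-regular background `V` (`(dL)²ε₀ ≤ 1/200`, Neumann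
budget `(Lᵈ/L)·24ω_A(ε₀) < 1`), a bondwise-`U1` gauge function `u`, and a radius `ε` with `9C₂Hε < 1`, `3ε ≤ R`:
THERE ARE the solutions `D̃_V`, `D̃_{V^u}` of the p. 267 equation (`p267_genuine` at `V` and at `V^u`), and on
`‖B‖ < ε`: (i) `D̃_{V^u}(R(u)B) = R(u(L·))D̃_V(B)`; (ii) `Φ_{V^u}(R(u)B) = R(u)Φ_V(B)`; (iii) the Jacobian operators
conjugate, `DΦ_{V^u}(R(u)B) = R(u)∘DΦ_V(B)∘R(u)⁻¹`; (iv) `σ(Φ_{V^u}(R(u)B)) = σ(Φ_V(B))` for every `R(u)`-invariant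
real functional `σ` (any codomain: `sigma_phi_gauge_genuineZd`).  Every letter (`h`, `C̃`, `D̃`, the (2.16) maps and their isometry, the covariances) is a construction or a
theorem of the tree (r09's lineage + `rotBFL`); NOT on this carrier: «Tr log», `det`, the operator logarithm, print's
Haar `σ` (see the section docstring). [cite: Balaban1987RG1, p.267, (2.12) p.268, (2.16) p.269] -/
theorem p269_measure_terms_genuineZd {ε : ℝ}
    (hq : 9 * (192000 * ((d : ℝ) * L) ^ 2) * (((L : ℝ) ^ d / L) / (1 - (L : ℝ) ^ d / L * (24 * omegaA d L ε₀))) * ε < 1)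
    (hRC : 3 * ε ≤ 1 / (4800 * ((d : ℝ) * L))) :
    ∃ DtV DtU : BField d 𝔸 → BField d 𝔸,
      (∀ B : BField d 𝔸, ‖B‖ < ε →
        DtV B ∈ closedBall (0 : BField d 𝔸) (4 * (192000 * ((d : ℝ) * L) ^ 2) * ε ^ 2) ∧
        Cfield hL hd V hV hε₀ hsm h44 (B - hfield hL hd V hV hε₀ hsm h44 hbud (DtV B)) = DtV B) ∧
      (∀ B : BField d 𝔸, ‖B‖ < ε →
        DtU B ∈ closedBall (0 : BField d 𝔸) (4 * (192000 * ((d : ℝ) * L) ^ 2) * ε ^ 2) ∧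
        Cfield hL hd (gaugeTransformZd u V) (mem_U1_gaugeTransformZd hV hu) hε₀ hsm (plaq_gaugeTransformZd_le V hu h44)
            (B - hfield hL hd (gaugeTransformZd u V) (mem_U1_gaugeTransformZd hV hu) hε₀ hsm
              (plaq_gaugeTransformZd_le V hu h44) hbud (DtU B)) = DtU B) ∧
      ∀ B : BField d 𝔸, ‖B‖ < ε →
        DtU (rotBFL u hu B) = rotBFL (fun y => u (blockBase L y)) (fun _ => hu _) (DtV B) ∧
        rotBFL u hu B - hfield hL hd (gaugeTransformZd u V) (mem_U1_gaugeTransformZd hV hu) hε₀ hsm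
            (plaq_gaugeTransformZd_le V hu h44) hbud (DtU (rotBFL u hu B)) =
          rotBFL u hu (B - hfield hL hd V hV hε₀ hsm h44 hbud (DtV B)) ∧
        fderiv ℂ (fun B => B - hfield hL hd (gaugeTransformZd u V) (mem_U1_gaugeTransformZd hV hu) hε₀ hsm
            (plaq_gaugeTransformZd_le V hu h44) hbud (DtU B)) (rotBFL u hu B) =
          (rotBFL u hu : BField d 𝔸 →L[ℂ] BField d 𝔸) ∘L
            fderiv ℂ (fun B => B - hfield hL hd V hV hε₀ hsm h44 hbud (DtV B)) B ∘L
              ((rotBFL u hu).symm : BField d 𝔸 →L[ℂ] BField d 𝔸) ∧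
        ∀ σ : BField d 𝔸 → ℝ, (∀ Y, σ (rotBFL u hu Y) = σ Y) →
          σ (rotBFL u hu B - hfield hL hd (gaugeTransformZd u V) (mem_U1_gaugeTransformZd hV hu) hε₀ hsm
              (plaq_gaugeTransformZd_le V hu h44) hbud (DtU (rotBFL u hu B))) =
            σ (B - hfield hL hd V hV hε₀ hsm h44 hbud (DtV B)) := by
  obtain ⟨DtV, hDtV, -⟩ := p267_genuine hL hd V hV hε₀ hsm h44 hbud ε hq hRC
  obtain ⟨DtU, hDtU, -⟩ := p267_genuine hL hd (gaugeTransformZd u V) (mem_U1_gaugeTransformZd hV hu) hε₀ hsm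
    (plaq_gaugeTransformZd_le V hu h44) hbud ε hq hRC
  have hV' : ∀ B : BField d 𝔸, ‖B‖ < ε →
      DtV B ∈ closedBall (0 : BField d 𝔸) (4 * (192000 * ((d : ℝ) * L) ^ 2) * ε ^ 2) ∧
      Cfield hL hd V hV hε₀ hsm h44 (B - hfield hL hd V hV hε₀ hsm h44 hbud (DtV B)) = DtV B :=
    fun B hB => ⟨(hDtV B hB).1, (hDtV B hB).2.1⟩
  have hU' : ∀ B : BField d 𝔸, ‖B‖ < ε →
      DtU B ∈ closedBall (0 : BField d 𝔸) (4 * (192000 * ((d : ℝ) * L) ^ 2) * ε ^ 2) ∧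
      Cfield hL hd (gaugeTransformZd u V) (mem_U1_gaugeTransformZd hV hu) hε₀ hsm (plaq_gaugeTransformZd_le V hu h44)
          (B - hfield hL hd (gaugeTransformZd u V) (mem_U1_gaugeTransformZd hV hu) hε₀ hsm
            (plaq_gaugeTransformZd_le V hu h44) hbud (DtU B)) = DtU B :=
    fun B hB => ⟨(hDtU B hB).1, (hDtU B hB).2.1⟩
  exact ⟨DtV, DtU, hV', hU', fun B hB =>
    ⟨Dt_gauge_genuineZd hL hd V hV hu hε₀ hsm h44 hbud hq hRC hV' hU' hB,
      phi_gauge_genuineZd hL hd V hV hu hε₀ hsm h44 hbud hq hRC hV' hU' hB,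
      fderiv_phi_gauge_genuineZd hL hd V hV hu hε₀ hsm h44 hbud hq hRC hV' hU' hB,
      fun σ hσ => sigma_phi_gauge_genuineZd hL hd V hV hu hε₀ hsm h44 hbud σ hσ hq hRC hV' hU' hB⟩⟩

include hL hd hbud in
/-- **A RADIUS EXISTS** for the two conditions `9C₂Hε < 1`, `3ε ≤ R` of `p267_genuine` ∕ §7 (b) (print p. 267:
«ε₁ sufficiently small»; the lineage's explicit `C₂ = 192000(dL)²`, `R = 1/(4800dL)`, `H ≥ 0` under the Neumann
budget): any `0 < ε ≤ min(R/3, 1/(9C₂H + 1))`. [cite: Balaban1987RG1, p.267] -/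
theorem exists_radius :
    ∃ ε : ℝ, 0 < ε ∧
      9 * (192000 * ((d : ℝ) * L) ^ 2) * (((L : ℝ) ^ d / L) / (1 - (L : ℝ) ^ d / L * (24 * omegaA d L ε₀))) * ε < 1 ∧
      3 * ε ≤ 1 / (4800 * ((d : ℝ) * L)) := by
  have hdL : 0 < (d : ℝ) * L := by
    have : (1 : ℝ) ≤ d := by exact_mod_cast hd
    have : (0 : ℝ) < L := by exact_mod_cast hL
    positivity
  set C₂ : ℝ := 192000 * ((d : ℝ) * L) ^ 2 with hC₂
  set H : ℝ := ((L : ℝ) ^ d / L) / (1 - (L : ℝ) ^ d / L * (24 * omegaA d L ε₀)) with hH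
  have hC₂0 : 0 ≤ C₂ := by rw [hC₂]; positivity
  have hH0 : 0 ≤ H := B12B0RestrictionAverage267.H_nonneg L d hbud
  have hK0 : 0 < 9 * C₂ * H + 1 := by positivity
  refine ⟨min (1 / (4800 * ((d : ℝ) * L)) / 3) (1 / (9 * C₂ * H + 1)), lt_min (by positivity) (by positivity),
    ?_, ?_⟩
  · have h1 : min (1 / (4800 * ((d : ℝ) * L)) / 3) (1 / (9 * C₂ * H + 1)) ≤ 1 / (9 * C₂ * H + 1) :=
      min_le_right _ _
    have h2 : 9 * C₂ * H * min (1 / (4800 * ((d : ℝ) * L)) / 3) (1 / (9 * C₂ * H + 1)) ≤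
        9 * C₂ * H * (1 / (9 * C₂ * H + 1)) := mul_le_mul_of_nonneg_left h1 (by positivity)
    have h3 : 9 * C₂ * H * (1 / (9 * C₂ * H + 1)) < 1 := by
      rw [mul_one_div, div_lt_one hK0]; linarith
    exact h2.trans_lt h3
  · have := min_le_left (1 / (4800 * ((d : ℝ) * L)) / 3) (1 / (9 * C₂ * H + 1)); linarith

end genuineZd

section genuineZdFlat

open B12LinearizationGenuineZd (BField hfield Cfield)
open B12Def267Covariance (mem_U1_gaugeTransformZd plaq_gaugeTransformZd_le)
open B7Prop1Explicit (U1)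
open B12ContourAverage253 (omegaA)
open Literature.MathematicalPhysics.QuantumLattice (blockBase plaquetteHolonomyZd gaugeTransformZd)

variable {d : ℕ} {𝔸 : Type*} [NormedRing 𝔸] [NormedAlgebra ℂ 𝔸] [NormOneClass 𝔸] [CompleteSpace 𝔸] {L : ℕ}

/-- **NON-VACUITY OF §7 (b) WITH EVERYTHING DISCHARGED**: at the FLAT background `V ≡ 1` with the trivial gauge
`u ≡ 1` and `ε₀ = 0` (hypotheses inhabited by `B12LinearizationGenuineZd.flat_hypotheses` and `(U1 𝔸).one_mem`),
for every `L, d ≥ 1` there is a radius `ε > 0` (`exists_radius`) and solutions `D̃_1`, `D̃_{1^1}` with the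
equivariances (i), (ii) of `p269_measure_terms_genuineZd` on `‖B‖ < ε`. [cite: Balaban1987RG1, p.267, (2.16) p.269] -/
example (hL : 0 < L) (hd : 1 ≤ d) (hV : ∀ b, (1 : ZdEdge d → 𝔸ˣ) b ∈ U1 𝔸)
    (hu : ∀ z, (1 : (Fin d → ℤ) → 𝔸ˣ) z ∈ U1 𝔸) (hε₀ : (0 : ℝ) ≤ 0) (hsm : ((d : ℝ) * L) ^ 2 * 0 ≤ 1 / 200)
    (h44 : ∀ (p : Fin d → ℤ) (i j : Fin d), i ≠ j →
      ‖((plaquetteHolonomyZd (1 : ZdEdge d → 𝔸ˣ) p i j : 𝔸ˣ) : 𝔸) - 1‖ ≤ (0 : ℝ))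
    (hbud : (L : ℝ) ^ d / L * (24 * omegaA d L 0) < 1) :
    ∃ ε : ℝ, 0 < ε ∧ ∃ DtV DtU : BField d 𝔸 → BField d 𝔸, ∀ B : BField d 𝔸, ‖B‖ < ε →
      DtU (rotBFL 1 hu B) = rotBFL (fun y => (1 : (Fin d → ℤ) → 𝔸ˣ) (blockBase L y)) (fun _ => hu _) (DtV B) ∧
      rotBFL 1 hu B - hfield hL hd (gaugeTransformZd 1 1) (mem_U1_gaugeTransformZd hV hu) hε₀ hsm
          (plaq_gaugeTransformZd_le 1 hu h44) hbud (DtU (rotBFL 1 hu B)) =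
        rotBFL 1 hu (B - hfield hL hd 1 hV hε₀ hsm h44 hbud (DtV B)) := by
  obtain ⟨ε, hε, hq, hRC⟩ := exists_radius (ε₀ := 0) hL hd hbud
  obtain ⟨DtV, DtU, -, -, h⟩ := p269_measure_terms_genuineZd hL hd 1 hV hu hε₀ hsm h44 hbud hq hRC
  exact ⟨ε, hε, DtV, DtU, fun B hB => ⟨(h B hB).1, (h B hB).2.1⟩⟩

end genuineZdFlat


/-! ## §8  (v1.3) TWO-CARRIER FORM: the primed system on DIFFERENT Banach spaces `𝒳′`, `𝒴′`, linked to the unprimed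
one by continuous linear isometric equivalences `U : 𝒴 ≃ 𝒴′`, `V : 𝒳 ≃ 𝒳′`

WHY.  Print's carriers are INDEXED BY THE BACKGROUND: in [15] (= [Balaban1985Variational], the paper (2.16)'s sentence
points to — p. 267 «This operation was discussed several times in the previous papers, e.g. see Sect. C [15], Sect. E [14].»;
[14] = [Balaban1985RegularSpaces], CMP 99, whose Sect. E kernel is the tree's `B8SectE` — D-g95-1) the
configuration norm (115) is `max{|A|_{(−1)}, |∇^{U}A|_{(−2)}}` with the covariant derivative `∇^{U}` of the
background, so `R(u)` maps the space AT `U` onto the space AT `U^u` — two different normed spaces (the tree's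
`B11Eq115GaugeIsometry.gauge115Isometry : Space115 … (∇^{U}) ≃ₗᵢ[ℂ] Space115 … (∇^{U^u})`, pub-balaban NE9 lane).  §§2–7
typed both systems on ONE pair `(𝒳, 𝒴)` with `U : 𝒴 ≃L[ℂ] 𝒴`; this section re-states the mechanism for `hop : 𝒳 → 𝒴`,
`hop′ : 𝒳′ → 𝒴′`, `C̃ : 𝒴 → 𝒳`, `C̃′ : 𝒴′ → 𝒳′`, `U : 𝒴 ≃L[ℂ] 𝒴′`, `V : 𝒳 ≃L[ℂ] 𝒳′` (same constants), so that
background-indexed carriers can host it; §§2–5 are the case `𝒳′ = 𝒳`, `𝒴′ = 𝒴`.  Proofs are those of §2 ∕ §3 ∕ §7 (a)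
verbatim; ACROSS two spaces the conjugation invariance of the determinant and of the trace are Mathlib's
`LinearMap.det_conj` ∕ `LinearMap.trace_conj'` (any `e : 𝒴 ≃ₗ 𝒴′`), and the operator logarithm is transported by the
continuous algebra isomorphism `T ↦ U∘T∘U⁻¹ : (𝒴 →L 𝒴) → (𝒴′ →L 𝒴′)` (`ContinuousLinearEquiv.arrowCongrSL U U`) term
by term in the series `MatrixLog.hasSum_mlog`.  RESULTS: `Dt_embed` ∕ `phi_embed` (ISOMETRIC EMBEDDINGS suffice for the equivariance of `D̃`, `Φ` — no inverse is
used; this also reads as the RESTRICTION of the scheme to a closed invariant sub-carrier, e.g. periodic fields = the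
torus), `Dt_gauge₂`, `phi_gauge₂`, `fderiv_Dt_gauge₂`, `jacobianOp_gauge₂`,
`fderiv_phi_gauge₂`, `det_fderiv_phi_gauge₂` (no analyticity binder, as in §7 (a)), `mlog_one_sub_conj₂`,
`logJacobian_gauge₂`, `trace_logJacobian_gauge₂`, `sigma_phi_gauge₂` (two functionals `σ`, `σ′` with `σ′∘U = σ`).  Nothing
of [15]'s letters is instantiated here (no (2.16)-covariance theorem for the Sect. C letters `B11Eq45HOperator.HopAd` ∕
`B11Eq44COperatorTorus.Cc` on the torus carrier is in the tree — the NE9 lane carries its chart along the gauge orbit by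
re-instantiating `C` at `U^g` with `U`-free constants, `Summits/…/Support/NE9CurChartGaugeOrbit`, and conjugates `H₁`, `𝔊` in
`B11Eq117GaugeNormInvariance`); this is the abstract host only. [cite: Balaban1987RG1, p.267, (2.12) p.268, (2.16) p.269]
[cite: Balaban1985Variational, (115) p.294, (47)–(50) p.285] -/

section twoCarrierAlgebra

variable {𝒴 𝒴' : Type*} [NormedAddCommGroup 𝒴] [NormedSpace ℂ 𝒴] [NormedAddCommGroup 𝒴'] [NormedSpace ℂ 𝒴']

/-- `U (S T) U⁻¹ = (U S U⁻¹)(U T U⁻¹)` across two spaces. [folklore] -/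
private theorem conj₂_mul (U : 𝒴 ≃L[ℂ] 𝒴') (S T : 𝒴 →L[ℂ] 𝒴) :
    (U : 𝒴 →L[ℂ] 𝒴') ∘L (S * T) ∘L (U.symm : 𝒴' →L[ℂ] 𝒴) =
      ((U : 𝒴 →L[ℂ] 𝒴') ∘L S ∘L (U.symm : 𝒴' →L[ℂ] 𝒴)) * ((U : 𝒴 →L[ℂ] 𝒴') ∘L T ∘L (U.symm : 𝒴' →L[ℂ] 𝒴)) := by
  ext v; simp

/-- `U Tⁿ U⁻¹ = (U T U⁻¹)ⁿ` across two spaces. [folklore] -/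
private theorem conj₂_pow (U : 𝒴 ≃L[ℂ] 𝒴') (T : 𝒴 →L[ℂ] 𝒴) (n : ℕ) :
    (U : 𝒴 →L[ℂ] 𝒴') ∘L (T ^ n) ∘L (U.symm : 𝒴' →L[ℂ] 𝒴) =
      ((U : 𝒴 →L[ℂ] 𝒴') ∘L T ∘L (U.symm : 𝒴' →L[ℂ] 𝒴)) ^ n := by
  induction n with
  | zero => ext v; simp
  | succ n ih => rw [pow_succ, conj₂_mul, ih, pow_succ]

/-- `U (1 − J) U⁻¹ = 1 − U J U⁻¹` across two spaces. [folklore] -/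
private theorem conj₂_one_sub (U : 𝒴 ≃L[ℂ] 𝒴') (J : 𝒴 →L[ℂ] 𝒴) :
    (U : 𝒴 →L[ℂ] 𝒴') ∘L (1 - J) ∘L (U.symm : 𝒴' →L[ℂ] 𝒴) =
      1 - (U : 𝒴 →L[ℂ] 𝒴') ∘L J ∘L (U.symm : 𝒴' →L[ℂ] 𝒴) := by
  ext v; simp

/-- **The trace is invariant under conjugation ACROSS two spaces**: `Tr_{𝒴′}(U T U⁻¹) = Tr_{𝒴}(T)` for `U : 𝒴 ≃L[ℂ] 𝒴′`
(Mathlib `LinearMap.trace_conj'`). [cite: Balaban1987RG1, (2.12) p.268, (2.16) p.269] -/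
theorem trace_conj_eq₂ (U : 𝒴 ≃L[ℂ] 𝒴') (T : 𝒴 →L[ℂ] 𝒴) :
    LinearMap.trace ℂ 𝒴' (((U : 𝒴 →L[ℂ] 𝒴') ∘L T ∘L (U.symm : 𝒴' →L[ℂ] 𝒴) : 𝒴' →L[ℂ] 𝒴') : 𝒴' →ₗ[ℂ] 𝒴') =
      LinearMap.trace ℂ 𝒴 (T : 𝒴 →ₗ[ℂ] 𝒴) := by
  rw [ContinuousLinearMap.toLinearMap_comp, ContinuousLinearMap.toLinearMap_comp]
  exact LinearMap.trace_conj' (T : 𝒴 →ₗ[ℂ] 𝒴) U.toLinearEquiv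

/-- **The determinant is invariant under conjugation ACROSS two spaces**: `det_{𝒴′}(U T U⁻¹) = det_{𝒴}(T)`
(Mathlib `LinearMap.det_conj`). [cite: Balaban1987RG1, (2.12) p.268, (2.16) p.269] -/
theorem det_conj_eq₂ (U : 𝒴 ≃L[ℂ] 𝒴') (T : 𝒴 →L[ℂ] 𝒴) :
    LinearMap.det (((U : 𝒴 →L[ℂ] 𝒴') ∘L T ∘L (U.symm : 𝒴' →L[ℂ] 𝒴) : 𝒴' →L[ℂ] 𝒴') : 𝒴' →ₗ[ℂ] 𝒴') =
      LinearMap.det (T : 𝒴 →ₗ[ℂ] 𝒴) := by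
  rw [ContinuousLinearMap.toLinearMap_comp, ContinuousLinearMap.toLinearMap_comp]
  exact LinearMap.det_conj (T : 𝒴 →ₗ[ℂ] 𝒴) U.toLinearEquiv

variable [CompleteSpace 𝒴] [CompleteSpace 𝒴']

/-- **`log (U(1 − J)U⁻¹) = U log(1 − J) U⁻¹` ACROSS two spaces** (`‖J‖ < 1`, `‖UJU⁻¹‖ < 1`): the logarithmic series
([Balaban1985Averaging] (21), `MatrixLog.hasSum_mlog`) is transported term by term by the continuous algebra isomorphism
`T ↦ UTU⁻¹` (`ContinuousLinearEquiv.arrowCongrSL U U`). [cite: Balaban1987RG1, (2.12) p.268, (2.16) p.269] -/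
theorem mlog_one_sub_conj₂ (U : 𝒴 ≃L[ℂ] 𝒴') {J : 𝒴 →L[ℂ] 𝒴} (hJ : ‖J‖ < 1)
    (hUJ : ‖(U : 𝒴 →L[ℂ] 𝒴') ∘L J ∘L (U.symm : 𝒴' →L[ℂ] 𝒴)‖ < 1) :
    mlog (1 - (U : 𝒴 →L[ℂ] 𝒴') ∘L J ∘L (U.symm : 𝒴' →L[ℂ] 𝒴)) =
      (U : 𝒴 →L[ℂ] 𝒴') ∘L mlog (1 - J) ∘L (U.symm : 𝒴' →L[ℂ] 𝒴) := by
  have hX : ‖(1 - J : 𝒴 →L[ℂ] 𝒴) - 1‖ < 1 := by rwa [sub_sub_cancel_left, norm_neg]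
  have hX' : ‖(1 - (U : 𝒴 →L[ℂ] 𝒴') ∘L J ∘L (U.symm : 𝒴' →L[ℂ] 𝒴) : 𝒴' →L[ℂ] 𝒴') - 1‖ < 1 := by
    rwa [sub_sub_cancel_left, norm_neg]
  let φ : (𝒴 →L[ℂ] 𝒴) →L[ℂ] (𝒴' →L[ℂ] 𝒴') :=
    ((U.arrowCongrSL U : (𝒴 →L[ℂ] 𝒴) ≃L[ℂ] (𝒴' →L[ℂ] 𝒴')) : (𝒴 →L[ℂ] 𝒴) →L[ℂ] (𝒴' →L[ℂ] 𝒴'))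
  have hφ : ∀ T : 𝒴 →L[ℂ] 𝒴, φ T = (U : 𝒴 →L[ℂ] 𝒴') ∘L T ∘L (U.symm : 𝒴' →L[ℂ] 𝒴) := fun T => rfl
  have h1 : HasSum (fun n : ℕ => φ (logSeriesCoeff n • ((1 - J : 𝒴 →L[ℂ] 𝒴) - 1) ^ n)) (φ (mlog (1 - J))) :=
    (hasSum_mlog hX).map φ φ.continuous
  have heq : (fun n : ℕ => φ (logSeriesCoeff n • ((1 - J : 𝒴 →L[ℂ] 𝒴) - 1) ^ n)) =
      fun n : ℕ => logSeriesCoeff n •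
        ((1 - (U : 𝒴 →L[ℂ] 𝒴') ∘L J ∘L (U.symm : 𝒴' →L[ℂ] 𝒴) : 𝒴' →L[ℂ] 𝒴') - 1) ^ n := by
    funext n
    rw [map_smul, hφ, conj₂_pow, ← conj₂_one_sub]
    congr 2
    ext v; simp
  rw [heq, hφ] at h1
  exact (hasSum_mlog hX').unique h1

end twoCarrierAlgebra

section embedding

variable {𝒳 𝒳' 𝒴 𝒴' : Type*} [NormedAddCommGroup 𝒳] [NormedSpace ℂ 𝒳] [CompleteSpace 𝒳]
  [NormedAddCommGroup 𝒳'] [NormedSpace ℂ 𝒳'] [CompleteSpace 𝒳']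
  [NormedAddCommGroup 𝒴] [NormedSpace ℂ 𝒴] [NormedAddCommGroup 𝒴'] [NormedSpace ℂ 𝒴']
  {hop : 𝒳 →ₗ[ℂ] 𝒴} {hop' : 𝒳' →ₗ[ℂ] 𝒴'} {Ct : 𝒴 → 𝒳} {Ct' : 𝒴' → 𝒳'} {C₂ R b ε : ℝ}
  {Dt : 𝒴 → 𝒳} {Dt' : 𝒴' → 𝒳'} {ιX : 𝒳 →L[ℂ] 𝒳'} {ιY : 𝒴 →L[ℂ] 𝒴'}

/-- **ISOMETRIC EMBEDDINGS SUFFICE for the equivariance of `D̃`**: `D̃′(ιB) = ι(D̃(B))` on `‖B‖ < ε` for isometric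
continuous linear maps `ιY : 𝒴 → 𝒴′`, `ιX : 𝒳 → 𝒳′` (NOT necessarily onto) intertwining the letters, `h′∘ιX = ιY∘h`,
`C̃′∘ιY = ιX∘C̃` on `‖Y‖ < R` — the proof of `Dt_gauge₂` uses no inverse.  Besides the (2.16) maps this covers the
RESTRICTION of the scheme to a closed invariant sub-carrier (the unprimed system = the sub-carrier's, `ι` = the
inclusion): the ambient `D̃` restricted to the sub-carrier IS the sub-carrier's `D̃` («exactly one solution») — e.g.
periodic fields inside `ℓ^∞(ℤᵈ)`, i.e. fields on print's tori `T_ε` of (0.1) p. 251 («this torus determines a sequence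
of tori»). [cite: Balaban1987RG1, p.267, (2.16) p.269, (0.1) p.251] -/
theorem Dt_embed (hC : QuadAnalytic Ct C₂ R) (hC' : QuadAnalytic Ct' C₂ R) (hC₂ : 0 ≤ C₂) (hb : 0 ≤ b)
    (hHop : ∀ X, ‖hop X‖ ≤ b * ‖X‖) (hHop' : ∀ X, ‖hop' X‖ ≤ b * ‖X‖) (hq : 9 * C₂ * b * ε < 1)
    (hRC : 3 * ε ≤ R)
    (hDball : ∀ B : 𝒴, ‖B‖ < ε → Dt B ∈ closedBall (0:𝒳) (4 * C₂ * ε ^ 2))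
    (hDfix : ∀ B : 𝒴, ‖B‖ < ε → Ct (B - hop (Dt B)) = Dt B)
    (hDball' : ∀ B : 𝒴', ‖B‖ < ε → Dt' B ∈ closedBall (0:𝒳') (4 * C₂ * ε ^ 2))
    (hDfix' : ∀ B : 𝒴', ‖B‖ < ε → Ct' (B - hop' (Dt' B)) = Dt' B)
    (hιY : ∀ Y, ‖ιY Y‖ = ‖Y‖) (hιX : ∀ X, ‖ιX X‖ = ‖X‖)
    (hhop : ∀ X, hop' (ιX X) = ιY (hop X)) (hCt : ∀ Y : 𝒴, ‖Y‖ < R → Ct' (ιY Y) = ιX (Ct Y))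
    {B : 𝒴} (hB : ‖B‖ < ε) : Dt' (ιY B) = ιX (Dt B) := by
  have hUB : ‖ιY B‖ < ε := by rwa [hιY]
  have hXball : ιX (Dt B) ∈ closedBall (0:𝒳') (4 * C₂ * ε ^ 2) := by
    have h := hDball _ hB
    rw [mem_closedBall_zero_iff] at h ⊢
    rwa [hιX]
  have hXfix : Ct' (ιY B - hop' (ιX (Dt B))) = ιX (Dt B) := by
    have h1 : ιY B - hop' (ιX (Dt B)) = ιY (B - hop (Dt B)) := by
      rw [map_sub, hhop]
    rw [h1, hCt _ (norm_phi_lt hC hC₂ hb hHop hq hRC hDball hDfix hB), hDfix _ hB]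
  exact (eq_Dt_of_fixedPt hC' hC₂ hb hHop' hq hRC hDball' hDfix' hUB hXball hXfix).symm

/-- **`Φ′(ιB) = ι(Φ(B))`** for isometric embeddings (same reading: gauge maps, or the inclusion of an invariant
sub-carrier — the linearizing substitution RESTRICTS). [cite: Balaban1987RG1, p.267, (2.16) p.269] -/
theorem phi_embed (hC : QuadAnalytic Ct C₂ R) (hC' : QuadAnalytic Ct' C₂ R) (hC₂ : 0 ≤ C₂) (hb : 0 ≤ b)
    (hHop : ∀ X, ‖hop X‖ ≤ b * ‖X‖) (hHop' : ∀ X, ‖hop' X‖ ≤ b * ‖X‖) (hq : 9 * C₂ * b * ε < 1)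
    (hRC : 3 * ε ≤ R)
    (hDball : ∀ B : 𝒴, ‖B‖ < ε → Dt B ∈ closedBall (0:𝒳) (4 * C₂ * ε ^ 2))
    (hDfix : ∀ B : 𝒴, ‖B‖ < ε → Ct (B - hop (Dt B)) = Dt B)
    (hDball' : ∀ B : 𝒴', ‖B‖ < ε → Dt' B ∈ closedBall (0:𝒳') (4 * C₂ * ε ^ 2))
    (hDfix' : ∀ B : 𝒴', ‖B‖ < ε → Ct' (B - hop' (Dt' B)) = Dt' B)
    (hιY : ∀ Y, ‖ιY Y‖ = ‖Y‖) (hιX : ∀ X, ‖ιX X‖ = ‖X‖)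
    (hhop : ∀ X, hop' (ιX X) = ιY (hop X)) (hCt : ∀ Y : 𝒴, ‖Y‖ < R → Ct' (ιY Y) = ιX (Ct Y))
    {B : 𝒴} (hB : ‖B‖ < ε) : ιY B - hop' (Dt' (ιY B)) = ιY (B - hop (Dt B)) := by
  rw [Dt_embed hC hC' hC₂ hb hHop hHop' hq hRC hDball hDfix hDball' hDfix' hιY hιX hhop hCt hB, hhop, map_sub]

end embedding

section twoCarrier

variable {𝒳 𝒳' 𝒴 𝒴' : Type*} [NormedAddCommGroup 𝒳] [NormedSpace ℂ 𝒳] [CompleteSpace 𝒳]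
  [NormedAddCommGroup 𝒳'] [NormedSpace ℂ 𝒳'] [CompleteSpace 𝒳']
  [NormedAddCommGroup 𝒴] [NormedSpace ℂ 𝒴] [NormedAddCommGroup 𝒴'] [NormedSpace ℂ 𝒴']
  {hop : 𝒳 →ₗ[ℂ] 𝒴} {hop' : 𝒳' →ₗ[ℂ] 𝒴'} {Ct : 𝒴 → 𝒳} {Ct' : 𝒴' → 𝒳'} {C₂ R b ε : ℝ}
  {Dt : 𝒴 → 𝒳} {Dt' : 𝒴' → 𝒳'} {V : 𝒳 ≃L[ℂ] 𝒳'} {U : 𝒴 ≃L[ℂ] 𝒴'}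

/-- **`D̃′(UB) = VD̃(B)` on `‖B‖ < ε`, TWO-CARRIER FORM** (primed system on `𝒳′`, `𝒴′`; `U : 𝒴 ≃L 𝒴′`, `V : 𝒳 ≃L 𝒳′`
isometric; `h′(VX) = U(hX)`, `C̃′(UY) = V(C̃Y)` on `‖Y‖ < R`): the transported `VD̃(B)` solves the primed equation in the
primed ball, hence equals `D̃′(UB)` by uniqueness («exactly one solution», `B12Lineariz267.eq_Dt_of_fixedPt` on `𝒳′`).
[cite: Balaban1987RG1, p.267, (2.16) p.269] -/
theorem Dt_gauge₂ (hC : QuadAnalytic Ct C₂ R) (hC' : QuadAnalytic Ct' C₂ R) (hC₂ : 0 ≤ C₂) (hb : 0 ≤ b)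
    (hHop : ∀ X, ‖hop X‖ ≤ b * ‖X‖) (hHop' : ∀ X, ‖hop' X‖ ≤ b * ‖X‖) (hq : 9 * C₂ * b * ε < 1)
    (hRC : 3 * ε ≤ R)
    (hDball : ∀ B : 𝒴, ‖B‖ < ε → Dt B ∈ closedBall (0:𝒳) (4 * C₂ * ε ^ 2))
    (hDfix : ∀ B : 𝒴, ‖B‖ < ε → Ct (B - hop (Dt B)) = Dt B)
    (hDball' : ∀ B : 𝒴', ‖B‖ < ε → Dt' B ∈ closedBall (0:𝒳') (4 * C₂ * ε ^ 2))
    (hDfix' : ∀ B : 𝒴', ‖B‖ < ε → Ct' (B - hop' (Dt' B)) = Dt' B)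
    (hU : ∀ Y, ‖U Y‖ = ‖Y‖) (hV : ∀ X, ‖V X‖ = ‖X‖)
    (hhop : ∀ X, hop' (V X) = U (hop X)) (hCt : ∀ Y : 𝒴, ‖Y‖ < R → Ct' (U Y) = V (Ct Y))
    {B : 𝒴} (hB : ‖B‖ < ε) : Dt' (U B) = V (Dt B) := by
  have hUB : ‖U B‖ < ε := by rwa [hU]
  have hXball : V (Dt B) ∈ closedBall (0:𝒳') (4 * C₂ * ε ^ 2) := by
    have h := hDball _ hB
    rw [mem_closedBall_zero_iff] at h ⊢
    rwa [hV]
  have hXfix : Ct' (U B - hop' (V (Dt B))) = V (Dt B) := by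
    have h1 : U B - hop' (V (Dt B)) = U (B - hop (Dt B)) := by
      rw [map_sub, hhop]
    rw [h1, hCt _ (norm_phi_lt hC hC₂ hb hHop hq hRC hDball hDfix hB), hDfix _ hB]
  exact (eq_Dt_of_fixedPt hC' hC₂ hb hHop' hq hRC hDball' hDfix' hUB hXball hXfix).symm

/-- **`Φ′(UB) = UΦ(B)`, two-carrier form.** [cite: Balaban1987RG1, p.267, (2.16) p.269] -/
theorem phi_gauge₂ (hC : QuadAnalytic Ct C₂ R) (hC' : QuadAnalytic Ct' C₂ R) (hC₂ : 0 ≤ C₂) (hb : 0 ≤ b)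
    (hHop : ∀ X, ‖hop X‖ ≤ b * ‖X‖) (hHop' : ∀ X, ‖hop' X‖ ≤ b * ‖X‖) (hq : 9 * C₂ * b * ε < 1)
    (hRC : 3 * ε ≤ R)
    (hDball : ∀ B : 𝒴, ‖B‖ < ε → Dt B ∈ closedBall (0:𝒳) (4 * C₂ * ε ^ 2))
    (hDfix : ∀ B : 𝒴, ‖B‖ < ε → Ct (B - hop (Dt B)) = Dt B)
    (hDball' : ∀ B : 𝒴', ‖B‖ < ε → Dt' B ∈ closedBall (0:𝒳') (4 * C₂ * ε ^ 2))
    (hDfix' : ∀ B : 𝒴', ‖B‖ < ε → Ct' (B - hop' (Dt' B)) = Dt' B)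
    (hU : ∀ Y, ‖U Y‖ = ‖Y‖) (hV : ∀ X, ‖V X‖ = ‖X‖)
    (hhop : ∀ X, hop' (V X) = U (hop X)) (hCt : ∀ Y : 𝒴, ‖Y‖ < R → Ct' (U Y) = V (Ct Y))
    {B : 𝒴} (hB : ‖B‖ < ε) : U B - hop' (Dt' (U B)) = U (B - hop (Dt B)) := by
  rw [Dt_gauge₂ hC hC' hC₂ hb hHop hHop' hq hRC hDball hDfix hDball' hDfix' hU hV hhop hCt hB, hhop, map_sub]

/-- LOCAL FORM: near `UB₀`, `D̃′ = V ∘ D̃ ∘ U⁻¹` eventually (two-carrier). [cite: Balaban1987RG1, p.267, (2.16) p.269] -/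
theorem Dt_gauge_eventuallyEq₂ (hC : QuadAnalytic Ct C₂ R) (hC' : QuadAnalytic Ct' C₂ R) (hC₂ : 0 ≤ C₂) (hb : 0 ≤ b)
    (hHop : ∀ X, ‖hop X‖ ≤ b * ‖X‖) (hHop' : ∀ X, ‖hop' X‖ ≤ b * ‖X‖) (hq : 9 * C₂ * b * ε < 1)
    (hRC : 3 * ε ≤ R)
    (hDball : ∀ B : 𝒴, ‖B‖ < ε → Dt B ∈ closedBall (0:𝒳) (4 * C₂ * ε ^ 2))
    (hDfix : ∀ B : 𝒴, ‖B‖ < ε → Ct (B - hop (Dt B)) = Dt B)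
    (hDball' : ∀ B : 𝒴', ‖B‖ < ε → Dt' B ∈ closedBall (0:𝒳') (4 * C₂ * ε ^ 2))
    (hDfix' : ∀ B : 𝒴', ‖B‖ < ε → Ct' (B - hop' (Dt' B)) = Dt' B)
    (hU : ∀ Y, ‖U Y‖ = ‖Y‖) (hV : ∀ X, ‖V X‖ = ‖X‖)
    (hhop : ∀ X, hop' (V X) = U (hop X)) (hCt : ∀ Y : 𝒴, ‖Y‖ < R → Ct' (U Y) = V (Ct Y))
    {B₀ : 𝒴} (hB₀ : ‖B₀‖ < ε) :
    Dt' =ᶠ[𝓝 (U B₀)] (⇑V ∘ Dt ∘ ⇑U.symm) := by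
  have hUB₀ : ‖U B₀‖ < ε := by rwa [hU]
  filter_upwards [(isOpen_lt continuous_norm continuous_const).mem_nhds hUB₀] with B' hB'
  have hA : ‖U.symm B'‖ < ε := by
    have h := hU (U.symm B'); rw [U.apply_symm_apply] at h; rwa [← h]
  have h := Dt_gauge₂ hC hC' hC₂ hb hHop hHop' hq hRC hDball hDfix hDball' hDfix' hU hV hhop hCt hA
  rw [U.apply_symm_apply] at h
  simpa using h

/-- **`DD̃′(UB₀) = V ∘ DD̃(B₀) ∘ U⁻¹`, two-carrier form** (no analyticity binder: `ContinuousLinearEquiv.comp_fderiv` ∕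
`comp_right_fderiv`). [cite: Balaban1987RG1, p.267, (2.16) p.269] -/
theorem fderiv_Dt_gauge₂ (hC : QuadAnalytic Ct C₂ R) (hC' : QuadAnalytic Ct' C₂ R) (hC₂ : 0 ≤ C₂) (hb : 0 ≤ b)
    (hHop : ∀ X, ‖hop X‖ ≤ b * ‖X‖) (hHop' : ∀ X, ‖hop' X‖ ≤ b * ‖X‖) (hq : 9 * C₂ * b * ε < 1)
    (hRC : 3 * ε ≤ R)
    (hDball : ∀ B : 𝒴, ‖B‖ < ε → Dt B ∈ closedBall (0:𝒳) (4 * C₂ * ε ^ 2))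
    (hDfix : ∀ B : 𝒴, ‖B‖ < ε → Ct (B - hop (Dt B)) = Dt B)
    (hDball' : ∀ B : 𝒴', ‖B‖ < ε → Dt' B ∈ closedBall (0:𝒳') (4 * C₂ * ε ^ 2))
    (hDfix' : ∀ B : 𝒴', ‖B‖ < ε → Ct' (B - hop' (Dt' B)) = Dt' B)
    (hU : ∀ Y, ‖U Y‖ = ‖Y‖) (hV : ∀ X, ‖V X‖ = ‖X‖)
    (hhop : ∀ X, hop' (V X) = U (hop X)) (hCt : ∀ Y : 𝒴, ‖Y‖ < R → Ct' (U Y) = V (Ct Y))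
    {B₀ : 𝒴} (hB₀ : ‖B₀‖ < ε) :
    fderiv ℂ Dt' (U B₀) = (V : 𝒳 →L[ℂ] 𝒳') ∘L fderiv ℂ Dt B₀ ∘L (U.symm : 𝒴' →L[ℂ] 𝒴) := by
  rw [(Dt_gauge_eventuallyEq₂ hC hC' hC₂ hb hHop hHop' hq hRC hDball hDfix hDball' hDfix' hU hV hhop hCt
      hB₀).fderiv_eq, V.comp_fderiv, U.symm.comp_right_fderiv, U.symm_apply_apply]

/-- **`J′(UB₀) = U ∘ J(B₀) ∘ U⁻¹`** for `J = h∘DD̃`, two-carrier form. [cite: Balaban1987RG1, (2.12) p.268, (2.16) p.269] -/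
theorem jacobianOp_gauge₂ (hC : QuadAnalytic Ct C₂ R) (hC' : QuadAnalytic Ct' C₂ R) (hC₂ : 0 ≤ C₂) (hb : 0 ≤ b)
    (hHop : ∀ X, ‖hop X‖ ≤ b * ‖X‖) (hHop' : ∀ X, ‖hop' X‖ ≤ b * ‖X‖) (hq : 9 * C₂ * b * ε < 1)
    (hRC : 3 * ε ≤ R)
    (hDball : ∀ B : 𝒴, ‖B‖ < ε → Dt B ∈ closedBall (0:𝒳) (4 * C₂ * ε ^ 2))
    (hDfix : ∀ B : 𝒴, ‖B‖ < ε → Ct (B - hop (Dt B)) = Dt B)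
    (hDball' : ∀ B : 𝒴', ‖B‖ < ε → Dt' B ∈ closedBall (0:𝒳') (4 * C₂ * ε ^ 2))
    (hDfix' : ∀ B : 𝒴', ‖B‖ < ε → Ct' (B - hop' (Dt' B)) = Dt' B)
    (hU : ∀ Y, ‖U Y‖ = ‖Y‖) (hV : ∀ X, ‖V X‖ = ‖X‖)
    (hhop : ∀ X, hop' (V X) = U (hop X)) (hCt : ∀ Y : 𝒴, ‖Y‖ < R → Ct' (U Y) = V (Ct Y))
    {B₀ : 𝒴} (hB₀ : ‖B₀‖ < ε) :
    hop'.mkContinuous b hHop' ∘L fderiv ℂ Dt' (U B₀) =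
      (U : 𝒴 →L[ℂ] 𝒴') ∘L (hop.mkContinuous b hHop ∘L fderiv ℂ Dt B₀) ∘L (U.symm : 𝒴' →L[ℂ] 𝒴) := by
  rw [fderiv_Dt_gauge₂ hC hC' hC₂ hb hHop hHop' hq hRC hDball hDfix hDball' hDfix' hU hV hhop hCt hB₀]
  ext v
  simp [hhop]

/-- LOCAL FORM: near `UB₀`, `Φ′ = U ∘ Φ ∘ U⁻¹` eventually (two-carrier). [cite: Balaban1987RG1, p.267, (2.16) p.269] -/
theorem phi_gauge_eventuallyEq₂ (hC : QuadAnalytic Ct C₂ R) (hC' : QuadAnalytic Ct' C₂ R) (hC₂ : 0 ≤ C₂) (hb : 0 ≤ b)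
    (hHop : ∀ X, ‖hop X‖ ≤ b * ‖X‖) (hHop' : ∀ X, ‖hop' X‖ ≤ b * ‖X‖) (hq : 9 * C₂ * b * ε < 1)
    (hRC : 3 * ε ≤ R)
    (hDball : ∀ B : 𝒴, ‖B‖ < ε → Dt B ∈ closedBall (0:𝒳) (4 * C₂ * ε ^ 2))
    (hDfix : ∀ B : 𝒴, ‖B‖ < ε → Ct (B - hop (Dt B)) = Dt B)
    (hDball' : ∀ B : 𝒴', ‖B‖ < ε → Dt' B ∈ closedBall (0:𝒳') (4 * C₂ * ε ^ 2))
    (hDfix' : ∀ B : 𝒴', ‖B‖ < ε → Ct' (B - hop' (Dt' B)) = Dt' B)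
    (hU : ∀ Y, ‖U Y‖ = ‖Y‖) (hV : ∀ X, ‖V X‖ = ‖X‖)
    (hhop : ∀ X, hop' (V X) = U (hop X)) (hCt : ∀ Y : 𝒴, ‖Y‖ < R → Ct' (U Y) = V (Ct Y))
    {B₀ : 𝒴} (hB₀ : ‖B₀‖ < ε) :
    (fun B => B - hop' (Dt' B)) =ᶠ[𝓝 (U B₀)] (⇑U ∘ (fun B => B - hop (Dt B)) ∘ ⇑U.symm) := by
  have hUB₀ : ‖U B₀‖ < ε := by rwa [hU]
  filter_upwards [(isOpen_lt continuous_norm continuous_const).mem_nhds hUB₀] with B' hB'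
  have hA : ‖U.symm B'‖ < ε := by
    have h := hU (U.symm B'); rw [U.apply_symm_apply] at h; rwa [← h]
  have h := phi_gauge₂ hC hC' hC₂ hb hHop hHop' hq hRC hDball hDfix hDball' hDfix' hU hV hhop hCt hA
  rw [U.apply_symm_apply] at h
  simpa using h

/-- **`DΦ′(UB₀) = U ∘ DΦ(B₀) ∘ U⁻¹`, two-carrier form** (no analyticity binder). [cite: Balaban1987RG1, (2.12) p.268, (2.16) p.269] -/
theorem fderiv_phi_gauge₂ (hC : QuadAnalytic Ct C₂ R) (hC' : QuadAnalytic Ct' C₂ R) (hC₂ : 0 ≤ C₂) (hb : 0 ≤ b)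
    (hHop : ∀ X, ‖hop X‖ ≤ b * ‖X‖) (hHop' : ∀ X, ‖hop' X‖ ≤ b * ‖X‖) (hq : 9 * C₂ * b * ε < 1)
    (hRC : 3 * ε ≤ R)
    (hDball : ∀ B : 𝒴, ‖B‖ < ε → Dt B ∈ closedBall (0:𝒳) (4 * C₂ * ε ^ 2))
    (hDfix : ∀ B : 𝒴, ‖B‖ < ε → Ct (B - hop (Dt B)) = Dt B)
    (hDball' : ∀ B : 𝒴', ‖B‖ < ε → Dt' B ∈ closedBall (0:𝒳') (4 * C₂ * ε ^ 2))
    (hDfix' : ∀ B : 𝒴', ‖B‖ < ε → Ct' (B - hop' (Dt' B)) = Dt' B)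
    (hU : ∀ Y, ‖U Y‖ = ‖Y‖) (hV : ∀ X, ‖V X‖ = ‖X‖)
    (hhop : ∀ X, hop' (V X) = U (hop X)) (hCt : ∀ Y : 𝒴, ‖Y‖ < R → Ct' (U Y) = V (Ct Y))
    {B₀ : 𝒴} (hB₀ : ‖B₀‖ < ε) :
    fderiv ℂ (fun B => B - hop' (Dt' B)) (U B₀) =
      (U : 𝒴 →L[ℂ] 𝒴') ∘L fderiv ℂ (fun B => B - hop (Dt B)) B₀ ∘L (U.symm : 𝒴' →L[ℂ] 𝒴) := by
  rw [(phi_gauge_eventuallyEq₂ hC hC' hC₂ hb hHop hHop' hq hRC hDball hDfix hDball' hDfix' hU hV hhop hCt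
      hB₀).fderiv_eq, U.comp_fderiv, U.symm.comp_right_fderiv, U.symm_apply_apply]

/-- **`det_{𝒴′} DΦ′(UB₀) = det_{𝒴} DΦ(B₀)`, two-carrier form** — THE JACOBIAN DETERMINANT IS GAUGE INVARIANT across
background-indexed carriers (no analyticity binder; `det_conj_eq₂`). [cite: Balaban1987RG1, (2.12) p.268, (2.16) p.269] -/
theorem det_fderiv_phi_gauge₂ (hC : QuadAnalytic Ct C₂ R) (hC' : QuadAnalytic Ct' C₂ R) (hC₂ : 0 ≤ C₂) (hb : 0 ≤ b)
    (hHop : ∀ X, ‖hop X‖ ≤ b * ‖X‖) (hHop' : ∀ X, ‖hop' X‖ ≤ b * ‖X‖) (hq : 9 * C₂ * b * ε < 1)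
    (hRC : 3 * ε ≤ R)
    (hDball : ∀ B : 𝒴, ‖B‖ < ε → Dt B ∈ closedBall (0:𝒳) (4 * C₂ * ε ^ 2))
    (hDfix : ∀ B : 𝒴, ‖B‖ < ε → Ct (B - hop (Dt B)) = Dt B)
    (hDball' : ∀ B : 𝒴', ‖B‖ < ε → Dt' B ∈ closedBall (0:𝒳') (4 * C₂ * ε ^ 2))
    (hDfix' : ∀ B : 𝒴', ‖B‖ < ε → Ct' (B - hop' (Dt' B)) = Dt' B)
    (hU : ∀ Y, ‖U Y‖ = ‖Y‖) (hV : ∀ X, ‖V X‖ = ‖X‖)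
    (hhop : ∀ X, hop' (V X) = U (hop X)) (hCt : ∀ Y : 𝒴, ‖Y‖ < R → Ct' (U Y) = V (Ct Y))
    {B₀ : 𝒴} (hB₀ : ‖B₀‖ < ε) :
    LinearMap.det ((fderiv ℂ (fun B => B - hop' (Dt' B)) (U B₀) : 𝒴' →L[ℂ] 𝒴') : 𝒴' →ₗ[ℂ] 𝒴') =
      LinearMap.det ((fderiv ℂ (fun B => B - hop (Dt B)) B₀ : 𝒴 →L[ℂ] 𝒴) : 𝒴 →ₗ[ℂ] 𝒴) := by
  rw [fderiv_phi_gauge₂ hC hC' hC₂ hb hHop hHop' hq hRC hDball hDfix hDball' hDfix' hU hV hhop hCt hB₀, det_conj_eq₂]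

/-- **`σ′(Φ′(UB)) = σ(Φ(B))`, two-carrier form**: two functionals `σ` on `𝒴`, `σ′` on `𝒴′` with `σ′(UY) = σ(Y)` (the
«log σ(·)» term read on background-indexed carriers). [cite: Balaban1987RG1, (2.12) p.268, (2.16) p.269] -/
theorem sigma_phi_gauge₂ {F : Type*} (σ : 𝒴 → F) (σ' : 𝒴' → F) (hσ : ∀ Y, σ' (U Y) = σ Y)
    (hC : QuadAnalytic Ct C₂ R) (hC' : QuadAnalytic Ct' C₂ R) (hC₂ : 0 ≤ C₂) (hb : 0 ≤ b)
    (hHop : ∀ X, ‖hop X‖ ≤ b * ‖X‖) (hHop' : ∀ X, ‖hop' X‖ ≤ b * ‖X‖) (hq : 9 * C₂ * b * ε < 1)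
    (hRC : 3 * ε ≤ R)
    (hDball : ∀ B : 𝒴, ‖B‖ < ε → Dt B ∈ closedBall (0:𝒳) (4 * C₂ * ε ^ 2))
    (hDfix : ∀ B : 𝒴, ‖B‖ < ε → Ct (B - hop (Dt B)) = Dt B)
    (hDball' : ∀ B : 𝒴', ‖B‖ < ε → Dt' B ∈ closedBall (0:𝒳') (4 * C₂ * ε ^ 2))
    (hDfix' : ∀ B : 𝒴', ‖B‖ < ε → Ct' (B - hop' (Dt' B)) = Dt' B)
    (hU : ∀ Y, ‖U Y‖ = ‖Y‖) (hV : ∀ X, ‖V X‖ = ‖X‖)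
    (hhop : ∀ X, hop' (V X) = U (hop X)) (hCt : ∀ Y : 𝒴, ‖Y‖ < R → Ct' (U Y) = V (Ct Y))
    {B : 𝒴} (hB : ‖B‖ < ε) : σ' (U B - hop' (Dt' (U B))) = σ (B - hop (Dt B)) := by
  rw [phi_gauge₂ hC hC' hC₂ hb hHop hHop' hq hRC hDball hDfix hDball' hDfix' hU hV hhop hCt hB, hσ]

variable [CompleteSpace 𝒴] [CompleteSpace 𝒴']

/-- **`log DΦ′(UB₀) = U ∘ log DΦ(B₀) ∘ U⁻¹`, two-carrier form** (`9C₂bε ≤ 1/2`, both `C̃`, `C̃′` Fréchet-analytic on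
`‖·‖ < R`, so that `‖J‖, ‖J′‖ < 1` by `B12JacobianTrLog268.norm_jacobianOp_lt_one`; the logarithm crosses the carriers by
`mlog_one_sub_conj₂`). [cite: Balaban1987RG1, (2.12) p.268, (2.16) p.269] -/
theorem logJacobian_gauge₂ (hC : QuadAnalytic Ct C₂ R) (hCa : AnalyticOnNhd ℂ Ct {Y : 𝒴 | ‖Y‖ < R})
    (hC' : QuadAnalytic Ct' C₂ R) (hCa' : AnalyticOnNhd ℂ Ct' {Y : 𝒴' | ‖Y‖ < R}) (hC₂ : 0 ≤ C₂) (hb : 0 ≤ b)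
    (hHop : ∀ X, ‖hop X‖ ≤ b * ‖X‖) (hHop' : ∀ X, ‖hop' X‖ ≤ b * ‖X‖) (hq2 : 9 * C₂ * b * ε ≤ 1 / 2)
    (hRC : 3 * ε ≤ R)
    (hDball : ∀ B : 𝒴, ‖B‖ < ε → Dt B ∈ closedBall (0:𝒳) (4 * C₂ * ε ^ 2))
    (hDfix : ∀ B : 𝒴, ‖B‖ < ε → Ct (B - hop (Dt B)) = Dt B)
    (hDball' : ∀ B : 𝒴', ‖B‖ < ε → Dt' B ∈ closedBall (0:𝒳') (4 * C₂ * ε ^ 2))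
    (hDfix' : ∀ B : 𝒴', ‖B‖ < ε → Ct' (B - hop' (Dt' B)) = Dt' B)
    (hU : ∀ Y, ‖U Y‖ = ‖Y‖) (hV : ∀ X, ‖V X‖ = ‖X‖)
    (hhop : ∀ X, hop' (V X) = U (hop X)) (hCt : ∀ Y : 𝒴, ‖Y‖ < R → Ct' (U Y) = V (Ct Y))
    {B₀ : 𝒴} (hB₀ : ‖B₀‖ < ε) :
    mlog (1 - hop'.mkContinuous b hHop' ∘L fderiv ℂ Dt' (U B₀)) =
      (U : 𝒴 →L[ℂ] 𝒴') ∘L mlog (1 - hop.mkContinuous b hHop ∘L fderiv ℂ Dt B₀) ∘L (U.symm : 𝒴' →L[ℂ] 𝒴) := by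
  have hUB₀ : ‖U B₀‖ < ε := by rwa [hU]
  have hJ := norm_jacobianOp_lt_one hC hCa hC₂ hb hHop hq2 hRC hDball hDfix hB₀
  have hJ' := norm_jacobianOp_lt_one hC' hCa' hC₂ hb hHop' hq2 hRC hDball' hDfix' hUB₀
  rw [jacobianOp_gauge₂ hC hC' hC₂ hb hHop hHop' (lt_one_of_le_half hq2) hRC hDball hDfix hDball' hDfix' hU hV hhop
    hCt hB₀] at hJ' ⊢
  exact mlog_one_sub_conj₂ U hJ hJ'

/-- **`Tr_{𝒴′} log DΦ′(UB₀) = Tr_{𝒴} log DΦ(B₀)`, two-carrier form** — «Tr log(I − h((δ/δB)D̃)(·))» IS GAUGE INVARIANT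
across background-indexed carriers (`trace_conj_eq₂`). [cite: Balaban1987RG1, (2.12) p.268, (2.16) p.269] -/
theorem trace_logJacobian_gauge₂ (hC : QuadAnalytic Ct C₂ R) (hCa : AnalyticOnNhd ℂ Ct {Y : 𝒴 | ‖Y‖ < R})
    (hC' : QuadAnalytic Ct' C₂ R) (hCa' : AnalyticOnNhd ℂ Ct' {Y : 𝒴' | ‖Y‖ < R}) (hC₂ : 0 ≤ C₂) (hb : 0 ≤ b)
    (hHop : ∀ X, ‖hop X‖ ≤ b * ‖X‖) (hHop' : ∀ X, ‖hop' X‖ ≤ b * ‖X‖) (hq2 : 9 * C₂ * b * ε ≤ 1 / 2)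
    (hRC : 3 * ε ≤ R)
    (hDball : ∀ B : 𝒴, ‖B‖ < ε → Dt B ∈ closedBall (0:𝒳) (4 * C₂ * ε ^ 2))
    (hDfix : ∀ B : 𝒴, ‖B‖ < ε → Ct (B - hop (Dt B)) = Dt B)
    (hDball' : ∀ B : 𝒴', ‖B‖ < ε → Dt' B ∈ closedBall (0:𝒳') (4 * C₂ * ε ^ 2))
    (hDfix' : ∀ B : 𝒴', ‖B‖ < ε → Ct' (B - hop' (Dt' B)) = Dt' B)
    (hU : ∀ Y, ‖U Y‖ = ‖Y‖) (hV : ∀ X, ‖V X‖ = ‖X‖)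
    (hhop : ∀ X, hop' (V X) = U (hop X)) (hCt : ∀ Y : 𝒴, ‖Y‖ < R → Ct' (U Y) = V (Ct Y))
    {B₀ : 𝒴} (hB₀ : ‖B₀‖ < ε) :
    LinearMap.trace ℂ 𝒴' ((mlog (1 - hop'.mkContinuous b hHop' ∘L fderiv ℂ Dt' (U B₀)) : 𝒴' →L[ℂ] 𝒴') : 𝒴' →ₗ[ℂ] 𝒴') =
      LinearMap.trace ℂ 𝒴 ((mlog (1 - hop.mkContinuous b hHop ∘L fderiv ℂ Dt B₀) : 𝒴 →L[ℂ] 𝒴) : 𝒴 →ₗ[ℂ] 𝒴) := by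
  rw [logJacobian_gauge₂ hC hCa hC' hCa' hC₂ hb hHop hHop' hq2 hRC hDball hDfix hDball' hDfix' hU hV hhop hCt hB₀,
    trace_conj_eq₂]

/-- Consistency with §§2–5: at `𝒳′ = 𝒳`, `𝒴′ = 𝒴` the two-carrier `Dt_gauge₂` IS §2's `Dt_gauge` (same statement), checked
on §5's degenerate model (`U = V = −1` on `ℂ`, `C̃ = D̃ = 0`). [cite: Balaban1987RG1, (2.16) p.269] -/
example {B : ℂ} (hB : ‖B‖ < 1) :
    (fun _ : ℂ => (0 : ℂ)) (ContinuousLinearEquiv.neg ℂ B) = ContinuousLinearEquiv.neg ℂ ((fun _ : ℂ => (0 : ℂ)) B) :=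
  Dt_gauge₂ (𝒳 := ℂ) (𝒳' := ℂ) (𝒴 := ℂ) (𝒴' := ℂ) (hop := LinearMap.id) (hop' := LinearMap.id)
    (Ct := fun _ => 0) (Ct' := fun _ => 0) (C₂ := 0) (R := 3) (b := 1) (ε := 1)
    (Dt := fun _ => 0) (Dt' := fun _ => 0) (V := ContinuousLinearEquiv.neg ℂ) (U := ContinuousLinearEquiv.neg ℂ)
    ⟨fun Y _ => by simp, fun P Q => differentiableOn_const (0:ℂ)⟩
    ⟨fun Y _ => by simp, fun P Q => differentiableOn_const (0:ℂ)⟩ le_rfl zero_le_one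
    (fun X => by simp) (fun X => by simp) (by norm_num) (by norm_num)
    (fun B _ => by simp) (fun B _ => by simp) (fun B _ => by simp) (fun B _ => by simp)
    (fun Y => by simp) (fun X => by simp) (fun X => by simp) (fun Y _ => by simp) hB

end twoCarrier


/-! ## §9  (v1.4) RESTRICTION TO A CLOSED INVARIANT SUB-CARRIER: the scheme, `D̃`, `Φ` and the Jacobian operator
`1 − h∘DD̃` RESTRICT to any closed pair of subspaces `W𝒳 ≤ 𝒳`, `W𝒴 ≤ 𝒴` stable under the letters

WHY.  Print's (2.10)–(2.16) live on the FINITE tori of (0.1) p. 251 («this torus determines a sequence of tori»;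
p. 267 «It transforms g-valued functions B defined at bonds of the lattice T^{(k+1)} into such functions defined at
bonds of T^{(k)}»), where «Tr log» and `det` of (2.12) make sense; r09's carrier for the letters `L`, `Q̃`, `h`, `C̃`,
`D̃` is the bond space `ℓ^∞(ℤᵈ)` (`B12Def267Covariance.BField`), on which they do not (§7 HONEST SCOPE).  The periodic bond fields are a CLOSED subspace
of `ℓ^∞(ℤᵈ)` (an intersection of kernels of the continuous maps `A ↦ A∘τ_v − A`), finite-dimensional when the
structure algebra is, and the letters built from translation-covariant formulas map periodic fields to periodic
fields.  This section proves, for the abstract scheme of §§2–8, that NOTHING ELSE is needed to pass to such a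
sub-carrier: given closed `W𝒳`, and `W𝒴` with `h(W𝒳) ⊆ W𝒴`, `C̃(W𝒴) ⊆ W𝒳` (BINDERS, as the covariance of the letters
is throughout this file), (i) `C̃` restricted and co-restricted is again `QuadAnalytic` with the SAME constants
(`quadAnalytic_subcarrier` — the quadratic bound is inherited, and analyticity along complex lines co-restricts
because the derivative of a curve with values in a closed subspace lies in it, the tree's
`Literature.Analysis.Calculus.ContDiffCodRestrict`); (ii) the ambient `D̃` maps `W𝒴 ∩ {‖B‖ < ε}` into `W𝒳`
(`Dt_mem_subcarrier`: the sub-carrier system has its own fixed point by `B13Contraction113.exists_unique_fixedPoint`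
— a closed subspace of a Banach space is complete — and «exactly one solution» in the ambient ball identifies it with
`D̃(B)`), hence `Φ(B) = B − hD̃(B) ∈ W𝒴` (`phi_mem_subcarrier`); (iii) the derivative `DD̃(B)` maps `W𝒴` into `W𝒳`
and the Jacobian operator `1 − h∘DD̃(B)` maps `W𝒴` into itself (`fderiv_Dt_mem_subcarrier`,
`jacobianOp_mem_subcarrier` — no differentiability binder: a derivative of a map carrying a neighbourhood into a
closed subspace takes values in it, `mem_of_hasFDerivAt_of_isClosed`, and the junk value `0` lies in every
subspace); (iv) any `D̃_W` of the sub-carrier system IS the ambient `D̃` (`Dt_subcarrier_eq`, = §8 `Dt_embed` for the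
inclusions), and such a `D̃_W` exists (`exists_Dt_subcarrier`, `B12Lineariz267.exists_Dt` in the complete `W𝒳`).
So §3's `Tr log` ∕ `det` statements and §6's Haar `σ` apply on a finite-dimensional invariant sub-carrier AS SOON AS
the letters' invariance is supplied — which for the periodic sub-carrier of `ℓ^∞(ℤᵈ)` is
translation covariance of r09's `LQ̃`, `Q̃`, `h`, `C̃` (NOT in the tree; pattern of r09's
`B12Average012Periodicity.Tavg_shiftE` ∕ `avgBar_shiftE`).  HONEST SCOPE: abstract host only; no sub-carrier of
`BField` is constructed here and no letter's invariance is proved here. [cite: Balaban1987RG1, (0.1) p.251, p.267,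
(2.12) p.268, (2.16) p.269] -/

section subcarrier

variable {𝒳 𝒴 : Type*} [NormedAddCommGroup 𝒳] [NormedSpace ℂ 𝒳] [NormedAddCommGroup 𝒴] [NormedSpace ℂ 𝒴]
  {hop : 𝒳 →ₗ[ℂ] 𝒴} {Ct : 𝒴 → 𝒳} {C₂ R b ε : ℝ} {Dt : 𝒴 → 𝒳}
  {W𝒳 : Submodule ℂ 𝒳} {W𝒴 : Submodule ℂ 𝒴}

/-- **`C̃` restricted to an invariant sub-carrier and co-restricted to a CLOSED one is again `QuadAnalytic`, with the
same constants**: the quadratic bound is inherited (norms of a subspace are the ambient ones) and analyticity along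
complex lines co-restricts — the complex derivative of a curve with values in a closed subspace lies in it
(`Literature.Analysis.Calculus.differentiableWithinAt_of_linearIsometry_comp` for the inclusion) — for print's `C̃` of
p. 267 passing from the `ℓ^∞(ℤᵈ)` carrier to the periodic (torus) one. [cite: Balaban1987RG1, p.267] -/
theorem quadAnalytic_subcarrier (hC : QuadAnalytic Ct C₂ R) (hW𝒳 : IsClosed (W𝒳 : Set 𝒳))
    (hCt : ∀ Y ∈ W𝒴, Ct Y ∈ W𝒳) :
    QuadAnalytic (fun Y : W𝒴 => (⟨Ct Y, hCt Y Y.2⟩ : W𝒳)) C₂ R where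
  quad Y hY := by
    have h := hC.quad (Y : 𝒴) (by simpa [Submodule.coe_norm] using hY)
    simpa [Submodule.coe_norm] using h
  lineAnalytic P Q := by
    intro ζ hζ
    have hset : {ζ : ℂ | ‖P + ζ • Q‖ < R} = {ζ : ℂ | ‖(P : 𝒴) + ζ • (Q : 𝒴)‖ < R} := by
      ext z
      simp only [mem_setOf_eq, Submodule.coe_norm, Submodule.coe_add, Submodule.coe_smul]
    have hs : IsOpen {ζ : ℂ | ‖(P : 𝒴) + ζ • (Q : 𝒴)‖ < R} :=
      isOpen_lt (by fun_prop) continuous_const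
    have hζ' : ζ ∈ {ζ : ℂ | ‖(P : 𝒴) + ζ • (Q : 𝒴)‖ < R} := by rwa [hset] at hζ
    have hamb : DifferentiableWithinAt ℂ (fun ζ : ℂ => Ct ((P : 𝒴) + ζ • (Q : 𝒴)))
        {ζ : ℂ | ‖(P : 𝒴) + ζ • (Q : 𝒴)‖ < R} ζ := hC.lineAnalytic (P : 𝒴) (Q : 𝒴) ζ hζ'
    rw [hset]
    refine differentiableWithinAt_of_linearIsometry_comp W𝒳.subtypeₗᵢ ?_ (hs.uniqueDiffWithinAt hζ') hζ' ?_
    · rw [range_subtypeₗᵢ]; exact hW𝒳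
    · have heq : (W𝒳.subtypeₗᵢ ∘ fun ζ : ℂ => (⟨Ct ((P + ζ • Q : W𝒴) : 𝒴), hCt _ (P + ζ • Q).2⟩ : W𝒳)) =
          fun ζ : ℂ => Ct ((P : 𝒴) + ζ • (Q : 𝒴)) := by
        funext z; simp
      rw [heq]; exact hamb

/-- The restricted `h` (print's «operator h» of p. 267 on the sub-carrier) obeys the same bound `‖hX‖ ≤ b‖X‖`.
[cite: Balaban1987RG1, p.267] -/
theorem norm_hop_restrict_le (hHop : ∀ X, ‖hop X‖ ≤ b * ‖X‖) (hhop : ∀ X ∈ W𝒳, hop X ∈ W𝒴)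
    (X : W𝒳) : ‖hop.restrict hhop X‖ ≤ b * ‖X‖ := by
  simpa [Submodule.coe_norm, LinearMap.coe_restrict_apply] using hHop (X : 𝒳)

/-- **The ambient `D̃` maps the sub-carrier ball `W𝒴 ∩ {‖B‖ < ε}` into `W𝒳`** (closed `W𝒳`, `h(W𝒳) ⊆ W𝒴`,
`C̃(W𝒴) ⊆ W𝒳`): the sub-carrier system `(h|, C̃|)` has its own solution of `C̃(B − hX) = X` in the ball `4C₂ε²` of the
complete space `W𝒳` (`B13Contraction113.exists_unique_fixedPoint`), and «exactly one solution» in the ambient ball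
(`B12Lineariz267.eq_Dt_of_fixedPt`) identifies it with `D̃(B)`. [cite: Balaban1987RG1, p.267] -/
theorem Dt_mem_subcarrier [CompleteSpace 𝒳] (hC : QuadAnalytic Ct C₂ R) (hC₂ : 0 ≤ C₂) (hb : 0 ≤ b)
    (hHop : ∀ X, ‖hop X‖ ≤ b * ‖X‖) (hq : 9 * C₂ * b * ε < 1) (hRC : 3 * ε ≤ R)
    (hDball : ∀ B : 𝒴, ‖B‖ < ε → Dt B ∈ closedBall (0:𝒳) (4 * C₂ * ε ^ 2))
    (hDfix : ∀ B : 𝒴, ‖B‖ < ε → Ct (B - hop (Dt B)) = Dt B)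
    (hW𝒳 : IsClosed (W𝒳 : Set 𝒳)) (hhop : ∀ X ∈ W𝒳, hop X ∈ W𝒴) (hCt : ∀ Y ∈ W𝒴, Ct Y ∈ W𝒳)
    {B : 𝒴} (hBW : B ∈ W𝒴) (hB : ‖B‖ < ε) : Dt B ∈ W𝒳 := by
  haveI : CompleteSpace W𝒳 := hW𝒳.completeSpace_coe
  have hCW := quadAnalytic_subcarrier (W𝒴 := W𝒴) hC hW𝒳 hCt
  have hBW' : ‖(⟨B, hBW⟩ : W𝒴)‖ < ε := by simpa [Submodule.coe_norm] using hB
  obtain ⟨XW, hXWball, hXWfix, -⟩ := exists_unique_fixedPoint (Hop := hop.restrict hhop)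
    (A' := (⟨B, hBW⟩ : W𝒴)) hCW hC₂ hb (norm_hop_restrict_le hHop hhop) hBW' hq hRC
  have hXball : (XW : 𝒳) ∈ closedBall (0:𝒳) (4 * C₂ * ε ^ 2) := by
    rw [mem_closedBall_zero_iff] at hXWball ⊢
    simpa [Submodule.coe_norm] using hXWball
  have hXfix : Ct (B - hop (XW : 𝒳)) = XW := by
    have h := congrArg Subtype.val hXWfix
    simpa [LinearMap.coe_restrict_apply] using h
  rw [← eq_Dt_of_fixedPt hC hC₂ hb hHop hq hRC hDball hDfix hB hXball hXfix]
  exact XW.2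

/-- **`Φ(B) = B − hD̃(B) ∈ W𝒴`** for `B` in the sub-carrier ball: the linearizing substitution of p. 267 restricts.
[cite: Balaban1987RG1, p.267] -/
theorem phi_mem_subcarrier [CompleteSpace 𝒳] (hC : QuadAnalytic Ct C₂ R) (hC₂ : 0 ≤ C₂) (hb : 0 ≤ b)
    (hHop : ∀ X, ‖hop X‖ ≤ b * ‖X‖) (hq : 9 * C₂ * b * ε < 1) (hRC : 3 * ε ≤ R)
    (hDball : ∀ B : 𝒴, ‖B‖ < ε → Dt B ∈ closedBall (0:𝒳) (4 * C₂ * ε ^ 2))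
    (hDfix : ∀ B : 𝒴, ‖B‖ < ε → Ct (B - hop (Dt B)) = Dt B)
    (hW𝒳 : IsClosed (W𝒳 : Set 𝒳)) (hhop : ∀ X ∈ W𝒳, hop X ∈ W𝒴) (hCt : ∀ Y ∈ W𝒴, Ct Y ∈ W𝒳)
    {B : 𝒴} (hBW : B ∈ W𝒴) (hB : ‖B‖ < ε) : B - hop (Dt B) ∈ W𝒴 :=
  W𝒴.sub_mem hBW (hhop _ (Dt_mem_subcarrier hC hC₂ hb hHop hq hRC hDball hDfix hW𝒳 hhop hCt hBW hB))

/-- **The derivative `(δ/δB)D̃(B)` maps `W𝒴` into `W𝒳`** at every `B` of the sub-carrier ball — with NO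
differentiability binder: where `D̃` is differentiable, its restriction to `W𝒴` carries a neighbourhood of `B` into
the closed `W𝒳` (`Dt_mem_subcarrier`), so its derivative takes values there
(`Literature.Analysis.Calculus.mem_of_hasFDerivAt_of_isClosed`); elsewhere `fderiv = 0`. [cite: Balaban1987RG1, (2.12) p.268] -/
theorem fderiv_Dt_mem_subcarrier [CompleteSpace 𝒳] (hC : QuadAnalytic Ct C₂ R) (hC₂ : 0 ≤ C₂) (hb : 0 ≤ b)
    (hHop : ∀ X, ‖hop X‖ ≤ b * ‖X‖) (hq : 9 * C₂ * b * ε < 1) (hRC : 3 * ε ≤ R)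
    (hDball : ∀ B : 𝒴, ‖B‖ < ε → Dt B ∈ closedBall (0:𝒳) (4 * C₂ * ε ^ 2))
    (hDfix : ∀ B : 𝒴, ‖B‖ < ε → Ct (B - hop (Dt B)) = Dt B)
    (hW𝒳 : IsClosed (W𝒳 : Set 𝒳)) (hhop : ∀ X ∈ W𝒳, hop X ∈ W𝒴) (hCt : ∀ Y ∈ W𝒴, Ct Y ∈ W𝒳)
    {B : 𝒴} (hBW : B ∈ W𝒴) (hB : ‖B‖ < ε) {Y : 𝒴} (hY : Y ∈ W𝒴) : fderiv ℂ Dt B Y ∈ W𝒳 := by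
  by_cases hD : DifferentiableAt ℂ Dt B
  · have hf : HasFDerivAt (fun B' : W𝒴 => Dt (B' : 𝒴)) ((fderiv ℂ Dt B) ∘L W𝒴.subtypeL) (⟨B, hBW⟩ : W𝒴) :=
      hD.hasFDerivAt.comp _ W𝒴.subtypeL.hasFDerivAt
    have hopen : IsOpen {B' : W𝒴 | ‖(B' : 𝒴)‖ < ε} :=
      isOpen_lt (continuous_norm.comp continuous_subtype_val) continuous_const
    have hev : ∀ᶠ (B' : W𝒴) in 𝓝 ⟨B, hBW⟩, Dt (B' : 𝒴) ∈ W𝒳 := by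
      filter_upwards [hopen.mem_nhds (show (⟨B, hBW⟩ : W𝒴) ∈ {B' : W𝒴 | ‖(B' : 𝒴)‖ < ε} from hB)]
        with B' hB'
      exact Dt_mem_subcarrier hC hC₂ hb hHop hq hRC hDball hDfix hW𝒳 hhop hCt B'.2 hB'
    simpa using mem_of_hasFDerivAt_of_isClosed W𝒳 hW𝒳 hf hev ⟨Y, hY⟩
  · rw [fderiv_zero_of_not_differentiableAt hD]
    simp

/-- **The Jacobian operator `1 − h∘(δ/δB)D̃(B)` of (2.12) maps `W𝒴` into itself** — so it HAS a restriction to the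
sub-carrier, to which (when `W𝒴` is finite-dimensional) §3's «Tr log» ∕ `det` statements apply. [cite: Balaban1987RG1, (2.12) p.268] -/
theorem jacobianOp_mem_subcarrier [CompleteSpace 𝒳] (hC : QuadAnalytic Ct C₂ R) (hC₂ : 0 ≤ C₂) (hb : 0 ≤ b)
    (hHop : ∀ X, ‖hop X‖ ≤ b * ‖X‖) (hq : 9 * C₂ * b * ε < 1) (hRC : 3 * ε ≤ R)
    (hDball : ∀ B : 𝒴, ‖B‖ < ε → Dt B ∈ closedBall (0:𝒳) (4 * C₂ * ε ^ 2))
    (hDfix : ∀ B : 𝒴, ‖B‖ < ε → Ct (B - hop (Dt B)) = Dt B)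
    (hW𝒳 : IsClosed (W𝒳 : Set 𝒳)) (hhop : ∀ X ∈ W𝒳, hop X ∈ W𝒴) (hCt : ∀ Y ∈ W𝒴, Ct Y ∈ W𝒳)
    {B : 𝒴} (hBW : B ∈ W𝒴) (hB : ‖B‖ < ε) {Y : 𝒴} (hY : Y ∈ W𝒴) :
    Y - hop (fderiv ℂ Dt B Y) ∈ W𝒴 :=
  W𝒴.sub_mem hY (hhop _ (fderiv_Dt_mem_subcarrier hC hC₂ hb hHop hq hRC hDball hDfix hW𝒳 hhop hCt hBW hB hY))

/-- **Any `D̃_W` of the sub-carrier system `(h|, C̃|)` IS the ambient `D̃`** on the sub-carrier ball: §8's `Dt_embed`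
for the inclusions `W𝒴 ↪ 𝒴`, `W𝒳 ↪ 𝒳`. [cite: Balaban1987RG1, p.267] -/
theorem Dt_subcarrier_eq [CompleteSpace 𝒳] (hC : QuadAnalytic Ct C₂ R) (hC₂ : 0 ≤ C₂) (hb : 0 ≤ b)
    (hHop : ∀ X, ‖hop X‖ ≤ b * ‖X‖) (hq : 9 * C₂ * b * ε < 1) (hRC : 3 * ε ≤ R)
    (hDball : ∀ B : 𝒴, ‖B‖ < ε → Dt B ∈ closedBall (0:𝒳) (4 * C₂ * ε ^ 2))
    (hDfix : ∀ B : 𝒴, ‖B‖ < ε → Ct (B - hop (Dt B)) = Dt B)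
    (hW𝒳 : IsClosed (W𝒳 : Set 𝒳)) (hhop : ∀ X ∈ W𝒳, hop X ∈ W𝒴) (hCt : ∀ Y ∈ W𝒴, Ct Y ∈ W𝒳)
    {DtW : W𝒴 → W𝒳}
    (hDWball : ∀ B : W𝒴, ‖B‖ < ε → DtW B ∈ closedBall (0:W𝒳) (4 * C₂ * ε ^ 2))
    (hDWfix : ∀ B : W𝒴, ‖B‖ < ε →
      (⟨Ct (B - hop.restrict hhop (DtW B) : W𝒴), hCt _ (B - hop.restrict hhop (DtW B)).2⟩ : W𝒳) = DtW B)
    {B : W𝒴} (hB : ‖B‖ < ε) : (DtW B : 𝒳) = Dt B := by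
  haveI : CompleteSpace W𝒳 := hW𝒳.completeSpace_coe
  have h := Dt_embed (ιY := W𝒴.subtypeL) (ιX := W𝒳.subtypeL) (hop := hop.restrict hhop) (hop' := hop)
    (Ct := fun Y : W𝒴 => (⟨Ct Y, hCt Y Y.2⟩ : W𝒳)) (Ct' := Ct) (Dt := DtW) (Dt' := Dt)
    (quadAnalytic_subcarrier (W𝒴 := W𝒴) hC hW𝒳 hCt) hC hC₂ hb (norm_hop_restrict_le hHop hhop) hHop hq hRC
    hDWball hDWfix hDball hDfix (fun Y => by simp [Submodule.coe_norm]) (fun X => by simp [Submodule.coe_norm])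
    (fun X => by simp [LinearMap.coe_restrict_apply]) (fun Y _ => rfl) hB
  simpa using h.symm


/-- **The sub-carrier system has its own `D̃_W : W𝒴 → W𝒳`** — ball and fixed-point binders from
`B12Lineariz267.exists_Dt` in the complete `W𝒳` — **and it is the ambient `D̃` co-restricted**; so §§2–8 apply on the
sub-carrier with `D̃_W`, and for finite-dimensional `W𝒴` so do §3's «Tr log» ∕ `det` and §6's Haar `σ`.
[cite: Balaban1987RG1, p.267, (2.12) p.268] -/
theorem exists_Dt_subcarrier [CompleteSpace 𝒳] (hC : QuadAnalytic Ct C₂ R) (hC₂ : 0 ≤ C₂) (hb : 0 ≤ b)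
    (hHop : ∀ X, ‖hop X‖ ≤ b * ‖X‖) (hq : 9 * C₂ * b * ε < 1) (hRC : 3 * ε ≤ R)
    (hDball : ∀ B : 𝒴, ‖B‖ < ε → Dt B ∈ closedBall (0:𝒳) (4 * C₂ * ε ^ 2))
    (hDfix : ∀ B : 𝒴, ‖B‖ < ε → Ct (B - hop (Dt B)) = Dt B)
    (hW𝒳 : IsClosed (W𝒳 : Set 𝒳)) (hhop : ∀ X ∈ W𝒳, hop X ∈ W𝒴) (hCt : ∀ Y ∈ W𝒴, Ct Y ∈ W𝒳) :
    ∃ DtW : W𝒴 → W𝒳, ∀ B : W𝒴, ‖B‖ < ε →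
      DtW B ∈ closedBall (0:W𝒳) (4 * C₂ * ε ^ 2) ∧
      (⟨Ct (B - hop.restrict hhop (DtW B) : W𝒴), hCt _ (B - hop.restrict hhop (DtW B)).2⟩ : W𝒳) = DtW B ∧
      (DtW B : 𝒳) = Dt B := by
  haveI : CompleteSpace W𝒳 := hW𝒳.completeSpace_coe
  obtain ⟨DtW, hDtW⟩ := exists_Dt (hop := hop.restrict hhop)
    (quadAnalytic_subcarrier (W𝒴 := W𝒴) hC hW𝒳 hCt) hC₂ hb (norm_hop_restrict_le hHop hhop) hq hRC
  refine ⟨DtW, fun B hB => ⟨(hDtW B hB).1, (hDtW B hB).2, ?_⟩⟩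
  exact Dt_subcarrier_eq hC hC₂ hb hHop hq hRC hDball hDfix hW𝒳 hhop hCt (fun B hB => (hDtW B hB).1)
    (fun B hB => (hDtW B hB).2) hB

end subcarrier


/-! ## §10  (v1.5) THE PERIODIC SUB-CARRIER OF r09's `ℓ^∞(ℤᵈ)` CARRIER = PRINT'S TORUS (0.1): construction,
closedness, finite dimension, (2.16)∕(2.17)-stability, and the Jacobian determinant of (2.12) ON THE TORUS

WHY.  §9 proved abstractly that the p. 267 ∕ (2.16) scheme restricts to any closed invariant sub-carrier pair; the
sub-carrier print actually uses is the space of bond functions on the finite torus of (0.1) p. 251 («a torus T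
obtained by the usual identification of boundary points of the cube … This torus determines a sequence of tori»;
p. 267 «It transforms 𝐠-valued functions B defined at bonds of the lattice T⁽ᵏ⁺¹⁾ into such functions defined at
bonds of T⁽ᵏ⁾»), i.e. — inside r09's carrier `BField d 𝔸 = ℓ^∞(bonds of ℤᵈ; 𝔸)` of the letters `LQ̃, Q̃, h, C̃, D̃` —
the PERIODIC bond fields (period `LN` on the fine lattice `T⁽ᵏ⁾`, period `N` on the coarse lattice `T⁽ᵏ⁺¹⁾`; the
relabelling to `(ℤ/Nℤ)ᵈ` is the tree's `B7AvgPeriodicity` ∕ `B12Average012Periodicity.avgIter012_descend`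
dictionary).  This section CONSTRUCTS that sub-carrier and instantiates §§8–9 on it.
RESULTS.  (a) `shiftBFL v : BField ≃L[ℂ] BField` — the translations `τ_v` of (2.17) («(rU)(b) = U(rb)») as
continuous linear ISOMETRIC equivalences of `ℓ^∞` (r09's function-level `shiftE` underneath: `coe_shiftBFL`;
`shiftBFL_zero` ∕ `shiftBFL_add` ∕ `norm_shiftBFL`); `restrictEquiv` — a sub-carrier-preserving equivalence
restricts (generic).  (b) **`perBF d 𝔸 N`** — the `N`-periodic bond fields as a `ℂ`-subspace (`⨅_v` of the
equalisers of `τ_{Nv}` with `1`; `mem_perBF_iff` bondwise), **CLOSED** (`isClosed_perBF`, hence complete), stable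
under all translations (`shiftBFL_mem_perBF`, `shiftBFLPer`).  (c) **`finiteDimensional_perBF`**: for
finite-dimensional `𝔸` and `N ≥ 1` the torus carrier is finite-dimensional (restriction to the `Nᵈ·d` bonds based
in the box `[0,N)ᵈ` is injective on periodic fields) — so «Tr log» ∕ `det` of (2.12) are the ordinary ones there.
(d) (2.16) ON THE TORUS: for an `N`-periodic gauge function `w` (a gauge transformation OF the torus) `R(w)^{±1}`
preserve `perBF N` (`rotBFL_mem_perBF`, `rotBFL_symm_mem_perBF`), an `LN`-periodic `u` read through the block map
is `N`-periodic (`blockBase_periodic`, r09's `blockBase_add`), and the restricted map **`rotBFLPer`**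
`: perBF N ≃L[ℂ] perBF N` is an isometry (`norm_rotBFLPer`).  (e) ASSEMBLY: for two systems `(h, C̃)`, `(h′, C̃′)`
on one carrier pair, (2.16)-covariant and preserving a closed sub-carrier pair also preserved by `U^{±1}`, `V^{±1}`
(binders), the restricted systems satisfy §8 verbatim — `Dt_gauge_sub`, `phi_gauge_sub`,
**`det_fderiv_phi_gauge_sub`** (`det_{W𝒴} DΦ_W′(UB₀) = det_{W𝒴} DΦ_W(B₀)`, no analyticity binder),
`trace_logJacobian_gauge_sub` (with the Fréchet-analyticity of `C̃|`, `C̃′|` on the sub-carrier as binders); AT THE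
TORUS: **`det_fderiv_phi_gauge_per`** ∕ `Dt_gauge_per` (abstract letters on `BField`, stability binders), and for
[I]'s GENUINE letters **`p269_det_genuineZd_per`**: with r09's `hfield` ∕ `Cfield` ∕ `quadAnalytic_Cfield` ∕
`norm_hfield_le` ∕ `hfield_gaugeTransformZd` ∕ `Cfield_gaugeTransformZd` BY NAME, an `LN`-periodic bondwise-`U1`
gauge function `u`, ANY ambient solutions `D̃_V`, `D̃_{V^u}` (exist: `p267_genuine`) and ONLY the two stability
binders «`h_V(perBF N) ⊆ perBF (LN)`», «`C̃_V(perBF (LN)) ⊆ perBF N`» (their `V^u` twins FOLLOW: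
`hfield_mem_perBF_gauge`, `Cfield_mem_perBF_gauge`), the restricted solutions exist, are the ambient ones, are
(2.16)-equivariant, and **the torus Jacobian determinant `det(1 − h∘DD̃_W)` is (2.16)-invariant**.
HONEST SCOPE.  (i) The two stability binders = translation covariance of r09's `h` ∕ `C̃` at an `LN`-periodic
background (his `LQ_shiftE` ∕ `Qtilde_shiftE` are in the tree; the `hfield` ∕ `Cfield` ∕ uniqueness-of-`h` versions
are not) — NOT discharged here.  (ii) «Tr log» on the torus needs, beyond finite dimension, the Fréchet analyticity
of `C̃|` on the sub-carrier ball (a Hartogs-type consequence of `QuadAnalytic` in finite dimension; not formalised):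
kept as the binders `hCaW`, `hCaW'`.  (iii) Print's Haar `σ` needs `𝐠`-valued bond variables (§6's product carrier),
a further sub-carrier condition not imposed on `perBF`.  (iv) Uniform period `N` in all directions (print: `L_μ = L^m`
for all `μ`); (0.1)'s half-integer offsets are the usual relabelling.  FIVE `def`s with bodies (`restrictEquiv`,
`shiftBFL`, `perBF`, `shiftBFLPer`, `rotBFLPer`; + 3 private auxiliaries), theorems, no `Prop` fact, no `sorry`.
[cite: Balaban1987RG1, (0.1) p.251, p.267, (2.12) p.268, (2.16)–(2.17) p.269] -/

section restrictEquiv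

variable {E : Type*} [NormedAddCommGroup E] [NormedSpace ℂ E]

/-- A continuous linear equivalence preserving a subspace in both directions RESTRICTS to a continuous linear
equivalence of the subspace (the (2.16) ∕ (2.17) maps on an invariant sub-carrier; generic: Mathlib's
`ContinuousLinearEquiv.ofSubmodules e W W` with `W.map e = W` derived from the two stability hypotheses). [cite: Balaban1987RG1, (2.16) p.269] -/
noncomputable def restrictEquiv (e : E ≃L[ℂ] E) (W : Submodule ℂ E) (h₁ : ∀ x ∈ W, e x ∈ W)
    (h₂ : ∀ x ∈ W, e.symm x ∈ W) : W ≃L[ℂ] W :=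
  e.ofSubmodules W W (by
    apply le_antisymm
    · rintro _ ⟨x, hx, rfl⟩
      exact h₁ x hx
    · intro x hx
      exact ⟨e.symm x, h₂ x hx, by simp⟩)

/-- `restrictEquiv e W` acts as `e` (the restricted (2.16) ∕ (2.17) map is the ambient one on the sub-carrier). [cite: Balaban1987RG1, (2.16) p.269] -/
@[simp] theorem coe_restrictEquiv (e : E ≃L[ℂ] E) (W : Submodule ℂ E) (h₁ : ∀ x ∈ W, e x ∈ W)
    (h₂ : ∀ x ∈ W, e.symm x ∈ W) (x : W) : ((restrictEquiv e W h₁ h₂ x : W) : E) = e x := rfl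

/-- Its inverse acts as `e⁻¹`. [cite: Balaban1987RG1, (2.16) p.269] -/
@[simp] theorem coe_restrictEquiv_symm (e : E ≃L[ℂ] E) (W : Submodule ℂ E) (h₁ : ∀ x ∈ W, e x ∈ W)
    (h₂ : ∀ x ∈ W, e.symm x ∈ W) (x : W) : (((restrictEquiv e W h₁ h₂).symm x : W) : E) = e.symm x := rfl

/-- An isometric `e` restricts to an isometry («orthogonal transformations» stay orthogonal on the sub-carrier). [cite: Balaban1987RG1, (2.16) p.269] -/
theorem norm_restrictEquiv (e : E ≃L[ℂ] E) (W : Submodule ℂ E) (h₁ : ∀ x ∈ W, e x ∈ W)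
    (h₂ : ∀ x ∈ W, e.symm x ∈ W) (he : ∀ x, ‖e x‖ = ‖x‖) (x : W) : ‖restrictEquiv e W h₁ h₂ x‖ = ‖x‖ := by
  rw [Submodule.coe_norm, coe_restrictEquiv, he, Submodule.coe_norm]

end restrictEquiv

section shiftZd

open B12LinearizationGenuineZd (BField)
open B12Average012Periodicity (shiftE shiftE_apply shiftE_add shiftE_zero)
open Literature.MathematicalPhysics.QuantumLattice (ZdEdge)

variable {d : ℕ} {𝔸 : Type*} [NormedAddCommGroup 𝔸] [NormedSpace ℂ 𝔸]

omit [NormedSpace ℂ 𝔸] in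
/-- the translated bounded field is bounded by the same sup [folklore] -/
private theorem memℓp_shiftE (v : Fin d → ℤ) (Y : BField d 𝔸) : Memℓp (shiftE v (⇑Y : ZdEdge d → 𝔸)) ⊤ :=
  memℓp_infty ⟨‖Y‖, by
    rintro _ ⟨b, rfl⟩
    exact lp.norm_apply_le_norm ENNReal.top_ne_zero Y _⟩

/-- (2.17) translation as a bounded linear self-map of `ℓ^∞` (auxiliary; packaged as an equivalence below). [cite: Balaban1987RG1, (2.17) p.269] -/
private noncomputable def shiftBFc (v : Fin d → ℤ) : BField d 𝔸 →L[ℂ] BField d 𝔸 :=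
  LinearMap.mkContinuous
    { toFun := fun Y => ⟨shiftE v (⇑Y : ZdEdge d → 𝔸), memℓp_shiftE v Y⟩
      map_add' := fun Y Y' => lp.ext (funext fun b => by
        simp only [lp.coeFn_add, Pi.add_apply]; rfl)
      map_smul' := fun a Y => lp.ext (funext fun b => by
        simp only [lp.coeFn_smul, Pi.smul_apply, RingHom.id_apply]; rfl) } 1
    fun Y => by
      rw [one_mul]
      exact lp.norm_le_of_forall_le (norm_nonneg _) fun b => lp.norm_apply_le_norm ENNReal.top_ne_zero Y _

/-- bondwise action of the auxiliary map [folklore] -/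
private theorem shiftBFc_apply_apply (v : Fin d → ℤ) (Y : BField d 𝔸) (b : ZdEdge d) :
    (shiftBFc v Y : ZdEdge d → 𝔸) b = Y (b.1 + v, b.2) := rfl

/-- `τ_{−v}τ_v = 1` for the auxiliary map [folklore] -/
private theorem shiftBFc_neg_comp (v : Fin d → ℤ) (Y : BField d 𝔸) : shiftBFc (-v) (shiftBFc v Y) = Y :=
  lp.ext (funext fun b => by
    show (Y : ZdEdge d → 𝔸) ((b.1 + -v) + v, b.2) = Y b
    rw [neg_add_cancel_right])

/-- **(2.17) «(rU)(b) = U(rb)» FOR TRANSLATIONS `r = τ_v` AS A CONTINUOUS LINEAR ISOMETRIC EQUIVALENCE OF `ℓ^∞`**: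
`(τ_v Y)(⟨x, μ⟩) = Y(⟨x + v, μ⟩)` on r09's carrier `BField d 𝔸 = ℓ^∞(bonds of ℤᵈ; 𝔸)` (his function-level
`B12Average012Periodicity.shiftE` underneath), inverse `τ_{−v}`. [cite: Balaban1987RG1, (2.17) p.269] -/
noncomputable def shiftBFL (v : Fin d → ℤ) : BField d 𝔸 ≃L[ℂ] BField d 𝔸 :=
  ContinuousLinearEquiv.equivOfInverse (shiftBFc v) (shiftBFc (-v)) (shiftBFc_neg_comp v)
    fun Y => by simpa using shiftBFc_neg_comp (-v) Y

/-- `⇑(τ_v Y) = shiftE v ⇑Y` (r09's translation of bond configurations). [cite: Balaban1987RG1, (2.17) p.269] -/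
theorem coe_shiftBFL (v : Fin d → ℤ) (Y : BField d 𝔸) :
    ((shiftBFL v Y : BField d 𝔸) : ZdEdge d → 𝔸) = shiftE v (⇑Y : ZdEdge d → 𝔸) := rfl

/-- Bondwise: `(τ_v Y)(⟨x, μ⟩) = Y(⟨x + v, μ⟩)`. [cite: Balaban1987RG1, (2.17) p.269] -/
theorem shiftBFL_apply_apply (v : Fin d → ℤ) (Y : BField d 𝔸) (b : ZdEdge d) :
    (shiftBFL v Y : ZdEdge d → 𝔸) b = Y (b.1 + v, b.2) := rfl

/-- `τ_v⁻¹ = τ_{−v}`. [cite: Balaban1987RG1, (2.17) p.269] -/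
theorem shiftBFL_symm_apply_apply (v : Fin d → ℤ) (Y : BField d 𝔸) (b : ZdEdge d) :
    ((shiftBFL v).symm Y : ZdEdge d → 𝔸) b = Y (b.1 + -v, b.2) := rfl

/-- `τ_0 = 1`. [cite: Balaban1987RG1, (2.17) p.269] -/
theorem shiftBFL_zero (Y : BField d 𝔸) : shiftBFL (0 : Fin d → ℤ) Y = Y :=
  lp.ext (funext fun b => by
    show (Y : ZdEdge d → 𝔸) (b.1 + 0, b.2) = Y b
    rw [add_zero])

/-- `τ_{u+v} = τ_u ∘ τ_v` (commuting translations). [cite: Balaban1987RG1, (2.17) p.269] -/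
theorem shiftBFL_add (u v : Fin d → ℤ) (Y : BField d 𝔸) : shiftBFL (u + v) Y = shiftBFL u (shiftBFL v Y) :=
  lp.ext (funext fun b => by
    show (Y : ZdEdge d → 𝔸) (b.1 + (u + v), b.2) = Y ((b.1 + u) + v, b.2)
    rw [add_assoc])

/-- **`‖τ_v Y‖ = ‖Y‖`**: translations are isometries of the sup norm («orthogonal transformations»).
[cite: Balaban1987RG1, (2.17) p.269] -/
theorem norm_shiftBFL (v : Fin d → ℤ) (Y : BField d 𝔸) : ‖shiftBFL v Y‖ = ‖Y‖ := by
  have h1 : ∀ (w : Fin d → ℤ) (Z : BField d 𝔸), ‖shiftBFL w Z‖ ≤ ‖Z‖ := fun w Z =>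
    lp.norm_le_of_forall_le (norm_nonneg _) fun b => by
      rw [shiftBFL_apply_apply]; exact lp.norm_apply_le_norm ENNReal.top_ne_zero Z _
  refine le_antisymm (h1 v Y) ?_
  have h2 := h1 (-v) (shiftBFL v Y)
  have h3 : shiftBFL (-v) (shiftBFL v Y) = Y := by rw [← shiftBFL_add, neg_add_cancel, shiftBFL_zero]
  rwa [h3] at h2

omit [NormedSpace ℂ 𝔸] in
/-- Evaluation at a bond is continuous on `ℓ^∞`. [folklore] -/
private theorem continuous_apply_BField (b : ZdEdge d) : Continuous fun Y : BField d 𝔸 => (Y : ZdEdge d → 𝔸) b :=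
  (continuous_apply b).comp (lp.uniformContinuous_coe (p := ⊤)).continuous

/-! ### (b) the `N`-periodic bond fields -/

variable (d 𝔸) in
/-- **THE PERIODIC SUB-CARRIER = PRINT'S TORUS**: the `N`-periodic bounded bond fields
`{Y : τ_{Nv}Y = Y for all v ∈ ℤᵈ}` as a `ℂ`-subspace of `ℓ^∞(bonds of ℤᵈ; 𝔸)` — the bond functions on the torus
`T` of (0.1) p. 251 with `N` sites per direction («obtained by the usual identification of boundary points of the
cube»; the relabelling to `(ℤ/Nℤ)ᵈ` is the tree's `B7AvgPeriodicity.proj` ∕ `descend` dictionary), read inside r09's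
carrier.  Intersection of the equalisers of the translations `τ_{Nv}` with the identity. [cite: Balaban1987RG1, (0.1) p.251, (2.17) p.269] -/
noncomputable def perBF (N : ℕ) : Submodule ℂ (BField d 𝔸) :=
  ⨅ v : Fin d → ℤ, LinearMap.eqLocus ((shiftBFL ((N : ℤ) • v) : BField d 𝔸 ≃L[ℂ] BField d 𝔸) : BField d 𝔸 →ₗ[ℂ] BField d 𝔸)
    LinearMap.id

/-- Membership: `Y ∈ perBF N ↔ τ_{Nv}Y = Y` for every `v ∈ ℤᵈ`. [cite: Balaban1987RG1, (0.1) p.251] -/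
theorem mem_perBF_iff_shift {N : ℕ} {Y : BField d 𝔸} :
    Y ∈ perBF d 𝔸 N ↔ ∀ v : Fin d → ℤ, shiftBFL ((N : ℤ) • v) Y = Y := by
  simp only [perBF, Submodule.mem_iInf, LinearMap.mem_eqLocus, LinearMap.id_coe, id_eq]
  rfl

/-- Membership, bondwise: `Y ∈ perBF N ↔ Y(⟨x + Nv, μ⟩) = Y(⟨x, μ⟩)` for all bonds and all `v ∈ ℤᵈ`.
[cite: Balaban1987RG1, (0.1) p.251] -/
theorem mem_perBF_iff {N : ℕ} {Y : BField d 𝔸} :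
    Y ∈ perBF d 𝔸 N ↔ ∀ (v : Fin d → ℤ) (b : ZdEdge d), (Y : ZdEdge d → 𝔸) (b.1 + (N : ℤ) • v, b.2) = Y b := by
  rw [mem_perBF_iff_shift]
  refine ⟨fun h v b => ?_, fun h v => lp.ext (funext fun b => ?_)⟩
  · have := congrArg (fun Z : BField d 𝔸 => (Z : ZdEdge d → 𝔸) b) (h v)
    simpa [shiftBFL_apply_apply] using this
  · rw [shiftBFL_apply_apply]; exact h v b

/-- **The periodic sub-carrier is CLOSED in `ℓ^∞`** (an intersection of equalisers of continuous maps) — so it is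
complete, and §9 applies to it. [cite: Balaban1987RG1, (0.1) p.251] -/
theorem isClosed_perBF (N : ℕ) : IsClosed ((perBF d 𝔸 N : Submodule ℂ (BField d 𝔸)) : Set (BField d 𝔸)) := by
  have : ((perBF d 𝔸 N : Submodule ℂ (BField d 𝔸)) : Set (BField d 𝔸)) =
      ⋂ v : Fin d → ℤ, {Y | shiftBFL ((N : ℤ) • v) Y = Y} := by
    ext Y; simp [mem_perBF_iff_shift]
  rw [this]
  exact isClosed_iInter fun v => isClosed_eq (shiftBFL ((N : ℤ) • v)).continuous continuous_id

/-- The torus carrier is COMPLETE (closed in the Banach space `ℓ^∞`) — the `[CompleteSpace 𝒳]` premise of §§8–9 on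
`perBF`. [cite: Balaban1987RG1, (0.1) p.251] -/
instance [CompleteSpace 𝔸] (N : ℕ) : CompleteSpace (perBF d 𝔸 N) :=
  (isClosed_perBF (d := d) (𝔸 := 𝔸) N).completeSpace_coe

/-- Translations preserve the periodic sub-carrier (they commute with the period translations).
[cite: Balaban1987RG1, (2.17) p.269] -/
theorem shiftBFL_mem_perBF {N : ℕ} (w : Fin d → ℤ) {Y : BField d 𝔸} (hY : Y ∈ perBF d 𝔸 N) :
    shiftBFL w Y ∈ perBF d 𝔸 N := by
  rw [mem_perBF_iff_shift] at hY ⊢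
  intro v
  rw [← shiftBFL_add, add_comm, shiftBFL_add, hY v]

/-- **The translation `τ_v` OF THE TORUS CARRIER**, `perBF N ≃L[ℂ] perBF N` (restriction of `shiftBFL v`).
[cite: Balaban1987RG1, (2.17) p.269, (0.1) p.251] -/
noncomputable def shiftBFLPer (N : ℕ) (v : Fin d → ℤ) : perBF d 𝔸 N ≃L[ℂ] perBF d 𝔸 N :=
  restrictEquiv (shiftBFL v) (perBF d 𝔸 N) (fun _ hY => shiftBFL_mem_perBF v hY) fun Y hY => by
    have : (shiftBFL v).symm Y = shiftBFL (-v) Y := lp.ext (funext fun _ => rfl)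
    rw [this]; exact shiftBFL_mem_perBF (-v) hY

/-- It acts as `τ_v`. [cite: Balaban1987RG1, (2.17) p.269] -/
theorem coe_shiftBFLPer (N : ℕ) (v : Fin d → ℤ) (Y : perBF d 𝔸 N) :
    ((shiftBFLPer N v Y : perBF d 𝔸 N) : BField d 𝔸) = shiftBFL v Y := rfl

/-- `‖τ_v Y‖ = ‖Y‖` on the torus carrier. [cite: Balaban1987RG1, (2.17) p.269] -/
theorem norm_shiftBFLPer (N : ℕ) (v : Fin d → ℤ) (Y : perBF d 𝔸 N) : ‖shiftBFLPer N v Y‖ = ‖Y‖ := by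
  rw [Submodule.coe_norm, coe_shiftBFLPer, norm_shiftBFL, Submodule.coe_norm]

/-! ### (c) finite dimension -/

/-- reduction of an integer vector to the box `[0, N)ᵈ` [folklore] -/
private def boxRed (N : ℕ) (hN : 0 < N) (x : Fin d → ℤ) : Fin d → Fin N :=
  fun i => ⟨(x i % (N : ℤ)).toNat, by
    have h0 : 0 ≤ x i % (N : ℤ) := Int.emod_nonneg _ (by exact_mod_cast hN.ne')
    have h1 : x i % (N : ℤ) < (N : ℤ) := Int.emod_lt_of_pos _ (by exact_mod_cast hN)
    omega⟩

/-- `x = box(x) + N·(x div N)` [folklore] -/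
private theorem boxRed_spec (N : ℕ) (hN : 0 < N) (x : Fin d → ℤ) :
    (fun i => ((boxRed N hN x i : ℕ) : ℤ)) + (N : ℤ) • (fun i => x i / (N : ℤ)) = x := by
  funext i
  simp only [boxRed, Pi.add_apply, Pi.smul_apply, smul_eq_mul]
  have h0 : 0 ≤ x i % (N : ℤ) := Int.emod_nonneg _ (by exact_mod_cast hN.ne')
  rw [Int.toNat_of_nonneg h0]
  have := Int.emod_def (x i) (N : ℤ)
  linarith

/-- restriction of a bond field to the bonds based in the box `[0, N)ᵈ` (a fundamental domain of the torus) [folklore] -/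
private noncomputable def boxRes (N : ℕ) : BField d 𝔸 →ₗ[ℂ] ((Fin d → Fin N) × Fin d → 𝔸) where
  toFun Y p := (Y : ZdEdge d → 𝔸) (fun i => ((p.1 i : ℕ) : ℤ), p.2)
  map_add' Y Y' := funext fun p => by simp
  map_smul' a Y := funext fun p => by simp

/-- **THE TORUS CARRIER IS FINITE-DIMENSIONAL** for a finite-dimensional structure algebra `𝔸` (`N ≥ 1`): a
periodic field is determined by its values on the `N^d·d` bonds based in the box `[0,N)ᵈ` (restriction is an
injective linear map into a finite product) — so on `perBF N` the Jacobian of (2.12) HAS a determinant and a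
«Tr log» in the ordinary sense. [cite: Balaban1987RG1, (0.1) p.251, (2.12) p.268] -/
theorem finiteDimensional_perBF [FiniteDimensional ℂ 𝔸] {N : ℕ} (hN : 0 < N) :
    FiniteDimensional ℂ (perBF d 𝔸 N) := by
  refine FiniteDimensional.of_injective ((boxRes (d := d) (𝔸 := 𝔸) N).domRestrict (perBF d 𝔸 N)) ?_
  intro Y Y' h
  have key : ∀ b : ZdEdge d, ((Y : BField d 𝔸) : ZdEdge d → 𝔸) b = ((Y' : BField d 𝔸) : ZdEdge d → 𝔸) b := by
    intro b
    -- `b.1 = box + N•q` with `box ∈ [0,N)ᵈ`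
    set box : Fin d → ℤ := fun i => ((boxRed N hN b.1 i : ℕ) : ℤ) with hbox
    set q : Fin d → ℤ := fun i => b.1 i / (N : ℤ) with hq
    have hsplit : box + (N : ℤ) • q = b.1 := boxRed_spec N hN b.1
    have hY : ((Y : BField d 𝔸) : ZdEdge d → 𝔸) (box + (N : ℤ) • q, b.2) = ((Y : BField d 𝔸) : ZdEdge d → 𝔸) (box, b.2) :=
      (mem_perBF_iff.1 Y.2) q (box, b.2)
    have hY' : ((Y' : BField d 𝔸) : ZdEdge d → 𝔸) (box + (N : ℤ) • q, b.2) = ((Y' : BField d 𝔸) : ZdEdge d → 𝔸) (box, b.2) :=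
      (mem_perBF_iff.1 Y'.2) q (box, b.2)
    have hres : ((Y : BField d 𝔸) : ZdEdge d → 𝔸) (box, b.2) = ((Y' : BField d 𝔸) : ZdEdge d → 𝔸) (box, b.2) :=
      congrFun h (boxRed N hN b.1, b.2)
    have hb : (box + (N : ℤ) • q, b.2) = b := Prod.ext hsplit rfl
    rw [hb] at hY hY'
    exact hY.trans (hres.trans hY'.symm)
  exact Subtype.ext (lp.ext (funext key))

/-- NON-VACUITY: constant bond fields lie on every torus carrier, and for `𝔸 = ℂ` the torus carrier IS
finite-dimensional (`finiteDimensional_perBF`). [cite: Balaban1987RG1, (0.1) p.251] -/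
example (a : 𝔸) (N : ℕ) :
    (⟨fun _ => a, memℓp_infty ⟨‖a‖, by rintro _ ⟨b, rfl⟩; exact le_rfl⟩⟩ : BField d 𝔸) ∈ perBF d 𝔸 N :=
  mem_perBF_iff.2 fun _ _ => rfl

example : FiniteDimensional ℂ (perBF 4 ℂ 3) := finiteDimensional_perBF (by norm_num)

end shiftZd

section rotPer

open B12LinearizationGenuineZd (BField)
open B12Average012Periodicity (shiftE blockBase_add)
open B12Def267Covariance (rotBF coe_rotBF norm_rotBF)
open B7Prop1Explicit (U1)
open Literature.MathematicalPhysics.QuantumLattice (ZdEdge blockBase)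

variable {d : ℕ} {𝔸 : Type*} [NormedRing 𝔸] [NormedAlgebra ℂ 𝔸] [NormOneClass 𝔸] {L : ℕ}

/-- **(2.16) PRESERVES THE TORUS CARRIER**: for an `N`-periodic gauge function `w` (`w(z + Nv) = w(z)`, i.e. a
gauge transformation OF THE TORUS), `R(w)` maps `N`-periodic bond fields to `N`-periodic bond fields.
[cite: Balaban1987RG1, (2.16) p.269, (0.1) p.251] -/
theorem rotBFL_mem_perBF {N : ℕ} {w : (Fin d → ℤ) → 𝔸ˣ} (hw : ∀ z, w z ∈ U1 𝔸)
    (hper : ∀ (z v : Fin d → ℤ), w (z + (N : ℤ) • v) = w z) {Y : BField d 𝔸} (hY : Y ∈ perBF d 𝔸 N) :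
    rotBFL w hw Y ∈ perBF d 𝔸 N := by
  rw [mem_perBF_iff] at hY ⊢
  intro v b
  rw [rotBFL_apply_apply, rotBFL_apply_apply, hper, hY v b]

/-- … and so does `R(w)⁻¹ = R(w⁻¹)`. [cite: Balaban1987RG1, (2.16) p.269] -/
theorem rotBFL_symm_mem_perBF {N : ℕ} {w : (Fin d → ℤ) → 𝔸ˣ} (hw : ∀ z, w z ∈ U1 𝔸)
    (hper : ∀ (z v : Fin d → ℤ), w (z + (N : ℤ) • v) = w z) {Y : BField d 𝔸} (hY : Y ∈ perBF d 𝔸 N) :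
    (rotBFL w hw).symm Y ∈ perBF d 𝔸 N := by
  rw [rotBFL_symm_apply]
  have hper' : ∀ (z v : Fin d → ℤ), w⁻¹ (z + (N : ℤ) • v) = w⁻¹ z := fun z v => by
    simp only [Pi.inv_apply, hper]
  exact rotBFL_mem_perBF (fun z => (U1 𝔸).inv_mem (hw z)) hper' hY

omit [NormedAlgebra ℂ 𝔸] [NormOneClass 𝔸] in
/-- An `LN`-periodic gauge function of the fine lattice read on the coarse lattice through the block map,
`y ↦ w(L·y)` (the `V` of §7 (b)), is `N`-periodic (`blockBase L (y + Nv) = blockBase L y + LNv`, r09's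
`blockBase_add`). [cite: Balaban1987RG1, (2.16) p.269, (0.1) p.251] -/
theorem blockBase_periodic {N : ℕ} {w : (Fin d → ℤ) → 𝔸ˣ}
    (hper : ∀ (z v : Fin d → ℤ), w (z + ((L * N : ℕ) : ℤ) • v) = w z) (y v : Fin d → ℤ) :
    w (blockBase L (y + (N : ℤ) • v)) = w (blockBase L y) := by
  rw [blockBase_add]
  have : (L : ℤ) • ((N : ℤ) • v) = ((L * N : ℕ) : ℤ) • v := by
    rw [smul_smul]; norm_cast
  rw [this, hper]

/-- **THE (2.16) MAP OF THE TORUS CARRIER**: `R(w)` restricted to the `N`-periodic fields, a continuous linear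
equivalence `perBF N ≃L[ℂ] perBF N` (for `N`-periodic `w`). [cite: Balaban1987RG1, (2.16) p.269, (0.1) p.251] -/
noncomputable def rotBFLPer (N : ℕ) (w : (Fin d → ℤ) → 𝔸ˣ) (hw : ∀ z, w z ∈ U1 𝔸)
    (hper : ∀ (z v : Fin d → ℤ), w (z + (N : ℤ) • v) = w z) : perBF d 𝔸 N ≃L[ℂ] perBF d 𝔸 N :=
  restrictEquiv (rotBFL w hw) (perBF d 𝔸 N) (fun _ hY => rotBFL_mem_perBF hw hper hY)
    fun _ hY => rotBFL_symm_mem_perBF hw hper hY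

/-- It acts as `R(w)`. [cite: Balaban1987RG1, (2.16) p.269] -/
theorem coe_rotBFLPer (N : ℕ) (w : (Fin d → ℤ) → 𝔸ˣ) (hw : ∀ z, w z ∈ U1 𝔸)
    (hper : ∀ (z v : Fin d → ℤ), w (z + (N : ℤ) • v) = w z) (Y : perBF d 𝔸 N) :
    ((rotBFLPer N w hw hper Y : perBF d 𝔸 N) : BField d 𝔸) = rotBFL w hw Y := rfl

/-- **and it is an ISOMETRY of the torus carrier** (the binder `hU` ∕ `hV` of §8 on `perBF`).
[cite: Balaban1987RG1, (2.16) p.269] -/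
theorem norm_rotBFLPer (N : ℕ) (w : (Fin d → ℤ) → 𝔸ˣ) (hw : ∀ z, w z ∈ U1 𝔸)
    (hper : ∀ (z v : Fin d → ℤ), w (z + (N : ℤ) • v) = w z) (Y : perBF d 𝔸 N) :
    ‖rotBFLPer N w hw hper Y‖ = ‖Y‖ := by
  rw [Submodule.coe_norm, coe_rotBFLPer, norm_rotBFL, Submodule.coe_norm]

end rotPer

/-! ### (e) ASSEMBLY: the two-system scheme RESTRICTED to invariant sub-carriers, and the torus instance -/

section subGauge

variable {𝒳 𝒴 : Type*} [NormedAddCommGroup 𝒳] [NormedSpace ℂ 𝒳] [CompleteSpace 𝒳]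
  [NormedAddCommGroup 𝒴] [NormedSpace ℂ 𝒴]
  {hop hop' : 𝒳 →ₗ[ℂ] 𝒴} {Ct Ct' : 𝒴 → 𝒳} {C₂ R b ε : ℝ} {V : 𝒳 ≃L[ℂ] 𝒳} {U : 𝒴 ≃L[ℂ] 𝒴}
  {W𝒳 : Submodule ℂ 𝒳} {W𝒴 : Submodule ℂ 𝒴}

omit [CompleteSpace 𝒳] in
/-- The covariance binder `h′(VX) = U(hX)` RESTRICTS to the sub-carrier systems. [cite: Balaban1987RG1, p.267, (2.16) p.269] -/
theorem hop_restrict_conj (hhop : ∀ X, hop' (V X) = U (hop X))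
    (hhopW : ∀ X ∈ W𝒳, hop X ∈ W𝒴) (hhopW' : ∀ X ∈ W𝒳, hop' X ∈ W𝒴)
    (hVW : ∀ X ∈ W𝒳, V X ∈ W𝒳) (hVW' : ∀ X ∈ W𝒳, V.symm X ∈ W𝒳)
    (hUW : ∀ Y ∈ W𝒴, U Y ∈ W𝒴) (hUW' : ∀ Y ∈ W𝒴, U.symm Y ∈ W𝒴) (X : W𝒳) :
    hop'.restrict hhopW' (restrictEquiv V W𝒳 hVW hVW' X) = restrictEquiv U W𝒴 hUW hUW' (hop.restrict hhopW X) :=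
  Subtype.ext (by simp [LinearMap.coe_restrict_apply, hhop])

omit [CompleteSpace 𝒳] in
/-- The covariance binder `C̃′(UY) = V(C̃Y)` RESTRICTS to the sub-carrier systems. [cite: Balaban1987RG1, p.267, (2.16) p.269] -/
theorem Ct_restrict_conj (hCt : ∀ Y : 𝒴, ‖Y‖ < R → Ct' (U Y) = V (Ct Y))
    (hCtW : ∀ Y ∈ W𝒴, Ct Y ∈ W𝒳) (hCtW' : ∀ Y ∈ W𝒴, Ct' Y ∈ W𝒳)
    (hVW : ∀ X ∈ W𝒳, V X ∈ W𝒳) (hVW' : ∀ X ∈ W𝒳, V.symm X ∈ W𝒳)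
    (hUW : ∀ Y ∈ W𝒴, U Y ∈ W𝒴) (hUW' : ∀ Y ∈ W𝒴, U.symm Y ∈ W𝒴) (Y : W𝒴) (hY : ‖Y‖ < R) :
    (⟨Ct' ((restrictEquiv U W𝒴 hUW hUW' Y : W𝒴) : 𝒴), hCtW' _ (restrictEquiv U W𝒴 hUW hUW' Y).2⟩ : W𝒳) =
      restrictEquiv V W𝒳 hVW hVW' ⟨Ct Y, hCtW Y Y.2⟩ :=
  Subtype.ext (by simpa using hCt (Y : 𝒴) (by simpa [Submodule.coe_norm] using hY))

/-- **`D̃_W′(UB) = VD̃_W(B)` ON THE SUB-CARRIER**: for two systems `(h, C̃)` at `U_{k+1}` and `(h′, C̃′)` at `U^u_{k+1}`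
on one carrier pair, (2.16)-covariant (`h′V = Uh`, `C̃′U = VC̃`, `U`, `V` isometric equivalences — binders) and
preserving a closed invariant sub-carrier pair `W𝒳`, `W𝒴` also preserved by `U^{±1}`, `V^{±1}` (binders), ANY
solutions `D̃_W`, `D̃_W′ : W𝒴 → W𝒳` of the restricted p. 267 equations in the ball (they exist and are the ambient
`D̃`'s: §9 `exists_Dt_subcarrier`) are intertwined by the RESTRICTED (2.16) maps — §8 `Dt_gauge₂` for the
sub-carrier systems (`quadAnalytic_subcarrier`, `norm_hop_restrict_le`, `norm_restrictEquiv`).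
[cite: Balaban1987RG1, p.267, (2.16) p.269, (0.1) p.251] -/
theorem Dt_gauge_sub (hC : QuadAnalytic Ct C₂ R) (hC' : QuadAnalytic Ct' C₂ R) (hC₂ : 0 ≤ C₂) (hb : 0 ≤ b)
    (hHop : ∀ X, ‖hop X‖ ≤ b * ‖X‖) (hHop' : ∀ X, ‖hop' X‖ ≤ b * ‖X‖) (hq : 9 * C₂ * b * ε < 1)
    (hRC : 3 * ε ≤ R) (hU : ∀ Y, ‖U Y‖ = ‖Y‖) (hV : ∀ X, ‖V X‖ = ‖X‖)
    (hhop : ∀ X, hop' (V X) = U (hop X)) (hCt : ∀ Y : 𝒴, ‖Y‖ < R → Ct' (U Y) = V (Ct Y))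
    (hW𝒳 : IsClosed (W𝒳 : Set 𝒳))
    (hhopW : ∀ X ∈ W𝒳, hop X ∈ W𝒴) (hCtW : ∀ Y ∈ W𝒴, Ct Y ∈ W𝒳)
    (hhopW' : ∀ X ∈ W𝒳, hop' X ∈ W𝒴) (hCtW' : ∀ Y ∈ W𝒴, Ct' Y ∈ W𝒳)
    (hVW : ∀ X ∈ W𝒳, V X ∈ W𝒳) (hVW' : ∀ X ∈ W𝒳, V.symm X ∈ W𝒳)
    (hUW : ∀ Y ∈ W𝒴, U Y ∈ W𝒴) (hUW' : ∀ Y ∈ W𝒴, U.symm Y ∈ W𝒴)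
    {DtW DtW' : W𝒴 → W𝒳}
    (hDWball : ∀ B : W𝒴, ‖B‖ < ε → DtW B ∈ closedBall (0:W𝒳) (4 * C₂ * ε ^ 2))
    (hDWfix : ∀ B : W𝒴, ‖B‖ < ε →
      (⟨Ct (B - hop.restrict hhopW (DtW B) : W𝒴), hCtW _ (B - hop.restrict hhopW (DtW B)).2⟩ : W𝒳) = DtW B)
    (hDWball' : ∀ B : W𝒴, ‖B‖ < ε → DtW' B ∈ closedBall (0:W𝒳) (4 * C₂ * ε ^ 2))
    (hDWfix' : ∀ B : W𝒴, ‖B‖ < ε →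
      (⟨Ct' (B - hop'.restrict hhopW' (DtW' B) : W𝒴), hCtW' _ (B - hop'.restrict hhopW' (DtW' B)).2⟩ : W𝒳) = DtW' B)
    {B : W𝒴} (hB : ‖B‖ < ε) :
    DtW' (restrictEquiv U W𝒴 hUW hUW' B) = restrictEquiv V W𝒳 hVW hVW' (DtW B) := by
  haveI : CompleteSpace W𝒳 := hW𝒳.completeSpace_coe
  exact Dt_gauge₂ (V := restrictEquiv V W𝒳 hVW hVW') (U := restrictEquiv U W𝒴 hUW hUW')
    (quadAnalytic_subcarrier (W𝒴 := W𝒴) hC hW𝒳 hCtW) (quadAnalytic_subcarrier (W𝒴 := W𝒴) hC' hW𝒳 hCtW') hC₂ hb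
    (norm_hop_restrict_le hHop hhopW) (norm_hop_restrict_le hHop' hhopW') hq hRC hDWball hDWfix hDWball' hDWfix'
    (norm_restrictEquiv U W𝒴 hUW hUW' hU) (norm_restrictEquiv V W𝒳 hVW hVW' hV)
    (hop_restrict_conj hhop hhopW hhopW' hVW hVW' hUW hUW')
    (fun Y hY => Ct_restrict_conj hCt hCtW hCtW' hVW hVW' hUW hUW' Y hY) hB

/-- **`Φ_W′(UB) = UΦ_W(B)` on the sub-carrier.** [cite: Balaban1987RG1, p.267, (2.16) p.269] -/
theorem phi_gauge_sub (hC : QuadAnalytic Ct C₂ R) (hC' : QuadAnalytic Ct' C₂ R) (hC₂ : 0 ≤ C₂) (hb : 0 ≤ b)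
    (hHop : ∀ X, ‖hop X‖ ≤ b * ‖X‖) (hHop' : ∀ X, ‖hop' X‖ ≤ b * ‖X‖) (hq : 9 * C₂ * b * ε < 1)
    (hRC : 3 * ε ≤ R) (hU : ∀ Y, ‖U Y‖ = ‖Y‖) (hV : ∀ X, ‖V X‖ = ‖X‖)
    (hhop : ∀ X, hop' (V X) = U (hop X)) (hCt : ∀ Y : 𝒴, ‖Y‖ < R → Ct' (U Y) = V (Ct Y))
    (hW𝒳 : IsClosed (W𝒳 : Set 𝒳))
    (hhopW : ∀ X ∈ W𝒳, hop X ∈ W𝒴) (hCtW : ∀ Y ∈ W𝒴, Ct Y ∈ W𝒳)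
    (hhopW' : ∀ X ∈ W𝒳, hop' X ∈ W𝒴) (hCtW' : ∀ Y ∈ W𝒴, Ct' Y ∈ W𝒳)
    (hVW : ∀ X ∈ W𝒳, V X ∈ W𝒳) (hVW' : ∀ X ∈ W𝒳, V.symm X ∈ W𝒳)
    (hUW : ∀ Y ∈ W𝒴, U Y ∈ W𝒴) (hUW' : ∀ Y ∈ W𝒴, U.symm Y ∈ W𝒴)
    {DtW DtW' : W𝒴 → W𝒳}
    (hDWball : ∀ B : W𝒴, ‖B‖ < ε → DtW B ∈ closedBall (0:W𝒳) (4 * C₂ * ε ^ 2))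
    (hDWfix : ∀ B : W𝒴, ‖B‖ < ε →
      (⟨Ct (B - hop.restrict hhopW (DtW B) : W𝒴), hCtW _ (B - hop.restrict hhopW (DtW B)).2⟩ : W𝒳) = DtW B)
    (hDWball' : ∀ B : W𝒴, ‖B‖ < ε → DtW' B ∈ closedBall (0:W𝒳) (4 * C₂ * ε ^ 2))
    (hDWfix' : ∀ B : W𝒴, ‖B‖ < ε →
      (⟨Ct' (B - hop'.restrict hhopW' (DtW' B) : W𝒴), hCtW' _ (B - hop'.restrict hhopW' (DtW' B)).2⟩ : W𝒳) = DtW' B)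
    {B : W𝒴} (hB : ‖B‖ < ε) :
    restrictEquiv U W𝒴 hUW hUW' B - hop'.restrict hhopW' (DtW' (restrictEquiv U W𝒴 hUW hUW' B)) =
      restrictEquiv U W𝒴 hUW hUW' (B - hop.restrict hhopW (DtW B)) := by
  haveI : CompleteSpace W𝒳 := hW𝒳.completeSpace_coe
  exact phi_gauge₂ (V := restrictEquiv V W𝒳 hVW hVW') (U := restrictEquiv U W𝒴 hUW hUW')
    (quadAnalytic_subcarrier (W𝒴 := W𝒴) hC hW𝒳 hCtW) (quadAnalytic_subcarrier (W𝒴 := W𝒴) hC' hW𝒳 hCtW') hC₂ hb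
    (norm_hop_restrict_le hHop hhopW) (norm_hop_restrict_le hHop' hhopW') hq hRC hDWball hDWfix hDWball' hDWfix'
    (norm_restrictEquiv U W𝒴 hUW hUW' hU) (norm_restrictEquiv V W𝒳 hVW hVW' hV)
    (hop_restrict_conj hhop hhopW hhopW' hVW hVW' hUW hUW')
    (fun Y hY => Ct_restrict_conj hCt hCtW hCtW' hVW hVW' hUW hUW' Y hY) hB

/-- **`det_{W𝒴} DΦ_W′(UB₀) = det_{W𝒴} DΦ_W(B₀)` — THE JACOBIAN DETERMINANT OF (2.12) ON AN INVARIANT SUB-CARRIER IS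
(2.16)-INVARIANT** (no analyticity binder; a genuine determinant as soon as `W𝒴` is finite-dimensional, e.g. the
torus carrier `perBF` below): §8 `det_fderiv_phi_gauge₂` for the restricted systems. [cite: Balaban1987RG1, (2.12) p.268, (2.16) p.269, (0.1) p.251] -/
theorem det_fderiv_phi_gauge_sub (hC : QuadAnalytic Ct C₂ R) (hC' : QuadAnalytic Ct' C₂ R) (hC₂ : 0 ≤ C₂)
    (hb : 0 ≤ b) (hHop : ∀ X, ‖hop X‖ ≤ b * ‖X‖) (hHop' : ∀ X, ‖hop' X‖ ≤ b * ‖X‖) (hq : 9 * C₂ * b * ε < 1)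
    (hRC : 3 * ε ≤ R) (hU : ∀ Y, ‖U Y‖ = ‖Y‖) (hV : ∀ X, ‖V X‖ = ‖X‖)
    (hhop : ∀ X, hop' (V X) = U (hop X)) (hCt : ∀ Y : 𝒴, ‖Y‖ < R → Ct' (U Y) = V (Ct Y))
    (hW𝒳 : IsClosed (W𝒳 : Set 𝒳))
    (hhopW : ∀ X ∈ W𝒳, hop X ∈ W𝒴) (hCtW : ∀ Y ∈ W𝒴, Ct Y ∈ W𝒳)
    (hhopW' : ∀ X ∈ W𝒳, hop' X ∈ W𝒴) (hCtW' : ∀ Y ∈ W𝒴, Ct' Y ∈ W𝒳)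
    (hVW : ∀ X ∈ W𝒳, V X ∈ W𝒳) (hVW' : ∀ X ∈ W𝒳, V.symm X ∈ W𝒳)
    (hUW : ∀ Y ∈ W𝒴, U Y ∈ W𝒴) (hUW' : ∀ Y ∈ W𝒴, U.symm Y ∈ W𝒴)
    {DtW DtW' : W𝒴 → W𝒳}
    (hDWball : ∀ B : W𝒴, ‖B‖ < ε → DtW B ∈ closedBall (0:W𝒳) (4 * C₂ * ε ^ 2))
    (hDWfix : ∀ B : W𝒴, ‖B‖ < ε →
      (⟨Ct (B - hop.restrict hhopW (DtW B) : W𝒴), hCtW _ (B - hop.restrict hhopW (DtW B)).2⟩ : W𝒳) = DtW B)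
    (hDWball' : ∀ B : W𝒴, ‖B‖ < ε → DtW' B ∈ closedBall (0:W𝒳) (4 * C₂ * ε ^ 2))
    (hDWfix' : ∀ B : W𝒴, ‖B‖ < ε →
      (⟨Ct' (B - hop'.restrict hhopW' (DtW' B) : W𝒴), hCtW' _ (B - hop'.restrict hhopW' (DtW' B)).2⟩ : W𝒳) = DtW' B)
    {B₀ : W𝒴} (hB₀ : ‖B₀‖ < ε) :
    LinearMap.det ((fderiv ℂ (fun B : W𝒴 => B - hop'.restrict hhopW' (DtW' B)) (restrictEquiv U W𝒴 hUW hUW' B₀) :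
        W𝒴 →L[ℂ] W𝒴) : W𝒴 →ₗ[ℂ] W𝒴) =
      LinearMap.det ((fderiv ℂ (fun B : W𝒴 => B - hop.restrict hhopW (DtW B)) B₀ : W𝒴 →L[ℂ] W𝒴) :
        W𝒴 →ₗ[ℂ] W𝒴) := by
  haveI : CompleteSpace W𝒳 := hW𝒳.completeSpace_coe
  exact det_fderiv_phi_gauge₂ (V := restrictEquiv V W𝒳 hVW hVW') (U := restrictEquiv U W𝒴 hUW hUW')
    (quadAnalytic_subcarrier (W𝒴 := W𝒴) hC hW𝒳 hCtW) (quadAnalytic_subcarrier (W𝒴 := W𝒴) hC' hW𝒳 hCtW') hC₂ hb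
    (norm_hop_restrict_le hHop hhopW) (norm_hop_restrict_le hHop' hhopW') hq hRC hDWball hDWfix hDWball' hDWfix'
    (norm_restrictEquiv U W𝒴 hUW hUW' hU) (norm_restrictEquiv V W𝒳 hVW hVW' hV)
    (hop_restrict_conj hhop hhopW hhopW' hVW hVW' hUW hUW')
    (fun Y hY => Ct_restrict_conj hCt hCtW hCtW' hVW hVW' hUW hUW' Y hY) hB₀

/-- **`Tr_{W𝒴} log DΦ_W′(UB₀) = Tr_{W𝒴} log DΦ_W(B₀)` on an invariant sub-carrier** — the «Tr log» term of (2.12)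
read on the sub-carrier, (2.16)-invariant — under the additional binders that the RESTRICTED `C̃`, `C̃′` are
Fréchet-analytic on the sub-carrier ball (on a finite-dimensional sub-carrier this is a Hartogs-type consequence of
`QuadAnalytic`, not formalised here) and `9C₂bε ≤ 1/2`: §8 `trace_logJacobian_gauge₂`. [cite: Balaban1987RG1, (2.12) p.268, (2.16) p.269, (0.1) p.251] -/
theorem trace_logJacobian_gauge_sub [CompleteSpace 𝒴] (hC : QuadAnalytic Ct C₂ R) (hC' : QuadAnalytic Ct' C₂ R)
    (hC₂ : 0 ≤ C₂) (hb : 0 ≤ b) (hHop : ∀ X, ‖hop X‖ ≤ b * ‖X‖) (hHop' : ∀ X, ‖hop' X‖ ≤ b * ‖X‖)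
    (hq2 : 9 * C₂ * b * ε ≤ 1 / 2) (hRC : 3 * ε ≤ R) (hU : ∀ Y, ‖U Y‖ = ‖Y‖) (hV : ∀ X, ‖V X‖ = ‖X‖)
    (hhop : ∀ X, hop' (V X) = U (hop X)) (hCt : ∀ Y : 𝒴, ‖Y‖ < R → Ct' (U Y) = V (Ct Y))
    (hW𝒳 : IsClosed (W𝒳 : Set 𝒳)) (hW𝒴 : IsClosed (W𝒴 : Set 𝒴))
    (hhopW : ∀ X ∈ W𝒳, hop X ∈ W𝒴) (hCtW : ∀ Y ∈ W𝒴, Ct Y ∈ W𝒳)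
    (hhopW' : ∀ X ∈ W𝒳, hop' X ∈ W𝒴) (hCtW' : ∀ Y ∈ W𝒴, Ct' Y ∈ W𝒳)
    (hCaW : AnalyticOnNhd ℂ (fun Y : W𝒴 => (⟨Ct Y, hCtW Y Y.2⟩ : W𝒳)) {Y : W𝒴 | ‖Y‖ < R})
    (hCaW' : AnalyticOnNhd ℂ (fun Y : W𝒴 => (⟨Ct' Y, hCtW' Y Y.2⟩ : W𝒳)) {Y : W𝒴 | ‖Y‖ < R})
    (hVW : ∀ X ∈ W𝒳, V X ∈ W𝒳) (hVW' : ∀ X ∈ W𝒳, V.symm X ∈ W𝒳)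
    (hUW : ∀ Y ∈ W𝒴, U Y ∈ W𝒴) (hUW' : ∀ Y ∈ W𝒴, U.symm Y ∈ W𝒴)
    {DtW DtW' : W𝒴 → W𝒳}
    (hDWball : ∀ B : W𝒴, ‖B‖ < ε → DtW B ∈ closedBall (0:W𝒳) (4 * C₂ * ε ^ 2))
    (hDWfix : ∀ B : W𝒴, ‖B‖ < ε →
      (⟨Ct (B - hop.restrict hhopW (DtW B) : W𝒴), hCtW _ (B - hop.restrict hhopW (DtW B)).2⟩ : W𝒳) = DtW B)
    (hDWball' : ∀ B : W𝒴, ‖B‖ < ε → DtW' B ∈ closedBall (0:W𝒳) (4 * C₂ * ε ^ 2))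
    (hDWfix' : ∀ B : W𝒴, ‖B‖ < ε →
      (⟨Ct' (B - hop'.restrict hhopW' (DtW' B) : W𝒴), hCtW' _ (B - hop'.restrict hhopW' (DtW' B)).2⟩ : W𝒳) = DtW' B)
    {B₀ : W𝒴} (hB₀ : ‖B₀‖ < ε) :
    LinearMap.trace ℂ W𝒴 ((mlog (1 - (hop'.restrict hhopW').mkContinuous b (norm_hop_restrict_le hHop' hhopW') ∘L
        fderiv ℂ DtW' (restrictEquiv U W𝒴 hUW hUW' B₀)) : W𝒴 →L[ℂ] W𝒴) : W𝒴 →ₗ[ℂ] W𝒴) =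
      LinearMap.trace ℂ W𝒴 ((mlog (1 - (hop.restrict hhopW).mkContinuous b (norm_hop_restrict_le hHop hhopW) ∘L
        fderiv ℂ DtW B₀) : W𝒴 →L[ℂ] W𝒴) : W𝒴 →ₗ[ℂ] W𝒴) := by
  haveI : CompleteSpace W𝒳 := hW𝒳.completeSpace_coe
  haveI : CompleteSpace W𝒴 := hW𝒴.completeSpace_coe
  exact trace_logJacobian_gauge₂ (V := restrictEquiv V W𝒳 hVW hVW') (U := restrictEquiv U W𝒴 hUW hUW')
    (quadAnalytic_subcarrier (W𝒴 := W𝒴) hC hW𝒳 hCtW) hCaW (quadAnalytic_subcarrier (W𝒴 := W𝒴) hC' hW𝒳 hCtW')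
    hCaW' hC₂ hb (norm_hop_restrict_le hHop hhopW) (norm_hop_restrict_le hHop' hhopW') hq2 hRC hDWball hDWfix
    hDWball' hDWfix' (norm_restrictEquiv U W𝒴 hUW hUW' hU) (norm_restrictEquiv V W𝒳 hVW hVW' hV)
    (hop_restrict_conj hhop hhopW hhopW' hVW hVW' hUW hUW')
    (fun Y hY => Ct_restrict_conj hCt hCtW hCtW' hVW hVW' hUW hUW' Y hY) hB₀

end subGauge

section torusGauge

open B12LinearizationGenuineZd (BField)
open B7Prop1Explicit (U1)
open Literature.MathematicalPhysics.QuantumLattice (ZdEdge blockBase)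

variable {d : ℕ} {𝔸 : Type*} [NormedRing 𝔸] [NormedAlgebra ℂ 𝔸] [NormOneClass 𝔸] [CompleteSpace 𝔸] {L : ℕ}
  {hop hop' : BField d 𝔸 →ₗ[ℂ] BField d 𝔸} {Ct Ct' : BField d 𝔸 → BField d 𝔸} {C₂ R b ε : ℝ}
  {u : (Fin d → ℤ) → 𝔸ˣ} (hu : ∀ z, u z ∈ U1 𝔸) {N : ℕ}

/-- **(2.12)'s JACOBIAN DETERMINANT ON PRINT'S TORUS IS (2.16)-INVARIANT** — `det_fderiv_phi_gauge_sub` AT the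
periodic sub-carriers of r09's `ℓ^∞(ℤᵈ)`: fine fields `perBF (L·N)` (bonds of `T⁽ᵏ⁾`, period `LN`), coarse fields
`perBF N` (bonds of `T⁽ᵏ⁺¹⁾`, period `N`), the (2.16) maps `U = R(u)`, `V = R(u(L·))` for an `LN`-periodic gauge
function `u` of the torus (`rotBFL_mem_perBF`, `blockBase_periodic`).  Binders: the letters `h, C̃` (at `U_{k+1}`)
and `h′, C̃′` (at `U^u_{k+1}`) with their constants, their (2.16) covariance, and their STABILITY on the periodic
sub-carriers (= translation covariance at an `LN`-periodic background); `D̃_W`, `D̃_W′` any solutions of the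
restricted equations (exist by §9).  For finite-dimensional `𝔸` the carrier `perBF (L·N)` is finite-dimensional
(`finiteDimensional_perBF`), so this `det` is the ordinary one. [cite: Balaban1987RG1, (2.12) p.268, (2.16) p.269, (0.1) p.251] -/
theorem det_fderiv_phi_gauge_per (hC : QuadAnalytic Ct C₂ R) (hC' : QuadAnalytic Ct' C₂ R) (hC₂ : 0 ≤ C₂)
    (hb : 0 ≤ b) (hHop : ∀ X, ‖hop X‖ ≤ b * ‖X‖) (hHop' : ∀ X, ‖hop' X‖ ≤ b * ‖X‖) (hq : 9 * C₂ * b * ε < 1)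
    (hRC : 3 * ε ≤ R)
    (hhop : ∀ X, hop' (rotBFL (fun y => u (blockBase L y)) (fun _ => hu _) X) = rotBFL u hu (hop X))
    (hCt : ∀ Y : BField d 𝔸, ‖Y‖ < R → Ct' (rotBFL u hu Y) = rotBFL (fun y => u (blockBase L y)) (fun _ => hu _) (Ct Y))
    (hper : ∀ (z v : Fin d → ℤ), u (z + ((L * N : ℕ) : ℤ) • v) = u z)
    (hhopW : ∀ X ∈ perBF d 𝔸 N, hop X ∈ perBF d 𝔸 (L * N)) (hCtW : ∀ Y ∈ perBF d 𝔸 (L * N), Ct Y ∈ perBF d 𝔸 N)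
    (hhopW' : ∀ X ∈ perBF d 𝔸 N, hop' X ∈ perBF d 𝔸 (L * N)) (hCtW' : ∀ Y ∈ perBF d 𝔸 (L * N), Ct' Y ∈ perBF d 𝔸 N)
    {DtW DtW' : perBF d 𝔸 (L * N) → perBF d 𝔸 N}
    (hDWball : ∀ B : perBF d 𝔸 (L * N), ‖B‖ < ε → DtW B ∈ closedBall (0 : perBF d 𝔸 N) (4 * C₂ * ε ^ 2))
    (hDWfix : ∀ B : perBF d 𝔸 (L * N), ‖B‖ < ε →
      (⟨Ct (B - hop.restrict hhopW (DtW B) : perBF d 𝔸 (L * N)), hCtW _ (B - hop.restrict hhopW (DtW B)).2⟩ :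
        perBF d 𝔸 N) = DtW B)
    (hDWball' : ∀ B : perBF d 𝔸 (L * N), ‖B‖ < ε → DtW' B ∈ closedBall (0 : perBF d 𝔸 N) (4 * C₂ * ε ^ 2))
    (hDWfix' : ∀ B : perBF d 𝔸 (L * N), ‖B‖ < ε →
      (⟨Ct' (B - hop'.restrict hhopW' (DtW' B) : perBF d 𝔸 (L * N)), hCtW' _ (B - hop'.restrict hhopW' (DtW' B)).2⟩ :
        perBF d 𝔸 N) = DtW' B)
    {B₀ : perBF d 𝔸 (L * N)} (hB₀ : ‖B₀‖ < ε) :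
    LinearMap.det ((fderiv ℂ (fun B : perBF d 𝔸 (L * N) => B - hop'.restrict hhopW' (DtW' B))
        (rotBFLPer (L * N) u hu hper B₀) : perBF d 𝔸 (L * N) →L[ℂ] perBF d 𝔸 (L * N)) :
          perBF d 𝔸 (L * N) →ₗ[ℂ] perBF d 𝔸 (L * N)) =
      LinearMap.det ((fderiv ℂ (fun B : perBF d 𝔸 (L * N) => B - hop.restrict hhopW (DtW B)) B₀ :
        perBF d 𝔸 (L * N) →L[ℂ] perBF d 𝔸 (L * N)) : perBF d 𝔸 (L * N) →ₗ[ℂ] perBF d 𝔸 (L * N)) :=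
  det_fderiv_phi_gauge_sub (W𝒳 := perBF d 𝔸 N) (W𝒴 := perBF d 𝔸 (L * N))
    (V := rotBFL (fun y => u (blockBase L y)) (fun _ => hu _)) (U := rotBFL u hu) hC hC' hC₂ hb hHop hHop' hq hRC
    (norm_rotBFL u hu) (norm_rotBFL (fun y => u (blockBase L y)) (fun _ => hu _)) hhop hCt (isClosed_perBF N)
    hhopW hCtW hhopW' hCtW'
    (fun _ hX => rotBFL_mem_perBF (fun _ => hu _) (blockBase_periodic hper) hX)
    (fun _ hX => rotBFL_symm_mem_perBF (fun _ => hu _) (blockBase_periodic hper) hX)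
    (fun _ hY => rotBFL_mem_perBF hu hper hY) (fun _ hY => rotBFL_symm_mem_perBF hu hper hY)
    hDWball hDWfix hDWball' hDWfix' hB₀

/-- **`D̃_W′(R(u)B) = R(u(L·))D̃_W(B)` on the torus carrier** (same binders). [cite: Balaban1987RG1, p.267, (2.16) p.269, (0.1) p.251] -/
theorem Dt_gauge_per (hC : QuadAnalytic Ct C₂ R) (hC' : QuadAnalytic Ct' C₂ R) (hC₂ : 0 ≤ C₂)
    (hb : 0 ≤ b) (hHop : ∀ X, ‖hop X‖ ≤ b * ‖X‖) (hHop' : ∀ X, ‖hop' X‖ ≤ b * ‖X‖) (hq : 9 * C₂ * b * ε < 1)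
    (hRC : 3 * ε ≤ R)
    (hhop : ∀ X, hop' (rotBFL (fun y => u (blockBase L y)) (fun _ => hu _) X) = rotBFL u hu (hop X))
    (hCt : ∀ Y : BField d 𝔸, ‖Y‖ < R → Ct' (rotBFL u hu Y) = rotBFL (fun y => u (blockBase L y)) (fun _ => hu _) (Ct Y))
    (hper : ∀ (z v : Fin d → ℤ), u (z + ((L * N : ℕ) : ℤ) • v) = u z)
    (hhopW : ∀ X ∈ perBF d 𝔸 N, hop X ∈ perBF d 𝔸 (L * N)) (hCtW : ∀ Y ∈ perBF d 𝔸 (L * N), Ct Y ∈ perBF d 𝔸 N)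
    (hhopW' : ∀ X ∈ perBF d 𝔸 N, hop' X ∈ perBF d 𝔸 (L * N)) (hCtW' : ∀ Y ∈ perBF d 𝔸 (L * N), Ct' Y ∈ perBF d 𝔸 N)
    {DtW DtW' : perBF d 𝔸 (L * N) → perBF d 𝔸 N}
    (hDWball : ∀ B : perBF d 𝔸 (L * N), ‖B‖ < ε → DtW B ∈ closedBall (0 : perBF d 𝔸 N) (4 * C₂ * ε ^ 2))
    (hDWfix : ∀ B : perBF d 𝔸 (L * N), ‖B‖ < ε →
      (⟨Ct (B - hop.restrict hhopW (DtW B) : perBF d 𝔸 (L * N)), hCtW _ (B - hop.restrict hhopW (DtW B)).2⟩ :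
        perBF d 𝔸 N) = DtW B)
    (hDWball' : ∀ B : perBF d 𝔸 (L * N), ‖B‖ < ε → DtW' B ∈ closedBall (0 : perBF d 𝔸 N) (4 * C₂ * ε ^ 2))
    (hDWfix' : ∀ B : perBF d 𝔸 (L * N), ‖B‖ < ε →
      (⟨Ct' (B - hop'.restrict hhopW' (DtW' B) : perBF d 𝔸 (L * N)), hCtW' _ (B - hop'.restrict hhopW' (DtW' B)).2⟩ :
        perBF d 𝔸 N) = DtW' B)
    {B : perBF d 𝔸 (L * N)} (hB : ‖B‖ < ε) :
    DtW' (rotBFLPer (L * N) u hu hper B) =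
      rotBFLPer N (fun y => u (blockBase L y)) (fun _ => hu _) (blockBase_periodic hper) (DtW B) :=
  Dt_gauge_sub (W𝒳 := perBF d 𝔸 N) (W𝒴 := perBF d 𝔸 (L * N))
    (V := rotBFL (fun y => u (blockBase L y)) (fun _ => hu _)) (U := rotBFL u hu) hC hC' hC₂ hb hHop hHop' hq hRC
    (norm_rotBFL u hu) (norm_rotBFL (fun y => u (blockBase L y)) (fun _ => hu _)) hhop hCt (isClosed_perBF N)
    hhopW hCtW hhopW' hCtW'
    (fun _ hX => rotBFL_mem_perBF (fun _ => hu _) (blockBase_periodic hper) hX)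
    (fun _ hX => rotBFL_symm_mem_perBF (fun _ => hu _) (blockBase_periodic hper) hX)
    (fun _ hY => rotBFL_mem_perBF hu hper hY) (fun _ hY => rotBFL_symm_mem_perBF hu hper hY)
    hDWball hDWfix hDWball' hDWfix' hB

end torusGauge

section torusGenuine

open B12LinearizationGenuineZd (BField hfield Cfield norm_hfield_le quadAnalytic_Cfield)
open B12Def267Covariance (rotBF norm_rotBF mem_U1_gaugeTransformZd plaq_gaugeTransformZd_le hfield_gaugeTransformZd
  Cfield_gaugeTransformZd)
open B7Prop1Explicit (U1)
open B12ContourAverage253 (omegaA)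
open Literature.MathematicalPhysics.QuantumLattice (ZdEdge blockBase plaquetteHolonomyZd gaugeTransformZd)

variable {d : ℕ} {𝔸 : Type*} [NormedRing 𝔸] [NormedAlgebra ℂ 𝔸] [NormOneClass 𝔸] [CompleteSpace 𝔸] {L : ℕ}
  (hL : 0 < L) (hd : 1 ≤ d) (V : ZdEdge d → 𝔸ˣ) (hV : ∀ b, V b ∈ U1 𝔸) {u : (Fin d → ℤ) → 𝔸ˣ}
  (hu : ∀ z, u z ∈ U1 𝔸) {ε₀ : ℝ} (hε₀ : 0 ≤ ε₀) (hsm : ((d : ℝ) * L) ^ 2 * ε₀ ≤ 1 / 200)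
  (h44 : ∀ (p : Fin d → ℤ) (i j : Fin d), i ≠ j → ‖((plaquetteHolonomyZd V p i j : 𝔸ˣ) : 𝔸) - 1‖ ≤ ε₀)
  (hbud : (L : ℝ) ^ d / L * (24 * omegaA d L ε₀) < 1) {N : ℕ}

/-- **Stability of `h` at `V^u` from stability at `V`**: if `h_V` maps `N`-periodic coarse fields to `LN`-periodic
fine fields and `u` is `LN`-periodic, so does `h_{V^u}` — by r09's covariance `h_{V^u}(R(u(L·))X) = R(u)h_V(X)`
(`hfield_gaugeTransformZd`) and the (2.16)-stability of the torus carrier. [cite: Balaban1987RG1, p.267, (2.16) p.269, (0.1) p.251] -/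
theorem hfield_mem_perBF_gauge (hper : ∀ (z v : Fin d → ℤ), u (z + ((L * N : ℕ) : ℤ) • v) = u z)
    (hhopW : ∀ X ∈ perBF d 𝔸 N, hfield hL hd V hV hε₀ hsm h44 hbud X ∈ perBF d 𝔸 (L * N))
    (X : BField d 𝔸) (hX : X ∈ perBF d 𝔸 N) :
    hfield hL hd (gaugeTransformZd u V) (mem_U1_gaugeTransformZd hV hu) hε₀ hsm (plaq_gaugeTransformZd_le V hu h44)
      hbud X ∈ perBF d 𝔸 (L * N) := by
  set X₀ : BField d 𝔸 := (rotBFL (fun y => u (blockBase L y)) (fun _ => hu _)).symm X with hX₀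
  have hX₀W : X₀ ∈ perBF d 𝔸 N := rotBFL_symm_mem_perBF (fun _ => hu _) (blockBase_periodic hper) hX
  have hXe : X = rotBFL (fun y => u (blockBase L y)) (fun _ => hu _) X₀ := by
    rw [hX₀, ContinuousLinearEquiv.apply_symm_apply]
  rw [hXe, rotBFL_apply, hfield_gaugeTransformZd hL hd V hV hu hε₀ hsm h44 hbud, ← rotBFL_apply]
  exact rotBFL_mem_perBF hu hper (hhopW X₀ hX₀W)

/-- **Stability of `C̃` at `V^u` from stability at `V`** (r09's `Cfield_gaugeTransformZd` + torus stability under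
(2.16)). [cite: Balaban1987RG1, p.267, (2.16) p.269, (0.1) p.251] -/
theorem Cfield_mem_perBF_gauge (hper : ∀ (z v : Fin d → ℤ), u (z + ((L * N : ℕ) : ℤ) • v) = u z)
    (hCtW : ∀ Y ∈ perBF d 𝔸 (L * N), Cfield hL hd V hV hε₀ hsm h44 Y ∈ perBF d 𝔸 N)
    (Y : BField d 𝔸) (hY : Y ∈ perBF d 𝔸 (L * N)) :
    Cfield hL hd (gaugeTransformZd u V) (mem_U1_gaugeTransformZd hV hu) hε₀ hsm (plaq_gaugeTransformZd_le V hu h44)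
      Y ∈ perBF d 𝔸 N := by
  set Y₀ : BField d 𝔸 := (rotBFL u hu).symm Y with hY₀
  have hY₀W : Y₀ ∈ perBF d 𝔸 (L * N) := rotBFL_symm_mem_perBF hu hper hY
  have hYe : Y = rotBFL u hu Y₀ := by rw [hY₀, ContinuousLinearEquiv.apply_symm_apply]
  rw [hYe, rotBFL_apply, Cfield_gaugeTransformZd hL hd V hV hu hε₀ hsm h44, ← rotBFL_apply]
  exact rotBFL_mem_perBF (fun _ => hu _) (blockBase_periodic hper) (hCtW Y₀ hY₀W)

/-- **[B12] p. 269 (2.16) FOR THE JACOBIAN OF (2.12) ON PRINT'S TORUS, FOR [I]'S GENUINE LETTERS.**  On the periodic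
sub-carriers of r09's `ℓ^∞(bonds of ℤᵈ; 𝔸)` — fine fields of period `LN` (`T⁽ᵏ⁾`), coarse fields of period `N`
(`T⁽ᵏ⁺¹⁾`) — at a bondwise-`U1`, `ε₀`-regular background `V` and an `LN`-periodic bondwise-`U1` gauge function `u`
(radius conditions `9C₂Hε < 1`, `3ε ≤ R` as in §7 (b)): for ANY solutions `D̃_V`, `D̃_{V^u}` of the p. 267 equation
in the ambient balls (they exist: `p267_genuine`), and under the TWO STABILITY BINDERS «`h_V` maps `N`-periodic to
`LN`-periodic», «`C̃_V` maps `LN`-periodic to `N`-periodic» (= translation covariance of r09's letters at an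
`LN`-periodic `V`; the same at `V^u` FOLLOWS: `hfield_mem_perBF_gauge`, `Cfield_mem_perBF_gauge`), THERE ARE
restricted solutions `D̃_W`, `D̃_W′ : perBF (LN) → perBF N` (the ambient ones co-restricted) such that on `‖B‖ < ε`:
(i) `D̃_W′(R(u)B) = R(u(L·))D̃_W(B)` and (ii) **`det DΦ_W′(R(u)B) = det DΦ_W(B)`** for the torus Jacobians
`DΦ_W = 1 − h_V∘DD̃_W` — a genuine determinant for finite-dimensional `𝔸` (`finiteDimensional_perBF`).  Every other
letter is r09's construction or theorem (`hfield`, `Cfield`, `quadAnalytic_Cfield`, `norm_hfield_le`,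
`hfield_gaugeTransformZd`, `Cfield_gaugeTransformZd`) or this file's (`rotBFL`, `perBF`, §§8–9).
[cite: Balaban1987RG1, p.267, (2.12) p.268, (2.16) p.269, (0.1) p.251] -/
theorem p269_det_genuineZd_per {ε : ℝ}
    (hq : 9 * (192000 * ((d : ℝ) * L) ^ 2) * (((L : ℝ) ^ d / L) / (1 - (L : ℝ) ^ d / L * (24 * omegaA d L ε₀))) * ε < 1)
    (hRC : 3 * ε ≤ 1 / (4800 * ((d : ℝ) * L)))
    (hper : ∀ (z v : Fin d → ℤ), u (z + ((L * N : ℕ) : ℤ) • v) = u z)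
    (hhopW : ∀ X ∈ perBF d 𝔸 N, hfield hL hd V hV hε₀ hsm h44 hbud X ∈ perBF d 𝔸 (L * N))
    (hCtW : ∀ Y ∈ perBF d 𝔸 (L * N), Cfield hL hd V hV hε₀ hsm h44 Y ∈ perBF d 𝔸 N)
    {DtV DtU : BField d 𝔸 → BField d 𝔸}
    (hDtV : ∀ B : BField d 𝔸, ‖B‖ < ε →
      DtV B ∈ closedBall (0 : BField d 𝔸) (4 * (192000 * ((d : ℝ) * L) ^ 2) * ε ^ 2) ∧
      Cfield hL hd V hV hε₀ hsm h44 (B - hfield hL hd V hV hε₀ hsm h44 hbud (DtV B)) = DtV B)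
    (hDtU : ∀ B : BField d 𝔸, ‖B‖ < ε →
      DtU B ∈ closedBall (0 : BField d 𝔸) (4 * (192000 * ((d : ℝ) * L) ^ 2) * ε ^ 2) ∧
      Cfield hL hd (gaugeTransformZd u V) (mem_U1_gaugeTransformZd hV hu) hε₀ hsm (plaq_gaugeTransformZd_le V hu h44)
          (B - hfield hL hd (gaugeTransformZd u V) (mem_U1_gaugeTransformZd hV hu) hε₀ hsm
            (plaq_gaugeTransformZd_le V hu h44) hbud (DtU B)) = DtU B) :
    ∃ DtW DtW' : perBF d 𝔸 (L * N) → perBF d 𝔸 N,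
      (∀ B : perBF d 𝔸 (L * N), ‖B‖ < ε →
        (DtW B : BField d 𝔸) = DtV B ∧ (DtW' B : BField d 𝔸) = DtU B) ∧
      ∀ B : perBF d 𝔸 (L * N), ‖B‖ < ε →
        DtW' (rotBFLPer (L * N) u hu hper B) =
          rotBFLPer N (fun y => u (blockBase L y)) (fun _ => hu _) (blockBase_periodic hper) (DtW B) ∧
        LinearMap.det ((fderiv ℂ (fun B : perBF d 𝔸 (L * N) => B -
            (hfield hL hd (gaugeTransformZd u V) (mem_U1_gaugeTransformZd hV hu) hε₀ hsm
              (plaq_gaugeTransformZd_le V hu h44) hbud).restrict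
              (hfield_mem_perBF_gauge hL hd V hV hu hε₀ hsm h44 hbud hper hhopW) (DtW' B))
            (rotBFLPer (L * N) u hu hper B) : perBF d 𝔸 (L * N) →L[ℂ] perBF d 𝔸 (L * N)) :
              perBF d 𝔸 (L * N) →ₗ[ℂ] perBF d 𝔸 (L * N)) =
          LinearMap.det ((fderiv ℂ (fun B : perBF d 𝔸 (L * N) => B -
            (hfield hL hd V hV hε₀ hsm h44 hbud).restrict hhopW (DtW B)) B :
              perBF d 𝔸 (L * N) →L[ℂ] perBF d 𝔸 (L * N)) : perBF d 𝔸 (L * N) →ₗ[ℂ] perBF d 𝔸 (L * N)) := by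
  have hC := quadAnalytic_Cfield hL hd V hV hε₀ hsm h44
  have hC' := quadAnalytic_Cfield hL hd (gaugeTransformZd u V) (mem_U1_gaugeTransformZd hV hu) hε₀ hsm
    (plaq_gaugeTransformZd_le V hu h44)
  have hC₂ : (0 : ℝ) ≤ 192000 * ((d : ℝ) * L) ^ 2 := by positivity
  have hb := B12B0RestrictionAverage267.H_nonneg L d hbud
  have hHop := norm_hfield_le hL hd V hV hε₀ hsm h44 hbud
  have hHop' := norm_hfield_le hL hd (gaugeTransformZd u V) (mem_U1_gaugeTransformZd hV hu) hε₀ hsm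
    (plaq_gaugeTransformZd_le V hu h44) hbud
  have hhopW' := hfield_mem_perBF_gauge hL hd V hV hu hε₀ hsm h44 hbud hper hhopW
  have hCtW' := Cfield_mem_perBF_gauge hL hd V hV hu hε₀ hsm h44 (N := N) hper hCtW
  obtain ⟨DtW, hDtW⟩ := exists_Dt_subcarrier (W𝒳 := perBF d 𝔸 N) (W𝒴 := perBF d 𝔸 (L * N)) hC hC₂ hb hHop hq
    hRC (fun B hB => (hDtV B hB).1) (fun B hB => (hDtV B hB).2) (isClosed_perBF N) hhopW hCtW
  obtain ⟨DtW', hDtW'⟩ := exists_Dt_subcarrier (W𝒳 := perBF d 𝔸 N) (W𝒴 := perBF d 𝔸 (L * N)) hC' hC₂ hb hHop'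
    hq hRC (fun B hB => (hDtU B hB).1) (fun B hB => (hDtU B hB).2) (isClosed_perBF N) hhopW' hCtW'
  refine ⟨DtW, DtW', fun B hB => ⟨(hDtW B hB).2.2, (hDtW' B hB).2.2⟩, fun B hB => ⟨?_, ?_⟩⟩
  · exact Dt_gauge_per hu hC hC' hC₂ hb hHop hHop' hq hRC
      (hfield_gaugeTransformZd hL hd V hV hu hε₀ hsm h44 hbud)
      (fun Y _ => Cfield_gaugeTransformZd hL hd V hV hu hε₀ hsm h44 Y)
      hper hhopW hCtW hhopW' hCtW' (fun B hB => (hDtW B hB).1) (fun B hB => (hDtW B hB).2.1)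
      (fun B hB => (hDtW' B hB).1) (fun B hB => (hDtW' B hB).2.1) hB
  · exact det_fderiv_phi_gauge_per hu hC hC' hC₂ hb hHop hHop' hq hRC
      (hfield_gaugeTransformZd hL hd V hV hu hε₀ hsm h44 hbud)
      (fun Y _ => Cfield_gaugeTransformZd hL hd V hV hu hε₀ hsm h44 Y)
      hper hhopW hCtW hhopW' hCtW' (fun B hB => (hDtW B hB).1) (fun B hB => (hDtW B hB).2.1)
      (fun B hB => (hDtW' B hB).1) (fun B hB => (hDtW' B hB).2.1) hB

end torusGenuine

end Literature.MathematicalPhysics.QuantumFieldTheory.Balaban1983to89.B12JacobianGauge269
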